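import Summits.QuantumFields.YangMills.Theses.PencilRigidity
import Literature.MathematicalPhysics.QuantumFieldTheory.YangMillsOS
import Literature.MathematicalPhysics.QuantumLattice.WilsonBlockHeatBathLightCone2
import Summits.QuantumFields.YangMills.Theorems.PencilRigidityWeakCouplingHypercubicLimitStubTraceHolder
import Summits.QuantumFields.YangMills.Theorems.PencilRigidityWeakCouplingHypercubicLimitStubPressureForcesGap
import Summits.QuantumFields.YangMills.Theorems.PencilRigidityWeakCouplingHypercubicLimitStubRateBookkeeping
import Summits.QuantumFields.YangMills.Theorems.PencilRigidityWeakCouplingHypercubicLimitStubPerpContraction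
import Summits.QuantumFields.YangMills.Theorems.PencilRigidityWeakCouplingHypercubicLimitStubTraceCluster
import Summits.QuantumFields.YangMills.Theorems.PencilRigidityWeakCouplingHypercubicLimitStubTimeSlicing
import Summits.QuantumFields.YangMills.Theorems.PencilRigidityWeakCouplingHypercubicLimitStubFiniteTruncation
import Summits.QuantumFields.YangMills.Theorems.PencilRigidityWeakCouplingHypercubicLimitStubSpectralData
import Summits.QuantumFields.YangMills.Theorems.PencilRigidityWeakCouplingHypercubicLimitStubSliceKernel
import Summits.QuantumFields.YangMills.Theorems.PencilRigidityWeakCouplingHypercubicLimitStubSlabContraction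
import Summits.QuantumFields.YangMills.Theorems.PencilRigidityWeakCouplingHypercubicLimitStubTransferRepresentation
import Summits.QuantumFields.YangMills.Theorems.PencilRigidityWeakCouplingHypercubicLimitColdPressureClustering
import Summits.QuantumFields.YangMills.Theorems.PencilRigidityWeakCouplingHypercubicLimitSiblingTie
import Summits.QuantumFields.YangMills.Theorems.CoincidenceRotationBootstrapHypercubicLimitOneFieldWeak
import Summits.QuantumFields.YangMills.Theorems.PencilRigidityWeakCouplingHypercubicLimitStubRatioOfColdPressure
import Summits.QuantumFields.YangMills.Theorems.PencilRigidityWeakCouplingHypercubicLimitStubRelativeBookkeeping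
import Summits.QuantumFields.YangMills.Theorems.PencilRigidityWeakCouplingHypercubicLimitStubBlockReversalTranspose
import Summits.QuantumFields.YangMills.Theorems.PencilRigidityWeakCouplingHypercubicLimitStubWilsonStepReversal
import Summits.QuantumFields.YangMills.Theorems.PencilRigidityWeakCouplingHypercubicLimitStubKernelOpTranspose
import Summits.QuantumFields.YangMills.Theorems.PencilRigidityWeakCouplingHypercubicLimitStubRpSpectralOfColdPressure
import Literature.MathematicalPhysics.QuantumFieldTheory.WilsonTransferKernel
import Literature.MathematicalPhysics.QuantumFieldTheory.SlabTransferKernel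
import Literature.MathematicalPhysics.QuantumFieldTheory.TorusFreeTransfer
import Literature.MathematicalPhysics.QuantumFieldTheory.LatticeGaugeProofs
import Literature.MathematicalPhysics.QuantumLattice.GaugeGroups
import Literature.MathematicalPhysics.QuantumLattice.LatticeGaugeDLR
import Summits.QuantumFields.YangMills.Theorems.MirrorModularBoostsHypercubicLimitClosureHalvesDefs
import Summits.QuantumFields.YangMills.Theorems.MirrorModularBoostsHypercubicLimitPlaneLimitsOfBound
import Summits.QuantumFields.YangMills.Theorems.LangevinControlUVOSLegsAtWeakCouplingCStubCluster
import Summits.QuantumFields.YangMills.Theorems.PencilRigidityWeakCouplingHypercubicLimitRPPosOfPlaneLimits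
import Summits.QuantumFields.YangMills.Theorems.PencilRigidityWeakCouplingHypercubicLimitSignedPerm
import Summits.QuantumFields.YangMills.Theorems.PencilRigidityWeakCouplingHypercubicLimitDecayOfRPSpectral
import Summits.QuantumFields.YangMills.Theorems.MirrorModularBoostsHypercubicLimitFunctionalBoundPlanes
import Summits.QuantumFields.YangMills.Theorems.MirrorModularBoostsHypercubicLimitSoftLegsAssemblyMono
import Summits.QuantumFields.YangMills.Theorems.MirrorModularBoostsHypercubicLimitTranslationPlanes
import Summits.QuantumFields.YangMills.Theorems.PencilRigidityWeakCouplingHypercubicLimitIRInputsOfColdPressure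
import Summits.QuantumFields.YangMills.Theorems.MirrorModularBoostsHypercubicLimitOfLineInputs
import Summits.QuantumFields.YangMills.Theorems.PencilRigidityWeakCouplingHypercubicLimitStubVolumeFloor
import Summits.QuantumFields.YangMills.Theorems.PencilRigidityWeakCouplingHypercubicLimitOfLatticeCore
import Summits.QuantumFields.YangMills.Theorems.PencilRigidityWeakCouplingHypercubicLimitStubIrInputsRecentre
import Summits.QuantumFields.YangMills.Theorems.PencilRigidityWeakCouplingHypercubicLimitGevreyMomentBounds
import Summits.QuantumFields.YangMills.Theorems.PencilRigidityWeakCouplingHypercubicLimitOfGevreySkewCore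
import Summits.QuantumFields.YangMills.Theorems.PencilRigidityWeakCouplingHypercubicLimitOfUfbSkewCore
import Summits.QuantumFields.YangMills.Theorems.PencilRigidityWeakCouplingHypercubicLimitOfUfbCore
import Summits.QuantumFields.YangMills.Theorems.FradkinShenkerFlowFiniteSusceptibilityWeakCouplingMirrorLogConvex
import Summits.QuantumFields.YangMills.Theorems.PencilRigidityWeakCouplingHypercubicLimitStubRpSpectralAnti
import Summits.QuantumFields.YangMills.Theorems.PencilRigidityWeakCouplingHypercubicLimitStubMirrorOfRPSpectral
import Summits.QuantumFields.YangMills.Theorems.PencilRigidityWeakCouplingHypercubicLimitStubConvexWindow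
import Summits.QuantumFields.YangMills.Theorems.PencilRigidityWeakCouplingHypercubicLimitStubMirrorDomination
import Summits.QuantumFields.YangMills.Theorems.PencilRigidityWeakCouplingHypercubicLimitStubGapOfRPSpectral
import Summits.QuantumFields.YangMills.Theorems.PencilRigidityWeakCouplingHypercubicLimitOfRpCore
import Summits.QuantumFields.YangMills.Theorems.PencilRigidityWeakCouplingHypercubicLimitStubDisjointOfLatticeFloor
import Summits.QuantumFields.YangMills.Theorems.PencilRigidityWeakCouplingHypercubicLimitStubCompactOfDisjoint
import Summits.QuantumFields.YangMills.Theorems.PencilRigidityWeakCouplingHypercubicLimitStubLocaliseOfCompact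
import Summits.QuantumFields.YangMills.Theorems.PencilRigidityWeakCouplingHypercubicLimitStubSeparatingCoordinate
import Summits.QuantumFields.YangMills.Theorems.PencilRigidityWeakCouplingHypercubicLimitStubTimeSeparatedOfSeparated
import Summits.QuantumFields.YangMills.Theorems.PencilRigidityWeakCouplingHypercubicLimitOfRpCoreDisjoint
import Literature.MathematicalPhysics.QuantumLattice.SchwartzTranslationCutoff
import Literature.MathematicalPhysics.QuantumFieldTheory.OSSkeletonExplicitBounds
import Summits.QuantumFields.YangMills.Theses.MirrorModularBoosts
import Summits.QuantumFields.YangMills.Theorems.PencilRigidityDiagonalMirrorRPRStubRpClosureDefs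
import Summits.QuantumFields.YangMills.Theorems.PencilRigidityWeakCouplingHypercubicLimitRPOfRpCoreDisjoint
import Summits.QuantumFields.YangMills.Theorems.HypercubicLimit.Negative.ExtendByZero
import Summits.QuantumFields.YangMills.Theorems.MirrorModularBoostsHypercubicLimitPlaneLimitsDefs
import Summits.QuantumFields.YangMills.Theorems.DiagonalMirrorRPROddTorusSwapPairingDefs
import Summits.QuantumFields.YangMills.Theorems.PencilRigidityWeakCouplingHypercubicLimitRPDiagRPOfSwapPairing

/-!
# Line `Sketch` for the FOLD crux `WeakCouplingHypercubicLimitRP` (stmt-QuantumFields-27398, route PencilRigidity) =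
# the registered line `Sketch` of the aside crux `WeakCouplingHypercubicLimit` (stmt-QuantumFields-16120) + exactly ONE new stub

FOLD (shape F; director-ym O4 WORD 1–2, operator R678/R680, 2026-08-31; line-writer `linewriter-16120F-1` g0).  The crux is RE-TYPED as
`Summit.QuantumFields.YangMills.Theses.PencilRigidity.WeakCouplingHypercubicLimitRP` := the body of the old crux
`PencilRigidity.WeakCouplingHypercubicLimit` (stmt-16120, now an `aside` of the route, still defined) with ONE conjunct inserted after
`sch.HasWeakCouplingLimit ∧`: reflection positivity of the curvature channel `n ↦ S n (curvature,…)` of THE SAME witness in pull-back form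
`∘ linActMulti R` for every frame `R e₀ = a e₀ + b e₁`, `a² = b² = ½` (the four oriented diagonal mirrors; for a one-field family this is the
LANDED predicate `Cruxes.DiagonalMirrorRPR.ParityBridgeColdTraces.DiagonalFrameRP`, cited, not restated).  EVERYTHING of the stmt-16120
skeleton below (§§1–11, sections R10–R17, the heart S6i `stub_rpCoreDisjoint`, the ≈ 50 LANDED stubs, the old compositions
`WeakCouplingHypercubicLimit_of` / `…_ofSWS`) CARRIES OVER VERBATIM: those theorems conclude statements about the construction
`(subseq sch φ hφ, planeSum T)` or the old decl, which the FOLD keeps true (new ⟹ old: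
`Theorems/WeakCouplingHypercubicLimitRP/Negative/SummitTie.lean`, `weakCouplingHypercubicLimit_of_weakCouplingHypercubicLimitRP`).
The DELTA is §12 (section R18, kit `pub/ym-o4cluster/tenure-10604-restate-1/kit/handover/HFLineCore.lean` with the kit's local term def
replaced by the route decl):
  D1′ `stub_oddTorusSwapPairingLiminf` [OPEN — THE ONE NEW STUB after the ρ1 RESHAPE v2, 2026-08-31] the LATTICE statement: along the
      subsequence `φ` of the witness scheme, the swap-mirror Gram pairings of compact half-space curvature products on the scheme's OWN odd
      tori have `liminf ≥ 0` (`OddTorusSwapPairingLiminf r (subseq sch φ hφ)`, the landed def of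
      `Theorems/DiagonalMirrorRPROddTorusSwapPairingDefs.lean`, cited BY NAME); hypotheses = D1's = the core's.
  D1  `diagRPOfPlaneLimits_of_stubs` [PROVED HERE modulo D1′ — was the registered stub `stub_diagRPOfPlaneLimits` of v1 7bf38c709623ad77]
      diagonal-frame RP of the constructed plane-limit family `planeSum T` (beside its LANDED axis twin R3′ `stub_rpPosOfPlaneLimits`), from D1′ by
      the LANDED transfer `diagRPOfPlaneLimits_of_swapPairingLiminf` (p827255: own-torus swap symmetry p827142, convergence along `φ`, frames by
      proper sign flips, density closure, complexification).
  `oneFieldClausesRP_of_ufbDisjointCore` [= the LANDED `oneFieldClauses_of_ufbDisjointCore` (p149207) with the extra output `DiagonalFrameRP S₁`,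
      proof verbatim + one call of D1 — needed because the landed statement hides `φ, T` behind `∃ sch' S₁`; LANDED in D1-parametric form
      `oneFieldClausesRP_of_ufbDisjointCore_of_diagRP` (p825896) and instantiated here at D1].
  packaging `weakCouplingHypercubicLimitRP_of_oneFieldRP` [LANDED p825644, cited] one-field witness + `OneFieldClauses` + `DiagonalFrameRP` ⇒ the new
      crux (silence the other species, extend by zero; the new bullet via `extendByZero_const`).
  `weakCouplingHypercubicLimitRP_of_diagRP_of_rpCoreDisjoint` [LANDED p825896, cited] D1 ⇒ the SAME disjoint RP core as
      `weakCouplingHypercubicLimit_of_rpCoreDisjoint` (= the statement of S6i verbatim) ⇒ the new crux; NEW TOP COMPOSITION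
      `WeakCouplingHypercubicLimitRP_of := weakCouplingHypercubicLimitRP_of_diagRP_of_rpCoreDisjoint diagRPOfPlaneLimits_of_stubs stub_rpCoreDisjoint`
      (the kit's `weakCouplingHypercubicLimitRP_of_rpCoreDisjoint stub_rpCoreDisjoint` with D1 explicit) — the only theorem here concluding the new crux.
OPEN STUBS after the FOLD and the ρ1 reshape (v2): S6i `stub_rpCoreDisjoint` (the heart, unchanged, `∃`-form, monotone) and D1′
`stub_oddTorusSwapPairingLiminf` (D1 `diagRPOfPlaneLimits_of_stubs` is a theorem modulo D1′).
Hardest stub: S6i (the Clay existence-and-gap content); D1 is the 45°-universality / boundary-condition-insensitivity content of the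
weak-coupling limit (a straight 4-torus carries no diagonal mirror pair — tree negatives `Negative/SquareTorusNotSwapRP`, `OddTorusTwist` —
so Osterwalder–Seiler positivity does not hand it over the way it hands over `RPPos`; doors: (B) sign-twisted diagonal trace on the odd
straight torus ⇒ `OddTorusSwapPairingLiminf` ⇒ landed rp-closure; (A) tilted tori `Λ_L^U`, `U = sgn K₁`, which ARE diagonally swap-RP
(`Literature/…/TiltedTorusSwapRP`) + uniqueness of the infinite-volume state at weak coupling; (C) full `SO(4)` invariance of the limit,
then `isReflectionPositive_comp_diagFrame` of the SummitTie applies verbatim).  ON PATH: `YangMills ⟹ WeakCouplingHypercubicLimitRP`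
(SummitTie), so the new conjunct admits no junk disproof; every `_false_without_<H>` theorem of `Cruxes/WeakCouplingHypercubicLimit/Disproof.lean`
on the old decl transfers through new ⟹ old.  Critic's price ρ1 (idea-crit-9 g12) rides D1's docstring.
HONEST LABEL: a re-typing; nothing is proved by it; ⟨16120⟩ is an aside, ⟨27398⟩ is OPEN; the Yang–Mills mass gap is NOT proved.

# (carried over verbatim) the stmt-16120 skeleton:
# Line `Sketch` = card `trace-norm-cold-pressure` ("un-gauge by the trace") — checked skeleton for
crux stmt-QuantumFields-16120
(`Summit.QuantumFields.YangMills.Theses.PencilRigidity.WeakCouplingHypercubicLimit`: the existence leg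
at weak coupling in one-field gauge — every clause of the revised `YangMills` but the rotation half of
E1, with `HasLatticeMassGap r sch Δ` as its IR clause).

LEADS `prover-line-stmt-QuantumFields-16120-0` (r0–r2), `…-c1-0` (r3–r6), `…-c2-0` (r7: the IR lever factored out
and LANDED importable, p127195; the by-name sibling tie with stmt-16154 LANDED, p127226; heart S6b unchanged), `…-c3-0` (r8:
the heart re-stated in ONE-FIELD form without `let`/`letI` (registry repair; the one-field clause is gone — the landed
`hypercubicLimit_iff_oneFieldWeak` + `stub_siblingTie` carry the composition), and the IR lever EXTENDED: cold pressure ⇒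
the RP-spectral relative clustering of reflected slab functionals (`GapData` (iii-b) / `IRInputs` (b) of the 8646/16154 hosts),
new stubs R1–R6 of §5; r9: ALL of R1–R6 LANDED — the only `sorry` is the heart S6c) (gen 1, 2026-08-16).  The line handed over is the crux-ideate
sketch `SketchIdeator1.lean` (two first lemmas: `TraceClusterBound` typed, `pressureForcesGap` proved); it
is RESHAPED here into a registered skeleton (r0 18:48Z; r1: S1–S5 LANDED and wired in; r2: the open stub S6
SPLIT, using the new Literature defs `WilsonTransferKernel` (p122266), into the provable transfer
representation S6a and the open heart S6b in free-energy form — the ONLY open content).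
HONEST SCOPE: the lever is an IR-leg reduction — the
all-observable, volume-uniform lattice mass-gap clause follows from ONE exponential bound on cold-torus
trace excesses of the normalised transfer semigroup, by finite-dimensional trace inequalities; the whole
open content of the crux (existence at weak coupling + the cold-pressure bound (P_k) in transfer form)
is ONE stub, `stub_coldTransferData` (S6), stated as the crux with its last conjunct replaced.

## Stubs
  S1 `stub_traceHolder`       [S, LANDED p121053]  |tr(S M)| ≤ tr S · ‖M‖ for positive `S` (finite-dimensional trace Hölder).
  S2 `stub_perpContraction`   [M, LANDED p121560]  tr Tᵐ − 1 ≤ V C e^{−μm} (m ≥ m₀) ⇒ ‖T v‖ ≤ e^{−μ}‖v‖ on Ω^⊥ (spectral thm + S4).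
  S3 `stub_traceCluster`      [M, LANDED p121610 (lead)]  the card's `TraceClusterBound` with general exponents (a, b, p, q, N).
  S4 `stub_pressureForcesGap` [LANDED p121166; proved in the sketch] "m → ∞ kills the volume".
  S5 `stub_rateBookkeeping`   [S, LANDED p121384]  real analysis: cold-pressure bounds + r ≤ e^{−μ} + volume floor ⇒ C(A,B) e^{−μ n}.
  S6 (r0/r1) `stub_coldTransferData` — RESHAPED at r2 into S6a + S6b:
  S6a `stub_transferRepresentation` [L/XL, provable: OperatorTheory toolkit + WilsonTransferKernel defs p122266]
      — RESHAPED at r3 (continuation lead `prover-line-stmt-QuantumFields-16120-c1-0`) into FIVE independently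
      provable registered stubs + the glue held by the lead:
      T1 `stub_timeSlicing` [M] · T2 `stub_sliceKernel` [M/L] · T4 `stub_slabContraction` [L, abstract] ·
      T3a `stub_spectralData` [L, abstract] · T3b `stub_finiteTruncation` [L, abstract, Mathlib-only];
      r4: the glue `stub_transferRepresentation` PROVED from T1, T2, T4, T3a, T3b; r6: ALL of T1, T2, T4, T3a, T3b and the
      glue LANDED under Theorems (references below) — the ONLY open stub is S6b `stub_coldPressure` (the heart).
  IR lever `stub_latticeGapOfColdPressure` [r7, LANDED p127195]: cold pressure + volume floor along a scheme ⇒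
      `HasLatticeMassGap r sch Δ` (the IR half of the r6 composition; scheme-free and lattice-units forms in the same file).
  record `stub_siblingTie` [r7, LANDED p127226]: this crux ⇔ `CoincidenceRotationBootstrap.HypercubicLimit` (stmt-16154) by name.
  S6b `stub_coldPressure` [OPEN, the heart: the crux with `HasLatticeMassGap` replaced by the cold-pressure bound on
      `traceExcess` + volume floor].  (r0/r1 text of S6, for the record:) the crux with `HasLatticeMassGap r sch Δ` replaced by:
     a volume floor on `sch.L`, and for every pair of bounded observables, eventually in `k`, on every
     torus `S' ≥ L_k`, every `n ≤ S'` with `w < n`, `2w ≤ S'`: a trace-excess function `X ≥ 0` with the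
     cold-pressure bound for `2m ≥ S'+1` and, for every `ε > 0`, a finite-dimensional positive transfer
     model `(T, Ω, Ao, Bo)` (spectral truncation of the Osterwalder–Seiler–Lüscher transfer operator of
     Wilson's theory on the spatial torus `(2S'+1)³`, observables of time-width `≤ w` as dressed w-step
     operators, kernel domination ‖Ao‖ ≤ ‖A‖∞) reproducing the torus correlation to `ε`.
  Composition `WeakCouplingHypercubicLimit_of` (r7): S6b gives witnesses and every non-IR clause verbatim; the IR
  clause is `stub_latticeGapOfColdPressure` (inside which, per `(A, B)`: a priori bound when `n ≤ w` or `S' < 2w`,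
  else S2 → S3 on each finite model of `stub_transferRepresentation` → `ε → 0` → S5).
  LEAD c6 (`…-c6-0`, 2026-08-17), reshape r14 (§9): `RPSpectral ⇒ HasLatticeMassGap` by odd-torus reflection positivity
  (mirror correlators non-negative + step-one log-convex + periodic fold, landed for stmt-9442), so the heart LOSES its
  `HasLatticeMassGap` conjunct: S6h `stub_rpCore`; new provable stubs K1 `stub_rpSpectralAnti`, K2 `stub_mirrorOfRPSpectral`,
  K3 `stub_convexWindow`, K4 `stub_mirrorDomination`, K5 `stub_gapOfRPSpectral` (lead); `stub_ufbCore` is now PROVED from them.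
  LEAD c7 (`…-c7-0`, 2026-08-17), reshape r15 (§10): the `κ₃` floor of the heart relaxed to PAIRWISE-DISJOINT geometry (`IRInputs` (d)
  verbatim) — the time separation that non-triviality needs is produced from the continuity and the Euclidean symmetries (E3,
  translations, `W(B₄)`) of the limit family: new provable stubs N1 `stub_disjointOfLatticeFloor`, N2a `stub_compactOfDisjoint`,
  N2b `stub_localiseOfCompact`, N3a `stub_separatingCoordinate`, N3b `stub_timeSeparatedOfSeparated`; heart S6i `stub_rpCoreDisjoint`
  (monotone: `rpCoreDisjoint_of_rpCore`); composition `weakCouplingHypercubicLimit_of_rpCoreDisjoint`.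
  r16: ALL of N1 (p147724), N2a (p147763), N2b (p147984), N3a (p147785), N3b (p147332) and the assembly (p149207,
  Theorems/…OfRpCoreDisjoint.lean) LANDED — the only `sorry` is the heart S6i `stub_rpCoreDisjoint`.
  LEAD c8 (`…-c8-0`, 2026-08-17), reshape r17 (§11): the heart now has FILED SUPPLIERS — the planners split the promoted core
  along the renormalisation seam into the three crux items of route `ScalingWindowSplit` (W₁ `GapAtCorrelationLength`
  stmt-18927, U_R `SelfNormalisedMomentBoundsR` stmt-18014, W₂ᴳ `SelfNormalisedSkewnessGapped` stmt-18170); new registered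
  sub-goal V1 `stub_rpCoreDisjointOfSWS` (W₁ → U_R → W₂ᴳ → the heart VERBATIM; LANDED p163229, this seat) and the second composition
  `WeakCouplingHypercubicLimit_ofSWS` (crux from the three items through the line).  The heart S6i stays the single open stub
  (weakest, `∃`-form; monotone).
-/

noncomputable section

open scoped BigOperators Topology InnerProductSpace SchwartzMap
open MeasureTheory Filter
open Literature.MathematicalPhysics.QuantumFieldTheory Literature.MathematicalPhysics.QuantumLattice
open Literature.MathematicalPhysics.AQFT

namespace Summit.QuantumFields.YangMills.Cruxes.WeakCouplingHypercubicLimit.TraceNormColdPressure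

/-! ### §1 Finite-dimensional spectral stubs (provable now) -/

/-- `stub_traceHolder` (S1) — **finite-dimensional trace Hölder inequality**: for a positive operator
`S` and any operator `M` on `ℝᵈ`, `|tr(S M)| ≤ tr(S)·‖M‖` (diagonalise `S = Σ λᵢ |eᵢ⟩⟨eᵢ|`, `λᵢ ≥ 0`:
`tr(S M) = Σ λᵢ ⟨eᵢ, M eᵢ⟩`).  Simon, *Trace ideals*, Thm 3.1-type bound in finite dimension. -/
theorem stub_traceHolder :
    ∀ (d : ℕ) (S M : EuclideanSpace ℝ (Fin d) →L[ℝ] EuclideanSpace ℝ (Fin d)), S.IsPositive →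
      |LinearMap.trace ℝ _ (↑(S * M) : EuclideanSpace ℝ (Fin d) →ₗ[ℝ] EuclideanSpace ℝ (Fin d))| ≤ LinearMap.trace ℝ _ (↑(S) : EuclideanSpace ℝ (Fin d) →ₗ[ℝ] EuclideanSpace ℝ (Fin d)) * ‖M‖ :=
  -- LANDED (wave 1, p121053): Theorems/PencilRigidityWeakCouplingHypercubicLimitStubTraceHolder.lean
  _root_.Summit.QuantumFields.YangMills.Theorems.WeakCouplingHypercubicLimit.TraceNormColdPressure.stub_traceHolder

/-- `stub_perpContraction` (S2) — **the gap read off the trace excess** (finite-dimensional): `T ≥ 0`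
with a normalised fixed vector `Ω`, contracting on `Ω^⊥`; if `tr Tᵐ − 1 ≤ V·C·e^{−μ m}` for all
`m ≥ m₀` (any prefactor `V > 0`), then `‖T v‖ ≤ e^{−μ} ‖v‖` on `Ω^⊥` (eigenbasis of `R := T − |Ω⟩⟨Ω|`,
`tr Rᵐ = Σ ρᵢᵐ`, then `stub_pressureForcesGap`). -/
theorem stub_perpContraction :
    ∀ (d : ℕ) (T : EuclideanSpace ℝ (Fin d) →L[ℝ] EuclideanSpace ℝ (Fin d)) (Ω : EuclideanSpace ℝ (Fin d)) (μ V C : ℝ) (m₀ : ℕ),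
      T.IsPositive → ‖Ω‖ = 1 → T Ω = Ω → (∀ v, inner ℝ Ω v = 0 → ‖T v‖ ≤ ‖v‖) → 0 < V →
      (∀ m : ℕ, m₀ ≤ m → LinearMap.trace ℝ _ (↑(T ^ m) : EuclideanSpace ℝ (Fin d) →ₗ[ℝ] EuclideanSpace ℝ (Fin d)) - 1 ≤ V * C * Real.exp (-(μ * m))) →
      ∀ v, inner ℝ Ω v = 0 → ‖T v‖ ≤ Real.exp (-μ) * ‖v‖ :=
  -- LANDED (wave 1, p121560): Theorems/PencilRigidityWeakCouplingHypercubicLimitStubPerpContraction.lean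
  _root_.Summit.QuantumFields.YangMills.Theorems.WeakCouplingHypercubicLimit.TraceNormColdPressure.stub_perpContraction

/-- `stub_traceCluster` (S3) — **the trace cluster bound, general exponents** (the card's first lemma
`TraceClusterBound`, reshaped): `T ≥ 0` on `ℝᵈ`, `T Ω = Ω`, `‖Ω‖ = 1`, `‖T v‖ ≤ r‖v‖` on `Ω^⊥`
(`0 ≤ r ≤ 1`); if the trace excesses are bounded, `tr Tᵃ − 1 ≤ Xa`, `tr Tᴺ − 1 ≤ XN`, `tr Tᵖ − 1 ≤ Xp`,
`tr Tᵠ − 1 ≤ Xq`, then with `Z := tr Tᴺ`,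
`|tr(Tᵃ A Tᵇ B)/Z − (tr(Tᵖ A)/Z)(tr(Tᵠ B)/Z)| ≤ ‖A‖‖B‖ (rᵇ(1 + Xa) + rᵃ + XN + Xp + Xq + Xp · Xq)`.
Proof: `Tᵐ = P_Ω + R_m` with `R_m ≥ 0`, `‖R_m‖ ≤ rᵐ`, `tr R_m = tr Tᵐ − 1 ≥ 0`; expand the four terms,
`stub_traceHolder`, `|⟨Ω, M Ω⟩| ≤ ‖M‖`, `Z = 1 + (tr Tᴺ − 1) ≥ 1`.  The card's `TraceClusterBound`
(`p = q = N = a + b`, constant `3 X N`) is the special case up to the term `X N²`. -/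
theorem stub_traceCluster :
    ∀ (d : ℕ) (T A B : EuclideanSpace ℝ (Fin d) →L[ℝ] EuclideanSpace ℝ (Fin d)) (Ω : EuclideanSpace ℝ (Fin d)) (r Xa XN Xp Xq : ℝ)
      (a b p q N : ℕ),
      T.IsPositive → ‖Ω‖ = 1 → T Ω = Ω → 0 ≤ r → r ≤ 1 →
      (∀ v, inner ℝ Ω v = 0 → ‖T v‖ ≤ r * ‖v‖) →
      LinearMap.trace ℝ _ (↑(T ^ a) : EuclideanSpace ℝ (Fin d) →ₗ[ℝ] EuclideanSpace ℝ (Fin d)) - 1 ≤ Xa →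
      LinearMap.trace ℝ _ (↑(T ^ N) : EuclideanSpace ℝ (Fin d) →ₗ[ℝ] EuclideanSpace ℝ (Fin d)) - 1 ≤ XN →
      LinearMap.trace ℝ _ (↑(T ^ p) : EuclideanSpace ℝ (Fin d) →ₗ[ℝ] EuclideanSpace ℝ (Fin d)) - 1 ≤ Xp →
      LinearMap.trace ℝ _ (↑(T ^ q) : EuclideanSpace ℝ (Fin d) →ₗ[ℝ] EuclideanSpace ℝ (Fin d)) - 1 ≤ Xq →
      |LinearMap.trace ℝ _ (↑(T ^ a * A * T ^ b * B) : EuclideanSpace ℝ (Fin d) →ₗ[ℝ] EuclideanSpace ℝ (Fin d)) / LinearMap.trace ℝ _ (↑(T ^ N) : EuclideanSpace ℝ (Fin d) →ₗ[ℝ] EuclideanSpace ℝ (Fin d)) -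
          LinearMap.trace ℝ _ (↑(T ^ p * A) : EuclideanSpace ℝ (Fin d) →ₗ[ℝ] EuclideanSpace ℝ (Fin d)) / LinearMap.trace ℝ _ (↑(T ^ N) : EuclideanSpace ℝ (Fin d) →ₗ[ℝ] EuclideanSpace ℝ (Fin d)) *
            (LinearMap.trace ℝ _ (↑(T ^ q * B) : EuclideanSpace ℝ (Fin d) →ₗ[ℝ] EuclideanSpace ℝ (Fin d)) / LinearMap.trace ℝ _ (↑(T ^ N) : EuclideanSpace ℝ (Fin d) →ₗ[ℝ] EuclideanSpace ℝ (Fin d)))| ≤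
        ‖A‖ * ‖B‖ * (r ^ b * (1 + Xa) + r ^ a + XN + Xp + Xq + Xp * Xq) :=
  -- LANDED (lead, p121610): Theorems/PencilRigidityWeakCouplingHypercubicLimitStubTraceCluster.lean
  _root_.Summit.QuantumFields.YangMills.Theorems.WeakCouplingHypercubicLimit.TraceNormColdPressure.stub_traceCluster

/-- `stub_pressureForcesGap` (S4) — **"m → ∞ kills the volume"** (PROVED in the sketch, to be landed):
normalised spectral data `rᵢ ∈ [0, 1]`; if `log(1 + Σᵢ rᵢᵐ) ≤ V C e^{−μ m}` for all `m ≥ m₀` then every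
`rᵢ ≤ e^{−μ}`, whatever the prefactor `V > 0`. -/
theorem stub_pressureForcesGap :
    ∀ (n : ℕ) (r : Fin n → ℝ) (V C μ : ℝ) (m₀ : ℕ), (∀ i, 0 ≤ r i ∧ r i ≤ 1) → 0 < V →
      (∀ m : ℕ, m₀ ≤ m → Real.log (1 + ∑ i, r i ^ m) ≤ V * C * Real.exp (-μ * m)) →
      ∀ i, r i ≤ Real.exp (-μ) :=
  -- LANDED (wave 1, p121166): Theorems/PencilRigidityWeakCouplingHypercubicLimitStubPressureForcesGap.lean
  _root_.Summit.QuantumFields.YangMills.Theorems.WeakCouplingHypercubicLimit.TraceNormColdPressure.stub_pressureForcesGap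

/-- `stub_rateBookkeeping` (S5) — **real-analysis bookkeeping**: on the torus of half-side `S`, with
`μ = Δ a_k ∈ [0, 1]`, width `w ≤ n ≤ S`, `2w ≤ S`, trace excesses `X ≥ 0` obeying the cold-pressure
bound `X m ≤ C₀ V e^{−μ m}` for `2m ≥ S + 1` and the volume floor `C₀ V e^{−μ S/2} ≤ K`, the output of
`stub_traceCluster` at `r = e^{−μ}`, exponents `(2S+1−n−w, n−w, 2S+1−w, 2S+1−w, 2S+1)`, is at most
`C_A C_B e^{2w} (2 + 4K + K²) e^{−μ n}`. -/
theorem stub_rateBookkeeping :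
    ∀ (μ C₀ V K CA CB : ℝ) (X : ℕ → ℝ) (S n w : ℕ), 0 ≤ μ → μ ≤ 1 → 0 ≤ CA → 0 ≤ CB →
      w ≤ n → n ≤ S → 2 * w ≤ S → (∀ m, 0 ≤ X m) →
      (∀ m : ℕ, S + 1 ≤ 2 * m → X m ≤ C₀ * V * Real.exp (-(μ * m))) →
      C₀ * V * Real.exp (-(μ * S / 2)) ≤ K →
      CA * CB * (Real.exp (-μ) ^ (n - w) * (1 + X (2 * S + 1 - n - w)) +
          Real.exp (-μ) ^ (2 * S + 1 - n - w) + X (2 * S + 1) + X (2 * S + 1 - w) + X (2 * S + 1 - w) +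
          X (2 * S + 1 - w) * X (2 * S + 1 - w)) ≤
        CA * CB * Real.exp (2 * w) * (2 + 4 * K + K ^ 2) * Real.exp (-(μ * n)) :=
  -- LANDED (wave 1, p121384): Theorems/PencilRigidityWeakCouplingHypercubicLimitStubRateBookkeeping.lean
  _root_.Summit.QuantumFields.YangMills.Theorems.WeakCouplingHypercubicLimit.TraceNormColdPressure.stub_rateBookkeeping

/-! ### §2 The transfer representation (provable; RESHAPED at r3 into T1, T2, T4, T3a, T3b + glue) and the heart (OPEN) -/

/-- `stub_timeSlicing` (T1, r3) — **slicing the four-torus across Euclidean time** (Osterwalder–Seiler 1978 §2;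
template: `SlabTransferKernel.map_assemble_eq_haar` / `weight_assemble_eq_prod` for `FiniteTemperature.Config`).
A configuration `U : GaugeConfig 4 N G` of the torus `(ℤ/N)⁴` is ASSEMBLED from its time slices — spatial links
`Us t : GaugeConfig 3 N G` (`U((t,x⃗), i.succ) = Us t (x⃗, i)`) and temporal links `gs t : Site 3 N → G`
(`U((t,x⃗), 0) = gs t x⃗`), time being coordinate `0` and `x⃗ = Fin.tail x`; (a) assembling pushes the product of
the slice Haar measures forward to the Haar measure of the torus (measure-preserving, measurable); (b) Wilson's
action is the sum over slices of the spatial plaquette energy `wilsonAction (d := 3)` of each slice and the temporal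
plaquette energy `sliceTemporalAction` between consecutive slices. [folklore] -/
theorem stub_timeSlicing :
    ∀ (N : ℕ) [NeZero N] (G : Type) [Group G] [TopologicalSpace G] [IsTopologicalGroup G] [CompactSpace G]
      [MeasurableSpace G] [BorelSpace G] {n : ℕ} (ρ : G →* Matrix (Fin n) (Fin n) ℂ),
    MeasurePreserving
        (fun p : (ZMod N → GaugeConfig 3 N G) × (ZMod N → Site 3 N → G) => fun e : Edge 4 N =>
          (Fin.cons (p.2 (e.1 0) (Fin.tail e.1)) (fun i : Fin 3 => p.1 (e.1 0) (Fin.tail e.1, i)) : Fin 4 → G) e.2)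
        ((Measure.pi fun _ : ZMod N => Measure.pi fun _ : Edge 3 N => haarProbability G).prod
          (Measure.pi fun _ : ZMod N => Measure.pi fun _ : Site 3 N => haarProbability G))
        (Measure.pi fun _ : Edge 4 N => haarProbability G) ∧
      ∀ (Us : ZMod N → GaugeConfig 3 N G) (gs : ZMod N → Site 3 N → G),
        wilsonAction ρ (fun e : Edge 4 N =>
            (Fin.cons (gs (e.1 0) (Fin.tail e.1)) (fun i : Fin 3 => Us (e.1 0) (Fin.tail e.1, i)) : Fin 4 → G) e.2) =
          ∑ t : ZMod N, (wilsonAction ρ (Us t) + sliceTemporalAction ρ (Us t) (gs t) (Us (t + 1))) :=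
  -- LANDED (wave r3, worker T1, p124456): Theorems/PencilRigidityWeakCouplingHypercubicLimitStubTimeSlicing.lean
  _root_.Summit.QuantumFields.YangMills.Theorems.WeakCouplingHypercubicLimit.TraceNormColdPressure.stub_timeSlicing

/-- `stub_sliceKernel` (T2, r3) — **the Wilson time-slice kernel is a bounded, symmetric, strictly positive kernel OF
POSITIVE TYPE** (Lüscher 1977; Osterwalder–Seiler 1978 §§2–3; Seiler LNP 159 Ch. 2).  For a faithful unitary
`r : LatticeRep G`, `β ≥ 0`, on the slice space `GaugeConfig 3 N G` with its product Haar probability measure: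
measurability and the bound `≤ 1` of the temporal Boltzmann factor `exp(−β S_tm)` and of the spatial half-weight
`exp(−β S₃/2)` (`S_tm, S₃ ≥ 0` for unitary `ρ`); `K = wilsonSliceKernel r.ρ β` is jointly strongly measurable
(continuous; `G` is second countable through `r`), symmetric (`g ↦ g⁻¹`, inversion invariance of Haar, `Re tr ρ(h⁻¹) =
Re tr ρ(h)`; cf. `SlabTransferKernel.sliceKernel_symm`, of which `K` is a positive constant multiple), `0 < K ≤ 1`, and
of positive type against bounded measurable functions: gauge-averaging `P` is a self-adjoint idempotent commuting
with the un-averaged kernel `K₀(U,U') = exp(β Σ Re tr(ρ(U'ₗ)ρ(Uₗ)*))`, so `⟪f, K f⟫ = ⟪P(fs), K₀ P(fs)⟫ ≥ 0` by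
`ExpInnerProductKernelPositivity.integral_mul_exp_sum_mul_mul_nonneg` (feature map = real coordinates of `ρ`). [folklore] -/
theorem stub_sliceKernel :
    ∀ (G : Type) [Group G] [TopologicalSpace G] [IsTopologicalGroup G] [CompactSpace G]
      [MeasurableSpace G] [BorelSpace G] (r : LatticeRep G) (N : ℕ) [NeZero N] (β : ℝ), 0 ≤ β →
    (Measurable fun q : GaugeConfig 3 N G × (Site 3 N → G) × GaugeConfig 3 N G =>
        Real.exp (-(β * sliceTemporalAction r.ρ q.1 q.2.1 q.2.2))) ∧
    (∀ (U : GaugeConfig 3 N G) (g : Site 3 N → G) (U' : GaugeConfig 3 N G),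
        Real.exp (-(β * sliceTemporalAction r.ρ U g U')) ≤ 1) ∧
    (Measurable fun U : GaugeConfig 3 N G => Real.exp (-(β * wilsonAction r.ρ U / 2))) ∧
    (∀ U : GaugeConfig 3 N G, Real.exp (-(β * wilsonAction r.ρ U / 2)) ≤ 1) ∧
    StronglyMeasurable (Function.uncurry (wilsonSliceKernel r.ρ β : GaugeConfig 3 N G → GaugeConfig 3 N G → ℝ)) ∧
    (∀ U U' : GaugeConfig 3 N G, wilsonSliceKernel r.ρ β U U' = wilsonSliceKernel r.ρ β U' U) ∧
    (∀ U U' : GaugeConfig 3 N G, 0 < wilsonSliceKernel r.ρ β U U' ∧ wilsonSliceKernel r.ρ β U U' ≤ 1) ∧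
    (∀ f : GaugeConfig 3 N G → ℝ, Measurable f → (∀ U, |f U| ≤ 1) →
        0 ≤ ∫ U, ∫ U', f U * wilsonSliceKernel r.ρ β U U' * f U'
          ∂(Measure.pi fun _ : Edge 3 N => haarProbability G) ∂(Measure.pi fun _ : Edge 3 N => haarProbability G)) :=
  -- LANDED (wave r3, p125104): Theorems/PencilRigidityWeakCouplingHypercubicLimitStubSliceKernel.lean
  _root_.Summit.QuantumFields.YangMills.Theorems.WeakCouplingHypercubicLimit.TraceNormColdPressure.stub_sliceKernel

/-- `stub_slabContraction` (T4, r3; ABSTRACT measure theory) — **slab operators: integrating out the fibre variables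
and the block interiors** (the path-space half of Osterwalder–Seiler 1978 §2: "observables of finite time-width become
bounded operators dominated by ‖A‖∞ 𝕋ʷ").  Setting: probability spaces `(X, μ)` (slices) and `(Γ, ν)` (fibres = the
temporal links of a slice), a bounded measurable non-negative three-point weight `c(x, γ, x')` (the Boltzmann factor of
one time step), the cycle `ℤ/N` of slices with weight `∏ₜ c(xₜ, γₜ, xₜ₊₁)` under `μ^{⊗N} ⊗ ν^{⊗N}`, and two bounded
measurable block observables `α`, `β` of `r + 2` consecutive slices and the `r + 1` fibres between them, `α` read at the
sites `0, …, r+1`, `β` at the sites `r+a+3, …, 2r+a+4` (`N = 2r + a + b' + 6`).  With the fibre-averaged kernel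
`K(x,x') = ∫ c(x,γ,x') dν` and the CONTRACTED BLOCK KERNELS `X_α(u,u') = ∫∫ α(u ∷ v :: u', γ⃗) ∏ᵢ c(…) dν^{⊗(r+1)} dμ^{⊗r}`:
(a) `X_α`, `X_β` are jointly strongly measurable; (b) `|X_α| ≤ C_α · (∫ ∏ᵢ K dμ^{⊗r})` (the `r+1`-step path weight of
`K`) and `|X_α| ≤ C_α C_c^{r+1}`; (c) the cyclic integral with both blocks equals the two-bond-insertion cyclic integral
of `HeterogeneousCyclicPeeling.integral_cyclic_insert_two`'s shape (`X_α`, `a + 2` bonds `K`, `X_β`, `b' + 2` bonds `K`);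
(d) with `α` alone, the one-insertion shape of `integral_cyclic_insert_one` (`X_α`, then `r + a + b' + 5` bonds `K`);
(e) with no block, the pure `K`-cycle of `N` sites (Fubini over the product, `integral_fintype_prod_eq_prod` on the
fibres, `integral_cyclic_block_contract`, relabelling `ZMod N ≃ Fin N`). [folklore] -/
theorem stub_slabContraction :
    ∀ (X Γ : Type) [MeasurableSpace X] [MeasurableSpace Γ] (μ : Measure X) (ν : Measure Γ)
      [IsProbabilityMeasure μ] [IsProbabilityMeasure ν] (c : X → Γ → X → ℝ) (Cc : ℝ),
      Measurable (fun q : X × Γ × X => c q.1 q.2.1 q.2.2) → (∀ x γ x', 0 ≤ c x γ x' ∧ c x γ x' ≤ Cc) →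
    ∀ (r a b' N : ℕ) [NeZero N], N = 2 * r + a + b' + 4 + 2 →
    ∀ (α β : (Fin (r + 2) → X) → (Fin (r + 1) → Γ) → ℝ) (Cα Cβ : ℝ),
      Measurable (fun q : (Fin (r + 2) → X) × (Fin (r + 1) → Γ) => α q.1 q.2) →
      Measurable (fun q : (Fin (r + 2) → X) × (Fin (r + 1) → Γ) => β q.1 q.2) →
      (∀ W γs, |α W γs| ≤ Cα) → (∀ W γs, |β W γs| ≤ Cβ) →
    ∀ (K Xa Xb : X → X → ℝ), (∀ x x' : X, K x x' = ∫ γ, c x γ x' ∂ν) →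
      (∀ u u' : X, Xa u u' = ∫ v : Fin r → X, ∫ γs : Fin (r + 1) → Γ, α (Fin.cons u (Fin.snoc v u')) γs * ∏ i : Fin (r + 1), c ((Fin.cons u (Fin.snoc v u') : Fin (r + 2) → X) (Fin.castSucc i)) (γs i) ((Fin.cons u (Fin.snoc v u') : Fin (r + 2) → X) (Fin.succ i)) ∂(Measure.pi fun _ => ν) ∂(Measure.pi fun _ => μ)) →
      (∀ u u' : X, Xb u u' = ∫ v : Fin r → X, ∫ γs : Fin (r + 1) → Γ, β (Fin.cons u (Fin.snoc v u')) γs * ∏ i : Fin (r + 1), c ((Fin.cons u (Fin.snoc v u') : Fin (r + 2) → X) (Fin.castSucc i)) (γs i) ((Fin.cons u (Fin.snoc v u') : Fin (r + 2) → X) (Fin.succ i)) ∂(Measure.pi fun _ => ν) ∂(Measure.pi fun _ => μ)) →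
    (StronglyMeasurable (Function.uncurry Xa) ∧ StronglyMeasurable (Function.uncurry Xb)) ∧
    (∀ u u' : X, |Xa u u'| ≤ Cα * (∫ v : Fin r → X, ∏ i : Fin (r + 1), K ((Fin.cons u (Fin.snoc v u') : Fin (r + 2) → X) (Fin.castSucc i)) ((Fin.cons u (Fin.snoc v u') : Fin (r + 2) → X) (Fin.succ i)) ∂(Measure.pi fun _ => μ)) ∧ |Xb u u'| ≤ Cβ * (∫ v : Fin r → X, ∏ i : Fin (r + 1), K ((Fin.cons u (Fin.snoc v u') : Fin (r + 2) → X) (Fin.castSucc i)) ((Fin.cons u (Fin.snoc v u') : Fin (r + 2) → X) (Fin.succ i)) ∂(Measure.pi fun _ => μ))) ∧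
    (∀ u u' : X, |Xa u u'| ≤ Cα * Cc ^ (r + 1) ∧ |Xb u u'| ≤ Cβ * Cc ^ (r + 1)) ∧
    (∫ p : (ZMod N → X) × (ZMod N → Γ),
        α (fun i : Fin (r + 2) => p.1 ((i : ℕ) : ZMod N)) (fun i : Fin (r + 1) => p.2 ((i : ℕ) : ZMod N)) *
          β (fun i : Fin (r + 2) => p.1 ((r + a + 3 + (i : ℕ) : ℕ) : ZMod N))
            (fun i : Fin (r + 1) => p.2 ((r + a + 3 + (i : ℕ) : ℕ) : ZMod N)) *
          ∏ t : ZMod N, c (p.1 t) (p.2 t) (p.1 (t + 1))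
        ∂((Measure.pi fun _ => μ).prod (Measure.pi fun _ => ν)) =
      ∫ V : Fin (1 + (a + 2 + (b' + 1 + 1)) + 1) → X, ∏ t : Fin (1 + (a + 2 + (b' + 1 + 1)) + 1),
        (fun s : ℕ => if s = 0 then Xa else if s = a + 2 + 1 then Xb else K) (t : ℕ) (V t) (V (t + 1)) ∂(Measure.pi fun _ => μ)) ∧
    (∫ p : (ZMod N → X) × (ZMod N → Γ),
        α (fun i : Fin (r + 2) => p.1 ((i : ℕ) : ZMod N)) (fun i : Fin (r + 1) => p.2 ((i : ℕ) : ZMod N)) *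
          ∏ t : ZMod N, c (p.1 t) (p.2 t) (p.1 (t + 1))
        ∂((Measure.pi fun _ => μ).prod (Measure.pi fun _ => ν)) =
      ∫ V : Fin (1 + (r + a + b' + 4) + 1) → X, Xa (V 0) (V 1) *
        ∏ t : Fin (1 + (r + a + b' + 4)), K (V t.succ) (V (t.succ + 1)) ∂(Measure.pi fun _ => μ)) ∧
    (∫ p : (ZMod N → X) × (ZMod N → Γ), ∏ t : ZMod N, c (p.1 t) (p.2 t) (p.1 (t + 1))
        ∂((Measure.pi fun _ => μ).prod (Measure.pi fun _ => ν)) =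
      ∫ V : Fin (2 * r + a + b' + 4 + 2) → X, ∏ t : Fin (2 * r + a + b' + 4 + 2), K (V t) (V (t + 1)) ∂(Measure.pi fun _ => μ)) :=
  -- LANDED (wave r3, p125670): Theorems/PencilRigidityWeakCouplingHypercubicLimitStubSlabContraction.lean
  _root_.Summit.QuantumFields.YangMills.Theorems.WeakCouplingHypercubicLimit.TraceNormColdPressure.stub_slabContraction

/-- `stub_spectralData` (T3a, r3; ABSTRACT operator theory) — **spectral data of a positive-type Hilbert–Schmidt
kernel with two bond insertions** (Reed–Simon I Thm VI.16/VI.22–23; Simon, Trace ideals Ch. 3; the tree toolkit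
`PositiveKernelTransferOperator`, `CompactSelfAdjointEigenbasis`, `PositiveKernelSpectralTrace{,Two}`,
`HeterogeneousCyclicPeeling`, `KernelIterateBridge`).  For a strongly measurable symmetric kernel `0 < K ≤ C` on a
probability space with countably generated σ-algebra (so `L²` is separable), of positive type against bounded
measurable functions, and two strongly measurable bounded bond kernels `X_a`, `X_b` dominated by `C_A`, `C_B` times the
`r+1`-step path weight of `K`: there are a countable Hilbert basis `(bᵢ)` of `L²(μ)` of eigenvectors of the integral
operator of `K` with eigenvalues `0 ≤ λᵢ ≤ λ_{i₀}`, `λ_{i₀} > 0`, `Σ λᵢ² < ∞`, the `L²` operators `Â`, `B̂` of `X_a`,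
`X_b` with `‖Â‖ ≤ C_A λ_{i₀}^{r+1}`, `‖B̂‖ ≤ C_B λ_{i₀}^{r+1}` (kernel domination), the growth-rate formula
`limsup_m Z_{m+1}^{1/(m+1)} = λ_{i₀}` for the cyclic integrals `Z_m` of `K`, and the trace formulas as `HasSum`s:
`Z_{m+2} = Σ λᵢ^{m+2}`, the two-insertion cyclic integral `= Σ_{(i,j)} λⱼ^{a+2} λᵢ^{b'+2} ⟪bᵢ, Â bⱼ⟫ ⟪bⱼ, B̂ bᵢ⟫`, and the
one-insertion cyclic integrals `= Σ λᵢ^{r+a+b'+5} ⟪bᵢ, Â bᵢ⟫` (resp. `B̂`). [folklore] -/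
theorem stub_spectralData :
    ∀ (X : Type) [MeasurableSpace X] [MeasurableSpace.CountablyGenerated X] (μ : Measure X) [IsProbabilityMeasure μ]
      (K : X → X → ℝ) (C : ℝ), StronglyMeasurable (Function.uncurry K) → (∀ x y, K x y = K y x) →
      (∀ x y, 0 < K x y ∧ K x y ≤ C) →
      (∀ f : X → ℝ, Measurable f → (∀ x, |f x| ≤ 1) → 0 ≤ ∫ x, ∫ y, f x * K x y * f y ∂μ ∂μ) →
    ∀ (r : ℕ) (Xa Xb : X → X → ℝ) (CA CB CX : ℝ), StronglyMeasurable (Function.uncurry Xa) → StronglyMeasurable (Function.uncurry Xb) →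
      (∀ u u', |Xa u u'| ≤ CX ∧ |Xb u u'| ≤ CX) →
      (∀ u u' : X, |Xa u u'| ≤ CA * (∫ v : Fin r → X, ∏ i : Fin (r + 1), K ((Fin.cons u (Fin.snoc v u') : Fin (r + 2) → X) (Fin.castSucc i)) ((Fin.cons u (Fin.snoc v u') : Fin (r + 2) → X) (Fin.succ i)) ∂(Measure.pi fun _ => μ))) →
      (∀ u u' : X, |Xb u u'| ≤ CB * (∫ v : Fin r → X, ∏ i : Fin (r + 1), K ((Fin.cons u (Fin.snoc v u') : Fin (r + 2) → X) (Fin.castSucc i)) ((Fin.cons u (Fin.snoc v u') : Fin (r + 2) → X) (Fin.succ i)) ∂(Measure.pi fun _ => μ))) →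
    ∀ (a b' : ℕ),
    ∃ (ι : Type) (_ : Countable ι) (b : HilbertBasis ι ℝ (Lp ℝ 2 μ)) (lam : ι → ℝ) (i₀ : ι)
      (Aop Bop : Lp ℝ 2 μ →L[ℝ] Lp ℝ 2 μ),
      (∀ i, 0 ≤ lam i ∧ lam i ≤ lam i₀) ∧ 0 < lam i₀ ∧ Summable (fun i => lam i ^ 2) ∧
      ‖Aop‖ ≤ CA * lam i₀ ^ (r + 1) ∧ ‖Bop‖ ≤ CB * lam i₀ ^ (r + 1) ∧
      limsup (fun m : ℕ => (∫ V : Fin (m + 1) → X, ∏ t, K (V t) (V (t + 1)) ∂(Measure.pi fun _ => μ)) ^ (((m : ℝ) + 1)⁻¹))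
        atTop = lam i₀ ∧
      (∀ m : ℕ, HasSum (fun i => lam i ^ (m + 2))
        (∫ V : Fin (m + 2) → X, ∏ t, K (V t) (V (t + 1)) ∂(Measure.pi fun _ => μ))) ∧
      HasSum (fun pr : ι × ι => lam pr.2 ^ (a + 2) * lam pr.1 ^ (b' + 2) *
          inner ℝ (b pr.1) (Aop (b pr.2)) * inner ℝ (b pr.2) (Bop (b pr.1)))
        (∫ V : Fin (1 + (a + 2 + (b' + 1 + 1)) + 1) → X, ∏ t : Fin (1 + (a + 2 + (b' + 1 + 1)) + 1),
          (fun s : ℕ => if s = 0 then Xa else if s = a + 2 + 1 then Xb else fun x x' : X => K x x') (t : ℕ) (V t) (V (t + 1))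
          ∂(Measure.pi fun _ => μ)) ∧
      HasSum (fun i => lam i ^ (r + a + b' + 5) * inner ℝ (b i) (Aop (b i)))
        (∫ V : Fin (1 + (r + a + b' + 4) + 1) → X, Xa (V 0) (V 1) *
          ∏ t : Fin (1 + (r + a + b' + 4)), K (V t.succ) (V (t.succ + 1)) ∂(Measure.pi fun _ => μ)) ∧
      HasSum (fun i => lam i ^ (r + a + b' + 5) * inner ℝ (b i) (Bop (b i)))
        (∫ V : Fin (1 + (r + a + b' + 4) + 1) → X, Xb (V 0) (V 1) *
          ∏ t : Fin (1 + (r + a + b' + 4)), K (V t.succ) (V (t.succ + 1)) ∂(Measure.pi fun _ => μ)) :=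
  -- LANDED (wave r3, p124936): Theorems/PencilRigidityWeakCouplingHypercubicLimitStubSpectralData.lean
  _root_.Summit.QuantumFields.YangMills.Theorems.WeakCouplingHypercubicLimit.TraceNormColdPressure.stub_spectralData

/-- `stub_finiteTruncation` (T3b, r3; ABSTRACT, Mathlib only) — **finite-dimensional transfer models from spectral
data** (spectral truncation; Reed–Simon I §VI.5).  Given a countable Hilbert basis `(bᵢ)` of a real Hilbert space,
weights `0 ≤ λᵢ ≤ λ_{i₀}`, `λ_{i₀} > 0`, `Σ λᵢ² < ∞`, and bounded operators `Â`, `B̂` with `‖Â‖ ≤ C_A λ_{i₀}^{r+1}`,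
`‖B̂‖ ≤ C_B λ_{i₀}^{r+1}`: for every `ε > 0` a finite set of indices `F ∋ i₀` gives the model `T = diag(λᵢ/λ_{i₀})_{i∈F}`
on `ℝ^F`, `Ω = e_{i₀}`, `Ao = (⟪bᵢ, Â bⱼ⟫/λ_{i₀}^{r+1})_{i,j∈F}`, `Bo` likewise — `T ≥ 0`, `TΩ = Ω`, `‖T‖ ≤ 1`,
`‖Ao‖ ≤ C_A`, `‖Bo‖ ≤ C_B` (compressions), `tr T^{m+2} − 1 ≤ Σᵢ(λᵢ/λ_{i₀})^{m+2} − 1` — whose normalised traces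
reproduce the normalised spectral sums `Σ_{(i,j)} λⱼ^{a+2}λᵢ^{b'+2}⟪bᵢ,Âbⱼ⟫⟪bⱼ,B̂bᵢ⟫ / Σλᵢᴺ − (Σλᵢ^{N−r−1}⟪bᵢ,Âbᵢ⟫/Σλᵢᴺ)
(Σλᵢ^{N−r−1}⟪bᵢ,B̂bᵢ⟫/Σλᵢᴺ)`, `N = 2r + a + b' + 6`, to within `ε` (partial sums of absolutely convergent series;
`Matrix.toEuclideanCLM`, `LinearMap.trace_eq_matrix_trace`). [folklore] -/
theorem stub_finiteTruncation :
    ∀ (E : Type) [NormedAddCommGroup E] [InnerProductSpace ℝ E] [CompleteSpace E] (ι : Type) [Countable ι]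
      (b : HilbertBasis ι ℝ E) (lam : ι → ℝ) (i₀ : ι) (Aop Bop : E →L[ℝ] E) (CA CB : ℝ) (r a b' : ℕ),
      (∀ i, 0 ≤ lam i ∧ lam i ≤ lam i₀) → 0 < lam i₀ → Summable (fun i => lam i ^ 2) →
      ‖Aop‖ ≤ CA * lam i₀ ^ (r + 1) → ‖Bop‖ ≤ CB * lam i₀ ^ (r + 1) →
    ∀ ε : ℝ, 0 < ε →
      ∃ (d : ℕ) (T Ao Bo : EuclideanSpace ℝ (Fin d) →L[ℝ] EuclideanSpace ℝ (Fin d)) (Ω : EuclideanSpace ℝ (Fin d)),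
        T.IsPositive ∧ ‖Ω‖ = 1 ∧ T Ω = Ω ∧ (∀ v, inner ℝ Ω v = 0 → ‖T v‖ ≤ ‖v‖) ∧ ‖T‖ ≤ 1 ∧
        ‖Ao‖ ≤ CA ∧ ‖Bo‖ ≤ CB ∧
        (∀ m : ℕ, LinearMap.trace ℝ _ (↑(T ^ (m + 2)) : EuclideanSpace ℝ (Fin d) →ₗ[ℝ] EuclideanSpace ℝ (Fin d)) - 1 ≤ (∑' i, lam i ^ (m + 2)) / lam i₀ ^ (m + 2) - 1) ∧
        |(∑' pr : ι × ι, lam pr.2 ^ (a + 2) * lam pr.1 ^ (b' + 2) * inner ℝ (b pr.1) (Aop (b pr.2)) * inner ℝ (b pr.2) (Bop (b pr.1))) /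
              (∑' i, lam i ^ (2 * r + a + b' + 4 + 2)) -
            (∑' i, lam i ^ (r + a + b' + 5) * inner ℝ (b i) (Aop (b i))) / (∑' i, lam i ^ (2 * r + a + b' + 4 + 2)) *
              ((∑' i, lam i ^ (r + a + b' + 5) * inner ℝ (b i) (Bop (b i))) / (∑' i, lam i ^ (2 * r + a + b' + 4 + 2))) -
          (LinearMap.trace ℝ _ (↑(T ^ (b' + 2) * Ao * T ^ (a + 2) * Bo) : EuclideanSpace ℝ (Fin d) →ₗ[ℝ] EuclideanSpace ℝ (Fin d)) / LinearMap.trace ℝ _ (↑(T ^ (2 * r + a + b' + 4 + 2)) : EuclideanSpace ℝ (Fin d) →ₗ[ℝ] EuclideanSpace ℝ (Fin d)) -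
            LinearMap.trace ℝ _ (↑(T ^ (r + a + b' + 5) * Ao) : EuclideanSpace ℝ (Fin d) →ₗ[ℝ] EuclideanSpace ℝ (Fin d)) / LinearMap.trace ℝ _ (↑(T ^ (2 * r + a + b' + 4 + 2)) : EuclideanSpace ℝ (Fin d) →ₗ[ℝ] EuclideanSpace ℝ (Fin d)) *
              (LinearMap.trace ℝ _ (↑(T ^ (r + a + b' + 5) * Bo) : EuclideanSpace ℝ (Fin d) →ₗ[ℝ] EuclideanSpace ℝ (Fin d)) / LinearMap.trace ℝ _ (↑(T ^ (2 * r + a + b' + 4 + 2)) : EuclideanSpace ℝ (Fin d) →ₗ[ℝ] EuclideanSpace ℝ (Fin d))))| ≤ ε :=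
  -- LANDED (wave r3, worker T3b, p124646): Theorems/PencilRigidityWeakCouplingHypercubicLimitStubFiniteTruncation.lean
  _root_.Summit.QuantumFields.YangMills.Theorems.WeakCouplingHypercubicLimit.TraceNormColdPressure.stub_finiteTruncation

/-- `stub_transferRepresentation` (S6a) — **torus Wilson expectations are normalised transfer traces; finite
models** (Osterwalder–Seiler 1978 §§2–3, Lüscher 1977; PROVABLE with the tree's toolkit
`Literature/Analysis/OperatorTheory/PositiveKernelTransferOperator`, `KernelCyclicPeeling`,
`CyclicKernelClustering`, `PositiveKernelSpectralTrace{,Two}`, `IntegralOperatorHilbertSchmidt`, and the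
definitions `wilsonSliceKernel`/`cyclicPartition`/`transferSpectralRadius`/`traceExcess` of
`Literature/MathematicalPhysics/QuantumFieldTheory/WilsonTransferKernel`): for every compact `G`, faithful
`r`, and pair of bounded gauge-invariant local observables `A, B` there is a time-width `w` (depending on the
supports only) such that for every coupling `β ≥ 0`, every torus `(2S'+1)⁴`, every `n ≤ S'` with `w < n`,
`2w ≤ S'`, and every `ε > 0` there is a finite-dimensional positive transfer model — `T ≥ 0` on `ℝᵈ` with a unit
fixed vector `Ω`, contracting on `Ω^⊥` (spectral truncation of the normalised transfer operator of the slice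
kernel, `Ω` = its top eigenvector), `‖Ao‖ ≤ C_A`, `‖Bo‖ ≤ C_B` (dressed `w`-step insertion kernels dominated by
`‖A‖∞ Kʷ`), trace excesses `tr T^(m+2) − 1 ≤ traceExcess r.ρ β (2S'+1) (m+2)` (Hilbert–Schmidt trace formulas,
`m + 2 ≥ 2`) — whose normalised traces reproduce `latticeConnectedCorr r.ρ β (2S'+1) A B n` to within `ε`
(time-slicing of `wilsonMeasure` into the cyclic chain of slice kernels, two bond insertions, spectral sums;
`w < n` keeps every transfer exponent `≥ 1`).  Group-blind and TRUE; SHARED with cards ungauged-transfer-gap /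
spectral-requantisation-dock. -/
theorem stub_transferRepresentation :
    ∀ (G : Type) [Group G] [TopologicalSpace G] [IsTopologicalGroup G] [CompactSpace G]
      [MeasurableSpace G] [BorelSpace G] (r : LatticeRep G) (A B : YMSpecies G),
    ∃ w : ℕ, ∀ (β : ℝ), 0 ≤ β → ∀ (CA CB : ℝ), (∀ U, |A.F U| ≤ CA) → (∀ U, |B.F U| ≤ CB) →
      ∀ (S' n : ℕ), n ≤ S' → w < n → 2 * w ≤ S' → ∀ ε : ℝ, 0 < ε →
        ∃ (d : ℕ) (T Ao Bo : EuclideanSpace ℝ (Fin d) →L[ℝ] EuclideanSpace ℝ (Fin d)) (Ω : EuclideanSpace ℝ (Fin d)),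
          T.IsPositive ∧ ‖Ω‖ = 1 ∧ T Ω = Ω ∧ (∀ v, inner ℝ Ω v = 0 → ‖T v‖ ≤ ‖v‖) ∧ ‖Ao‖ ≤ CA ∧ ‖Bo‖ ≤ CB ∧
          (∀ m : ℕ, LinearMap.trace ℝ _ (↑(T ^ (m + 2)) : EuclideanSpace ℝ (Fin d) →ₗ[ℝ] EuclideanSpace ℝ (Fin d)) - 1 ≤ traceExcess r.ρ β (2 * S' + 1) (m + 2)) ∧
          |latticeConnectedCorr r.ρ β (2 * S' + 1) A.F B.F n - (LinearMap.trace ℝ _ (↑(T ^ (2 * S' + 1 - n - w) * Ao * T ^ (n - w) * Bo) : EuclideanSpace ℝ (Fin d) →ₗ[ℝ] EuclideanSpace ℝ (Fin d)) / LinearMap.trace ℝ _ (↑(T ^ (2 * S' + 1)) : EuclideanSpace ℝ (Fin d) →ₗ[ℝ] EuclideanSpace ℝ (Fin d)) - LinearMap.trace ℝ _ (↑(T ^ (2 * S' + 1 - w) * Ao) : EuclideanSpace ℝ (Fin d) →ₗ[ℝ] EuclideanSpace ℝ (Fin d)) / LinearMap.trace ℝ _ (↑(T ^ (2 * S' + 1))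 : EuclideanSpace ℝ (Fin d) →ₗ[ℝ] EuclideanSpace ℝ (Fin d)) * (LinearMap.trace ℝ _ (↑(T ^ (2 * S' + 1 - w) * Bo) : EuclideanSpace ℝ (Fin d) →ₗ[ℝ] EuclideanSpace ℝ (Fin d)) / LinearMap.trace ℝ _ (↑(T ^ (2 * S' + 1)) : EuclideanSpace ℝ (Fin d) →ₗ[ℝ] EuclideanSpace ℝ (Fin d))))| ≤ ε :=
  -- LANDED (lead c1, p125801): Theorems/PencilRigidityWeakCouplingHypercubicLimitStubTransferRepresentation.lean —
  -- the glue from T1/T2/T4/T3a/T3b (skeleton r4 proof, moved verbatim)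
  _root_.Summit.QuantumFields.YangMills.Theorems.WeakCouplingHypercubicLimit.TraceNormColdPressure.stub_transferRepresentation


/-! (r10) The r8–r9 heart S6c `stub_coldPressureOneField` (the crux with the continuum OS package assumed verbatim and
its IR clause in cold-pressure form) is SUPERSEDED by the lattice-side heart S6d of §6; its text is kept in
`Lines/Sketch.md` for the record. -/

/-! ### §3 The infrared lever as a registered stub, and the composition -/

/-- `stub_latticeGapOfColdPressure` (IR lever, r7; LANDED p127195 — the IR half of the r6 composition, factored out
as an importable theorem): **cold pressure forces the lattice mass-gap clause along a
scheme.**  If, eventually in `k`, the tori of the scheme obey the volume floor `C₀ (2S+1)³ e^{−Δ a_k S/2} ≤ K`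
(`S ≥ L_k`) and the cold-pressure bound `traceExcess r.ρ β_k (2S+1) (m+2) ≤ C₀ (2S+1)³ e^{−Δ a_k (m+2)}` (`S ≥ L_k`,
`S + 1 ≤ 2(m+2)`), with `β_k ≥ 0` eventually and `Δ > 0`, `C₀ ≥ 0`, then `HasLatticeMassGap r sch Δ` — pair by
pair: a priori bound for `n ≤ w` or `S < 2w`, otherwise on each finite transfer model (`stub_transferRepresentation`)
S2 gives the contraction rate `e^{−Δ a_k}` on `Ω^⊥`, S3 bounds the normalised connected trace, `ε → 0`, and S5
turns the result into `C(A,B) e^{−Δ a_k n}` with `C(A,B) = C_A C_B e^{2w}(2 + 4K + K²) ⊔ 2 C_A C_B e^{2w}`.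
[folklore] -/
theorem stub_latticeGapOfColdPressure :
    ∀ (G : Type) [Group G] [TopologicalSpace G] [IsTopologicalGroup G] [CompactSpace G]
      [MeasurableSpace G] [BorelSpace G] (r : LatticeRep G) (sch : SpeciesScheme (YMSpecies G)) (Δ C₀ K : ℝ),
      (∀ᶠ k in Filter.atTop, 0 ≤ sch.β k) → 0 < Δ → 0 ≤ C₀ →
      (∀ᶠ k in Filter.atTop, ∀ S : ℕ, sch.L k ≤ S →
        C₀ * ((2 * S + 1 : ℕ) : ℝ) ^ 3 * Real.exp (-(Δ * sch.a k * S / 2)) ≤ K) →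
      (∀ᶠ k in Filter.atTop, ∀ S : ℕ, sch.L k ≤ S → ∀ m : ℕ, S + 1 ≤ 2 * (m + 2) →
        traceExcess r.ρ (sch.β k) (2 * S + 1) (m + 2) ≤
          C₀ * ((2 * S + 1 : ℕ) : ℝ) ^ 3 * Real.exp (-(Δ * sch.a k * ((m + 2 : ℕ) : ℝ)))) →
      HasLatticeMassGap r sch Δ :=
  -- LANDED (lead c2, p127195): Theorems/PencilRigidityWeakCouplingHypercubicLimitColdPressureClustering.lean —
  -- with the scheme-free fixed-β form `abs_latticeConnectedCorr_le_of_coldPressure` and the lattice-units corollary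
  -- `uniformClustering_of_coldPressure` (cold pressure at β ⇒ the `UniformLatticeGap`-shaped conclusion at β)
  _root_.Summit.QuantumFields.YangMills.Theorems.WeakCouplingHypercubicLimit.TraceNormColdPressure.stub_latticeGapOfColdPressure

/-- `stub_siblingTie` (record, r7; LANDED p127226, lead c2): **this crux ⇔ the shared existence leg stmt-16154 BY
NAME** (`CoincidenceRotationBootstrap.HypercubicLimit`, verbatim `= MirrorModularBoosts.WeakCouplingHypercubicLimit`):
the one-field clause is weightless, so one closure or one refutation of either decl serves PencilRigidity,
CoincidenceRotationBootstrap and MirrorModularBoosts alike; with `Negative/SummitTie` (p121291) the heart is thus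
bracketed as `YangMills ⇒ crux ⇔ stmt-16154` and `S6c ⇒ crux`. -/
theorem stub_siblingTie :
    Summit.QuantumFields.YangMills.Theses.PencilRigidity.WeakCouplingHypercubicLimit ↔
      Summit.QuantumFields.YangMills.Theses.CoincidenceRotationBootstrap.HypercubicLimit :=
  -- LANDED (lead c2, p127226): Theorems/PencilRigidityWeakCouplingHypercubicLimitSiblingTie.lean
  _root_.Summit.QuantumFields.YangMills.Theorems.WeakCouplingHypercubicLimit.SiblingTie.stub_siblingTie

/-! ### §5 The infrared lever EXTENDED (r8): cold pressure ⇒ RP-spectral relative clustering of reflected slab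
functionals (the `GapData` (iii-b) / `IRInputs` (b) clause imported by the host closures of stmt-8646 / stmt-16154)

Cold pressure is a statement about the spectrum of Wilson's transfer operator on the spatial torus, so it delivers more
than the all-pairs decay of §3: for a bounded measurable functional `Y` of the time slab `[1, T]` (sup `B`), its link
reflection `ΘY = Y ∘ lift ∘ Θ_T` (`GaugeConfig.timeReflect`, `θ t = 1 − t`) and its time translate `Y_n`, on every cold
torus `(2S+1)⁴` with `2(T+n+1) ≤ S`,
`|⟨ΘY · Y_n⟩ − ⟨Y⟩²| ≤ e^{−g' n} (⟨ΘY · Y⟩ − ⟨Y⟩²) + 16 C₀ (2S+1)³ e^{−3gS/4} B²` (`0 ≤ g' ≤ g`, `g` the cold-pressure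
rate): RELATIVE to the OS square at `n = 0` (scale-free, so it survives multiplicative renormalisation), with a
`Y`-uniform thermal error.  Mechanism (Osterwalder–Seiler 1978 §§2–3 in trace form): slicing (T1), the slice kernel
(T2), block contraction with the TWO blocks `ΘY` (sites `1−T…0`) and `Y_n` (sites `n+1…n+T`) separated by `n+1` bonds
(the gap-`(a+1)` variant of `SlabFibreContraction.slab_cyclic_two`, Literature), the reflected block kernel is the
TRANSPOSE of the direct one (R3 + R4: time-reversal symmetry of the one-step Boltzmann factor and Haar inversion), so the
two-insertion spectral sum is `Σ_{(i,j)} λⱼ^{n+1} λᵢ^{2S−2T−n+2} ⟪bⱼ, B̂ bᵢ⟫²` with NON-NEGATIVE terms (the gap-`(a+1)`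
variant of `PositiveKernelSpectralTraceTwo.hasSum_integral_iterate_insert_two`, Literature, + R5 adjointness); cold
pressure forces `λⱼ ≤ e^{−g} λ_{i₀}` off the top (R1), and the bookkeeping R2 splits off the vacuum index. -/

/-- `stub_ratioOfColdPressure` (R1, r8; real analysis on a summable family) — **cold pressure forces the spectral
ratio**: non-negative weights `λᵢ ≤ λ_{i₀}`, `λ_{i₀} > 0`, `Σ λᵢ² < ∞`; if the normalised trace excesses obey
`(Σᵢ λᵢ^{m+2})/λ_{i₀}^{m+2} − 1 ≤ V C e^{−g (m+2)}` for all `m ≥ m₀` (any prefactor `V > 0`, any `C`, any real `g`), then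
every other weight satisfies `λᵢ ≤ e^{−g} λ_{i₀}` (one term of the sum of non-negative terms, `(m+2)`-th roots,
`m → ∞`; the infinite-dimensional form of `stub_pressureForcesGap`). [folklore] -/
theorem stub_ratioOfColdPressure :
    ∀ (ι : Type) (lam : ι → ℝ) (i₀ : ι) (V C g : ℝ) (m₀ : ℕ),
      (∀ i, 0 ≤ lam i ∧ lam i ≤ lam i₀) → 0 < lam i₀ → Summable (fun i => lam i ^ 2) → 0 < V →
      (∀ m : ℕ, m₀ ≤ m → (∑' i, lam i ^ (m + 2)) / lam i₀ ^ (m + 2) - 1 ≤ V * C * Real.exp (-(g * ((m + 2 : ℕ) : ℝ)))) →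
      ∀ i, i ≠ i₀ → lam i ≤ Real.exp (-g) * lam i₀ :=
  -- LANDED (wave r8, worker W2, p128733): Theorems/PencilRigidityWeakCouplingHypercubicLimitStubRatioOfColdPressure.lean
  _root_.Summit.QuantumFields.YangMills.Theorems.WeakCouplingHypercubicLimit.TraceNormColdPressure.stub_ratioOfColdPressure

/-- `stub_relativeBookkeeping` (R2, r8; real analysis on `tsum`s) — **splitting off the vacuum index**.  Normalised
weights `0 ≤ rᵢ ≤ 1`, `r_{i₀} = 1`, `rᵢ ≤ e^{−g}` for `i ≠ i₀` (`g ≥ 0`); a non-negative "squared matrix" `sq j i`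
(`= ⟪bⱼ, B̃ bᵢ⟫²`) with column sums `Σⱼ sq j i ≤ B²`, a "diagonal" `dg i` (`= ⟪bᵢ, B̃ bᵢ⟫`) with `|dg i| ≤ B` and
`dg i₀² = sq i₀ i₀`; a number `0 ≤ X ≤ 1` dominating the trace excesses `Σᵢ rᵢ^m − 1` at the four exponents used (all sums
summable).  Then the normalised two-point quantity `D(e₁,e₂) = Σ_{(i,j)} rⱼ^{e₁} rᵢ^{e₂} sq j i` and one-point quantity
`E = Σᵢ rᵢ^p dg i`, `Z = Σᵢ rᵢ^N`, satisfy, for `0 ≤ g' ≤ g`,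
`|D(n+1, M)/Z − (E/Z)²| ≤ e^{−g' n} (D(1, M₀)/Z − (E/Z)²) + 16 B² X`
(split `i = i₀` / `i ≠ i₀` and `j = i₀` / `j ≠ i₀`: the `(i₀)`-column gives `c² + P`, `P(n+1) ≤ e^{−g n} P(1)` termwise,
everything else is `O(B² X)`; `Z = 1 + X_N ≥ 1`; the case `X > 1` is settled in the assembly by the a priori sizes). [folklore] -/
theorem stub_relativeBookkeeping :
    ∀ (ι : Type) (i₀ : ι) (r : ι → ℝ) (sq : ι → ι → ℝ) (dg : ι → ℝ) (B g g' X : ℝ) (n M M₀ p N : ℕ),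
      (∀ i, 0 ≤ r i ∧ r i ≤ 1) → r i₀ = 1 → 0 ≤ g' → g' ≤ g → (∀ i, i ≠ i₀ → r i ≤ Real.exp (-g)) →
      (∀ j i, 0 ≤ sq j i) → (∀ i, Summable (fun j => sq j i) ∧ ∑' j, sq j i ≤ B ^ 2) →
      (∀ i, |dg i| ≤ B) → dg i₀ ^ 2 = sq i₀ i₀ → 0 ≤ X → X ≤ 1 →
      Summable (fun i => r i ^ M) → Summable (fun i => r i ^ M₀) → Summable (fun i => r i ^ p) →
      Summable (fun i => r i ^ N) →
      (∑' i, r i ^ M) - 1 ≤ X → (∑' i, r i ^ M₀) - 1 ≤ X → (∑' i, r i ^ p) - 1 ≤ X → (∑' i, r i ^ N) - 1 ≤ X →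
      Summable (fun pr : ι × ι => r pr.2 ^ (n + 1) * r pr.1 ^ M * sq pr.2 pr.1) →
      Summable (fun pr : ι × ι => r pr.2 ^ 1 * r pr.1 ^ M₀ * sq pr.2 pr.1) →
      Summable (fun i => r i ^ p * dg i) →
      |(∑' pr : ι × ι, r pr.2 ^ (n + 1) * r pr.1 ^ M * sq pr.2 pr.1) / (∑' i, r i ^ N) -
          ((∑' i, r i ^ p * dg i) / (∑' i, r i ^ N)) ^ 2| ≤
        Real.exp (-(g' * n)) * ((∑' pr : ι × ι, r pr.2 ^ 1 * r pr.1 ^ M₀ * sq pr.2 pr.1) / (∑' i, r i ^ N) -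
          ((∑' i, r i ^ p * dg i) / (∑' i, r i ^ N)) ^ 2) + 16 * B ^ 2 * X :=
  -- LANDED (wave r8, worker W2, p129105): Theorems/PencilRigidityWeakCouplingHypercubicLimitStubRelativeBookkeeping.lean
  _root_.Summit.QuantumFields.YangMills.Theorems.WeakCouplingHypercubicLimit.TraceNormColdPressure.stub_relativeBookkeeping

/-- `stub_blockReversalTranspose` (R3, r8; ABSTRACT measure theory, the shapes of `stub_slabContraction`) — **the
contracted kernel of a REVERSED block observable is the transpose.**  Slices `(X, μ)`, fibres `(Γ, ν)` (probability
spaces), a bounded measurable one-step weight `c(x, γ, x')` with the TIME-REVERSAL symmetry `c(x, ι γ, x') = c(x', γ, x)`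
for a measurable `ν`-preserving involution `ι : Γ → Γ` (in a lattice gauge theory: inversion of the temporal links); a bounded
measurable block observable `α` of `r+2` slices and `r+1` fibres, and its reversal
`α'(W, γ⃗) = α(W ∘ rev, ι ∘ γ⃗ ∘ rev)`.  Then `X_{α'}(u, u') = X_α(u', u)` for the contracted block kernels
`X_α(u,u') = ∫∫ α(u ∷ v :: u', γ⃗) ∏ᵢ c((u ∷ v :: u')ᵢ, γᵢ, (u ∷ v :: u')ᵢ₊₁) dν^{⊗(r+1)} dμ^{⊗r}` (reverse the interior
slices and the fibres — measure-preserving — and reindex the weight `i ↦ r − i`).  This is the path-space form of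
Osterwalder–Seiler reflection positivity: the reflected slab operator is the adjoint. [folklore] -/
theorem stub_blockReversalTranspose :
    ∀ (X Γ : Type) [MeasurableSpace X] [MeasurableSpace Γ] (μ : Measure X) (ν : Measure Γ)
      [IsProbabilityMeasure μ] [IsProbabilityMeasure ν] (c : X → Γ → X → ℝ) (Cc : ℝ) (ιΓ : Γ → Γ),
      Measurable (fun q : X × Γ × X => c q.1 q.2.1 q.2.2) → (∀ x γ x', 0 ≤ c x γ x' ∧ c x γ x' ≤ Cc) →
      Measurable ιΓ → MeasurePreserving ιΓ ν ν → (∀ γ, ιΓ (ιΓ γ) = γ) → (∀ x γ x', c x (ιΓ γ) x' = c x' γ x) →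
    ∀ (r : ℕ) (α : (Fin (r + 2) → X) → (Fin (r + 1) → Γ) → ℝ) (Cα : ℝ),
      Measurable (fun q : (Fin (r + 2) → X) × (Fin (r + 1) → Γ) => α q.1 q.2) → (∀ W γs, |α W γs| ≤ Cα) →
    ∀ u u' : X,
      (∫ v : Fin r → X, ∫ γs : Fin (r + 1) → Γ,
          (fun (W : Fin (r + 2) → X) (δs : Fin (r + 1) → Γ) => α (fun i => W (Fin.rev i)) (fun i => ιΓ (δs (Fin.rev i))))
            (Fin.cons u (Fin.snoc v u')) γs *
          ∏ i : Fin (r + 1), c ((Fin.cons u (Fin.snoc v u') : Fin (r + 2) → X) (Fin.castSucc i)) (γs i)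
            ((Fin.cons u (Fin.snoc v u') : Fin (r + 2) → X) (Fin.succ i)) ∂(Measure.pi fun _ => ν) ∂(Measure.pi fun _ => μ)) =
      ∫ v : Fin r → X, ∫ γs : Fin (r + 1) → Γ, α (Fin.cons u' (Fin.snoc v u)) γs *
          ∏ i : Fin (r + 1), c ((Fin.cons u' (Fin.snoc v u) : Fin (r + 2) → X) (Fin.castSucc i)) (γs i)
            ((Fin.cons u' (Fin.snoc v u) : Fin (r + 2) → X) (Fin.succ i)) ∂(Measure.pi fun _ => ν) ∂(Measure.pi fun _ => μ) :=
  -- LANDED (wave r8, worker W4, p128877): Theorems/PencilRigidityWeakCouplingHypercubicLimitStubBlockReversalTranspose.lean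
  _root_.Summit.QuantumFields.YangMills.Theorems.WeakCouplingHypercubicLimit.TraceNormColdPressure.stub_blockReversalTranspose

/-- `stub_wilsonStepReversal` (R4, r8) — **time-reversal symmetry of Wilson's one-step Boltzmann factor.**  For a
faithful unitary `r : LatticeRep G`: (a) inverting the temporal links swaps the two slices of the temporal plaquette
energy, `S_tm(U, g⁻¹, U') = S_tm(U', g, U)` (`Re tr ρ(h⁻¹) = Re tr ρ(h)` for unitary `ρ(h)`, cyclicity of the trace);
(b) pointwise inversion of the temporal links preserves their product Haar measure (compact groups are unimodular).
Cf. `SlabTransferKernel.elecSum_swap_inv` / `sliceKernel_symm` for the finite-temperature configuration type. [folklore] -/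
theorem stub_wilsonStepReversal :
    ∀ (G : Type) [Group G] [TopologicalSpace G] [IsTopologicalGroup G] [CompactSpace G]
      [MeasurableSpace G] [BorelSpace G] (r : LatticeRep G) (N : ℕ) [NeZero N],
      (∀ (U U' : GaugeConfig 3 N G) (g : Site 3 N → G),
          sliceTemporalAction r.ρ U (fun x => (g x)⁻¹) U' = sliceTemporalAction r.ρ U' g U) ∧
      Measurable (fun g : Site 3 N → G => fun x => (g x)⁻¹) ∧
      MeasurePreserving (fun g : Site 3 N → G => fun x => (g x)⁻¹)
        (Measure.pi fun _ : Site 3 N => haarProbability G) (Measure.pi fun _ : Site 3 N => haarProbability G) :=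
  -- LANDED (wave r8, worker W5, p128755): Theorems/PencilRigidityWeakCouplingHypercubicLimitStubWilsonStepReversal.lean
  _root_.Summit.QuantumFields.YangMills.Theorems.WeakCouplingHypercubicLimit.TraceNormColdPressure.stub_wilsonStepReversal

/-- `stub_kernelOpTranspose` (R5, r8; ABSTRACT `L²` operator theory) — **the integral operator of the transposed kernel
is the adjoint**: for bounded strongly measurable kernels `X_a`, `X_b` on a probability space with `X_b(x,y) = X_a(y,x)`
and `L²` operators `Â`, `B̂` acting a.e. as the kernel integrals (`exists_kernelOp`), `⟪f, Â g⟫ = ⟪B̂ f, g⟫` on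
`L²(μ)` (Fubini; the non-symmetric twin of `isSelfAdjoint_kernelOp`). [folklore] -/
theorem stub_kernelOpTranspose :
    ∀ (X : Type) [MeasurableSpace X] (μ : Measure X) [IsProbabilityMeasure μ] (Xa Xb : X → X → ℝ) (C : ℝ),
      StronglyMeasurable (Function.uncurry Xa) → StronglyMeasurable (Function.uncurry Xb) →
      (∀ x y, ‖Xa x y‖ ≤ C) → (∀ x y, ‖Xb x y‖ ≤ C) → (∀ x y, Xb x y = Xa y x) →
    ∀ (Aop Bop : Lp ℝ 2 μ →L[ℝ] Lp ℝ 2 μ),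
      (∀ φ : Lp ℝ 2 μ, (Aop φ : X → ℝ) =ᵐ[μ] fun x => ∫ y, Xa x y * φ y ∂μ) →
      (∀ φ : Lp ℝ 2 μ, (Bop φ : X → ℝ) =ᵐ[μ] fun x => ∫ y, Xb x y * φ y ∂μ) →
    ∀ f g : Lp ℝ 2 μ, inner ℝ f (Aop g) = inner ℝ (Bop f) g :=
  -- LANDED (wave r8, worker W6, p128709): Theorems/PencilRigidityWeakCouplingHypercubicLimitStubKernelOpTranspose.lean
  _root_.Summit.QuantumFields.YangMills.Theorems.WeakCouplingHypercubicLimit.TraceNormColdPressure.stub_kernelOpTranspose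

/-- `stub_rpSpectralOfColdPressure` (R6, r8; the LEAD's stub, assembled from T1, T2, R1–R5 and the gap-`(a+1)` Literature
variants) — **cold pressure forces the RP-spectral relative clustering of reflected slab functionals** at a fixed
coupling `β ≥ 0`: if the cold tori `S ≥ S₁` obey `traceExcess r.ρ β (2S+1) (m+2) ≤ C₀ (2S+1)³ e^{−g (m+2)}`
(`S + 1 ≤ 2(m+2)`, `g ≥ 0`), then for every bounded measurable functional `Y` of the time slab `[1, T]` of `ℤ⁴` (sup
`B`), every `S ≥ S₁` and `T, n` with `2(T+n+1) ≤ S`, and every rate `0 ≤ g' ≤ g`,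
`|∫ (Y∘lift∘Θ_T)·(Y∘τ_n∘lift) dμ − (∫ Y∘lift dμ)²| ≤ e^{−g' n} (∫ (Y∘lift∘Θ_T)·(Y∘lift) dμ − (∫ Y∘lift dμ)²)
 + 16 C₀ (2S+1)³ e^{−3gS/4} B²`, `μ = wilsonMeasure r.ρ β` on `GaugeConfig 4 (2S+1) G` — the body of `GapData` (iii-b)
(`PencilRigidityHypercubicLimitDefs`) with `ε S = 16 C₀ (2S+1)³ e^{−3gS/4} → 0`, and, along a scheme with the volume
floor, the body of `IRInputs` (b) of the coupling-response host of stmt-16154 (rate `Δ/4`). [folklore] -/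
theorem stub_rpSpectralOfColdPressure :
    ∀ (G : Type) [Group G] [TopologicalSpace G] [IsTopologicalGroup G] [CompactSpace G]
      [MeasurableSpace G] [BorelSpace G] (r : LatticeRep G) (β : ℝ), 0 ≤ β →
    ∀ (g C₀ : ℝ) (S₁ : ℕ), 0 ≤ g → 0 ≤ C₀ →
      (∀ S : ℕ, S₁ ≤ S → ∀ m : ℕ, S + 1 ≤ 2 * (m + 2) →
        traceExcess r.ρ β (2 * S + 1) (m + 2) ≤ C₀ * ((2 * S + 1 : ℕ) : ℝ) ^ 3 * Real.exp (-(g * ((m + 2 : ℕ) : ℝ)))) →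
    ∀ (S T n : ℕ), S₁ ≤ S → 2 * (T + n + 1) ≤ S →
    ∀ (Y : LGConfig 4 G → ℝ) (B : ℝ), Measurable Y → (∀ U, |Y U| ≤ B) →
      DependsOn Y {e : Literature.MathematicalPhysics.QuantumLattice.ZdEdge 4 |
        1 ≤ e.1 0 ∧ e.1 0 + (if e.2 = 0 then 1 else 0) ≤ T} →
    ∀ g' : ℝ, 0 ≤ g' → g' ≤ g →
      |(∫ U, Y (torusLift (2 * S + 1) (GaugeConfig.timeReflect U)) *
            Y (configShift (-Pi.single 0 (n : ℤ)) (torusLift (2 * S + 1) U))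
          ∂(wilsonMeasure r.ρ β : Measure (GaugeConfig 4 (2 * S + 1) G))) -
        (∫ U, Y (torusLift (2 * S + 1) U) ∂(wilsonMeasure r.ρ β : Measure (GaugeConfig 4 (2 * S + 1) G))) ^ 2| ≤
      Real.exp (-(g' * n)) *
          ((∫ U, Y (torusLift (2 * S + 1) (GaugeConfig.timeReflect U)) * Y (torusLift (2 * S + 1) U)
              ∂(wilsonMeasure r.ρ β : Measure (GaugeConfig 4 (2 * S + 1) G))) -
            (∫ U, Y (torusLift (2 * S + 1) U) ∂(wilsonMeasure r.ρ β : Measure (GaugeConfig 4 (2 * S + 1) G))) ^ 2) +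
        16 * C₀ * ((2 * S + 1 : ℕ) : ℝ) ^ 3 * Real.exp (-(g * (3 * (S : ℝ) / 4))) * B ^ 2 :=
  -- LANDED (lead c3, p129909): Theorems/PencilRigidityWeakCouplingHypercubicLimitStubRpSpectralOfColdPressure.lean — assembled from
  -- reflectedPair_transferForm p129751 (+ ReflectedPairCylinder p129596), reflectedSpectralSums p129416 (+ Literature
  -- PositiveKernelSpectralTraceTwoSucc p129129, SlabFibreContractionSucc p128737), relativeBound_of_reflectedSums p129731, R1–R5;
  -- same file: the scheme corollary `rpSpectral_of_coldPressure_scheme` (IRInputs (b) shape, rate Δ/4, error 16 K B² e^{−(Δ/4) a_k S})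
  _root_.Summit.QuantumFields.YangMills.Theorems.WeakCouplingHypercubicLimit.TraceNormColdPressure.stub_rpSpectralOfColdPressure

/-! ### §6 Reshape r10 (lead c4, 2026-08-16T23Z): the heart made LATTICE-SIDE — record

The r8–r9 heart S6c `stub_coldPressureOneField` (the crux with the CONTINUUM OS package of the limit family assumed
verbatim and its IR clause in cold-pressure form) was superseded at r10 by the LATTICE-SIDE heart S6d
`stub_latticeColdPressure`: weak coupling ∧ `PolyVolume` ∧ `PolyRenorm` ∧ bounded counterterm ∧ `UniformMomentBoundsPlanes`
∧ NT/κ₃ lattice floors ∧ volume floor ∧ cold pressure, composed through the twin crux stmt-16154's landed closure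
vocabulary (`IRInputs`, `PlaneLimits`, `SoftHalf`, `ReflHalf`, …) and the Z-pieces below (all LANDED; kept as references).
Its two bridges `irInputsAB_of_coldPressure` / `irInputs_of_coldPressure` and `reflHalf_of_pieces` LANDED (p130991,
`Theorems/PencilRigidityWeakCouplingHypercubicLimitIRInputsOfColdPressure.lean`).  The r10c heart is QUOTED verbatim in
§7 as the hypothesis of `latticeCore_of_coldPressureHeart` (reshape monotonicity: the r11 heart is weaker). -/

section R10

open Summit.QuantumFields.YangMills.Cruxes.HypercubicLimit.CouplingResponse
open Summit.QuantumFields.YangMills.Cruxes.OSLegsFromFemtoAndGap.DlrCollarTransfer (conn Decay RPPos ConnCS)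

/-- **Cold pressure ⇒ `IRInputs` (a) ∧ (b)** (r10 bridge): along a scheme with `β_k ≥ 0` eventually, the volume floor
and the cold-pressure bound at rate `Δ > 0` give `HasLatticeMassGap r sch (Δ/4)` and `RPSpectral r sch (Δ/4) (16 K)`. [folklore] -/
theorem irInputsAB_of_coldPressure :
    ∀ (G : Type) [Group G] [TopologicalSpace G] [IsTopologicalGroup G] [CompactSpace G]
      [MeasurableSpace G] [BorelSpace G] (r : LatticeRep G) (sch : SpeciesScheme (YMSpecies G)) (Δ C₀ K : ℝ),
      (∀ᶠ k in Filter.atTop, 0 ≤ sch.β k) → 0 < Δ → 0 ≤ C₀ →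
      (∀ᶠ k in Filter.atTop, ∀ S : ℕ, sch.L k ≤ S →
        C₀ * ((2 * S + 1 : ℕ) : ℝ) ^ 3 * Real.exp (-(Δ * sch.a k * S / 2)) ≤ K) →
      (∀ᶠ k in Filter.atTop, ∀ S : ℕ, sch.L k ≤ S → ∀ m : ℕ, S + 1 ≤ 2 * (m + 2) →
        traceExcess r.ρ (sch.β k) (2 * S + 1) (m + 2) ≤
          C₀ * ((2 * S + 1 : ℕ) : ℝ) ^ 3 * Real.exp (-(Δ * sch.a k * ((m + 2 : ℕ) : ℝ)))) →
      HasLatticeMassGap r sch (Δ / 4) ∧ RPSpectral r sch (Δ / 4) (16 * K) :=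
  -- LANDED (lead c4, p130991): Theorems/PencilRigidityWeakCouplingHypercubicLimitIRInputsOfColdPressure.lean
  _root_.Summit.QuantumFields.YangMills.Theorems.WeakCouplingHypercubicLimit.TraceNormColdPressure.irInputsAB_of_coldPressure

/-- `stub_functionalBoundPlanes` (Z1, r10; VERBATIM the twin stmt-16154's registered `stub_functionalBoundPlanes`,
XL) — **smeared → functional**: from the `k`-uniform `n!`-bounds on normalised plane-wise disjoint 6-tuples (and
polynomial volume growth, for the torus seam) to the `k`-uniform E0′-type bound on ALL of `⁰𝒮` for every renormalised
plane-string distribution. [folklore] -/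
theorem stub_functionalBoundPlanes :
    ∀ (G : Type) [Group G] [TopologicalSpace G] [IsTopologicalGroup G] [CompactSpace G]
      [MeasurableSpace G] [BorelSpace G] (r : LatticeRep G) (sch : SpeciesScheme (YMSpecies G)),
      PolyVolume sch → UniformMomentBoundsPlanes r sch → UniformFunctionalBoundPlanes r sch :=
  -- LANDED by the twin seat 16154-c2 (p136268): Theorems/MirrorModularBoostsHypercubicLimitFunctionalBoundPlanes.lean
  _root_.Summit.QuantumFields.YangMills.Cruxes.HypercubicLimit.CouplingResponse.stub_functionalBoundPlanes

/-- `stub_softLegsPlanes` (Z3a, r10c: the twin stmt-16154's `stub_softLegsPlanes` WITH the extra `PolyRenorm` hypothesis of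
its landed Mono form, L) — **the soft legs** of the candidate family `planeSum T` along the sub-scheme. [folklore] -/
theorem stub_softLegsPlanes :
    ∀ (G : Type) [Group G] [TopologicalSpace G] [IsTopologicalGroup G] [CompactSpace G]
      [MeasurableSpace G] [BorelSpace G] (r : LatticeRep G) (sch : SpeciesScheme (YMSpecies G))
      (φ : ℕ → ℕ) (hφ : StrictMono φ)
      (T : (n : ℕ) → (Fin n → Plane) → (𝓢((Fin n → EuclideanSpace ℝ (Fin 4)), ℂ) →L[ℂ] ℂ)),
      sch.HasWeakCouplingLimit → PolyVolume sch → PolyRenorm r sch → UniformFunctionalBoundPlanes r sch → IRInputs r sch →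
        PlaneLimits r sch φ T → ∀ Δ : ℝ, 0 < Δ → HasLatticeMassGap r sch Δ →
          SoftHalf r (subseq sch φ hφ) (planeSum T) Δ :=
  -- LANDED by the twin seat 16154-c2: `softLegsPlanes_of_translationMono` applied to `stub_translationPlanesMono`
  _root_.Summit.QuantumFields.YangMills.Cruxes.HypercubicLimit.CouplingResponse.softLegsPlanes_of_translationMono
    _root_.Summit.QuantumFields.YangMills.Cruxes.HypercubicLimit.CouplingResponse.stub_translationPlanesMono

/-- `stub_rpPosOfPlaneLimits` (Z3b-RP, r10; L) — **reflection positivity of the limit on positive-time off-diagonal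
tuples** (`RPPos`), from Osterwalder–Seiler positivity of Wilson's measure on the odd torus through the separated dense
class. [folklore] -/
theorem stub_rpPosOfPlaneLimits :
    ∀ (G : Type) [Group G] [TopologicalSpace G] [IsTopologicalGroup G] [CompactSpace G]
      [MeasurableSpace G] [BorelSpace G] (r : LatticeRep G) (sch : SpeciesScheme (YMSpecies G))
      (φ : ℕ → ℕ) (hφ : StrictMono φ)
      (T : (n : ℕ) → (Fin n → Plane) → (𝓢((Fin n → EuclideanSpace ℝ (Fin 4)), ℂ) →L[ℂ] ℂ)),
      (∀ᶠ k in atTop, 0 ≤ sch.β k) → UniformFunctionalBoundPlanes r sch → PlaneLimits r sch φ T →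
        RPPos (planeSum T) :=
  -- LANDED (wave 3, p135970): Theorems/PencilRigidityWeakCouplingHypercubicLimitRPPosOfPlaneLimits.lean
  _root_.Summit.QuantumFields.YangMills.Theorems.WeakCouplingHypercubicLimit.TraceNormColdPressure.stub_rpPosOfPlaneLimits

/-- `stub_signedPermOfPlaneLimits` (Z3b-SP, r10; L) — **invariance of the limit under every signed permutation of the
axes on `⁰𝒮`** (the full hyperoctahedral group `W(B₄)`). [folklore] -/
theorem stub_signedPermOfPlaneLimits :
    ∀ (G : Type) [Group G] [TopologicalSpace G] [IsTopologicalGroup G] [CompactSpace G]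
      [MeasurableSpace G] [BorelSpace G] (r : LatticeRep G) (sch : SpeciesScheme (YMSpecies G))
      (φ : ℕ → ℕ) (hφ : StrictMono φ)
      (T : (n : ℕ) → (Fin n → Plane) → (𝓢((Fin n → EuclideanSpace ℝ (Fin 4)), ℂ) →L[ℂ] ℂ)),
      UniformFunctionalBoundPlanes r sch → PlaneLimits r sch φ T →
        ∀ (n : ℕ) (R : EuclideanSpace ℝ (Fin 4) ≃ₗᵢ[ℝ] EuclideanSpace ℝ (Fin 4)),
          (∀ i : Fin 4, ∃ j : Fin 4, R (EuclideanSpace.single i 1) = EuclideanSpace.single j 1 ∨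
            R (EuclideanSpace.single i 1) = -EuclideanSpace.single j 1) →
          ∀ F : 𝓢((Fin n → EuclideanSpace ℝ (Fin 4)), ℂ), IsOffDiagonal F →
            planeSum T n (linActMulti R F) = planeSum T n F :=
  -- LANDED (wave 3, p136429): Theorems/PencilRigidityWeakCouplingHypercubicLimitSignedPerm.lean
  _root_.Summit.QuantumFields.YangMills.Theorems.WeakCouplingHypercubicLimit.TraceNormColdPressure.stub_signedPermOfPlaneLimits

/-- `stub_decayOfRPSpectral` (Z3b-D, r10; THIS LINE's transfer) — **RP-spectral relative clustering on the lattice ⇒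
exponential decay of the diagonal connected OS form of the limit** (`Decay (planeSum T) Δ`). [folklore] -/
theorem stub_decayOfRPSpectral :
    ∀ (G : Type) [Group G] [TopologicalSpace G] [IsTopologicalGroup G] [CompactSpace G]
      [MeasurableSpace G] [BorelSpace G] (r : LatticeRep G) (sch : SpeciesScheme (YMSpecies G))
      (φ : ℕ → ℕ) (hφ : StrictMono φ)
      (T : (n : ℕ) → (Fin n → Plane) → (𝓢((Fin n → EuclideanSpace ℝ (Fin 4)), ℂ) →L[ℂ] ℂ)) (Δ C : ℝ),
      0 < Δ → PolyVolume sch → PolyRenorm r sch → (∃ Cm : ℝ, ∀ k, |sch.m r.curvature k| ≤ Cm) →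
        UniformFunctionalBoundPlanes r sch → PlaneLimits r sch φ T → RPSpectral r sch Δ C → Decay (planeSum T) Δ :=
  -- LANDED (lead c4, p136008): Theorems/PencilRigidityWeakCouplingHypercubicLimitDecayOfRPSpectral.lean (+ toolkit A p135306, B p135672)
  _root_.Summit.QuantumFields.YangMills.Theorems.WeakCouplingHypercubicLimit.TraceNormColdPressure.stub_decayOfRPSpectral

end R10

/-! ### §7 Reshape r11 (lead c5, 2026-08-17): the heart made MINIMAL — the common lattice-side core of 16120/16154

Audit of r10c against what the landed machinery actually consumes (ours and the twin stmt-16154's, whose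
`oneFieldClauses_of_uniformMomentBoundsPlanes` (p136824) takes exactly weak coupling, `PolyVolume`, `PolyRenorm`, a bounded
counterterm, `UniformMomentBoundsPlanes` and `IRInputs`):
* cold pressure + the volume floor enter ONLY through the landed `irInputs_of_coldPressure` (⇒ `IRInputs`), so the
  heart may carry `IRInputs r sch` (the twin's clauses (a)–(d)) instead — strictly weaker, and the line's lever stays a
  landed sufficient condition for it (`latticeCore_of_coldPressureHeart` below records r10c-heart ⇒ r11-heart);
* the volume floor is a CONSEQUENCE of `PolyVolume` and `a_k L_k → ∞` (W4 `stub_volumeFloor`): `(2S'+1)³e^{−Δa_kS'/2}` is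
  decreasing in `S' ≥ L_k` once `a_k(2L_k+1) ≥ 12/Δ`, and `(2L_k+1)³ ≤ 27 (a_kL_k)^{3(N+1)}` by `a_k⁻¹ ≤ (a_kL_k)^N`;
* the bounded-counterterm conjunct is DERIVABLE with the same scheme (`stub_countertermBound`, p138229, parallel c5 process: the
  NT floor bounds `|c_k|` below, UMB at `n = 1` bounds `c_k(6⟨P⟩_k − m_k)`), and — the route first registered here, kept as the
  reusable W2 — removable by re-centring: W3 `stub_recentringWitness`
  (UMB at `n = 1` on single-plane tuples + translation invariance of Wilson's torus state pin `c_k(6⟨P⟩_k − m_k)` to a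
  bounded sequence, so `m'_k := 6⟨P_{01}⟩_k` (eventually; `m_k` before) is bounded with `c_k(m'_k − m_k)` bounded), W1
  `stub_momentBoundsRecentre` (UMB survives any re-centring with `c_k(m'_k − m_k)` bounded: the fields shift by
  `k`-uniformly bounded constants on normalised tuples — `a⁴Σ_{x∈box}|u(ax)| ≤ K|u|_s` uniformly — and
  `∏(Xᵢ+σᵢ) = Σ_t ∏_{i∈t}Xᵢ ∏_{i∉t}σᵢ` with `Σ_t C₁^{|t|}D^{n−|t|}|t|! ≤ (C₁+D)ⁿ n!`), W2 `stub_irInputsRecentre`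
  (`IRInputs` is blind to the counterterm: (a),(b) do not read `m`, the cumulants of (c),(d) are shift-invariant).
So the r11 HEART is S6e `stub_latticeCore`: for every compact simple `G`, `∃ r sch`, weak coupling ∧ `PolyVolume` ∧
`PolyRenorm` ∧ `UniformMomentBoundsPlanes r sch` ∧ `IRInputs r sch` — five conjuncts, no continuum object, no normalisation
small print; it is the statement BOTH cruxes 16120 and 16154 are closed modulo (the twin drops its counterterm conjunct by
the same W1–W3), i.e. the one item the planners should promote.  Composition: heart ⇒ (`core_of_latticeCore`, from W1–W3)
the six-conjunct input of `oneFieldClauses_of_uniformMomentBoundsPlanes` ⇒ `hypercubicLimit_iff_oneFieldWeak` ⇒ stmt-16154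
⇒ this crux (`stub_siblingTie`).  Schemes that differ only in the counterterm are written with the anonymous constructor
`⟨sch.a, sch.a_pos, sch.tendsto_a, sch.β, sch.L, sch.tendsto_L, sch.c, m'⟩` (= `{ sch with m := m' }`; the registry truncates
stub signatures at the first `:=`, so the structure-update notation must not appear in a stub header) so that every other
field agrees DEFINITIONALLY (same torus types). -/

section R11

open Summit.QuantumFields.YangMills.Cruxes.HypercubicLimit.CouplingResponse

/-- `stub_irInputsRecentre` (W2, r11; M) — **`IRInputs` is blind to the counterterms.**  Clauses (a) `HasLatticeMassGap`
and (b) (RP-spectral clustering of slab functionals) read only `β, a, L`; in (c),(d) each smeared curvature field of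
`{sch with m := m'}` is that of `sch` plus the constant `c_k a_k⁴ (Σ_{x∈box} f(a_k x))(m_k − m'_k)`, and the second and
third cumulants of bounded random variables under a probability measure are invariant under constant shifts
(`latticeSchwinger` unfolded with `Fin.prod_univ_two/three`; Wilson's torus measure is a probability measure). [folklore] -/
theorem stub_irInputsRecentre :
    ∀ (G : Type) [Group G] [TopologicalSpace G] [IsTopologicalGroup G] [CompactSpace G]
      [MeasurableSpace G] [BorelSpace G] (r : LatticeRep G) (sch : SpeciesScheme (YMSpecies G))
      (m' : YMSpecies G → ℕ → ℝ), IRInputs r sch →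
        IRInputs r ⟨sch.a, sch.a_pos, sch.tendsto_a, sch.β, sch.L, sch.tendsto_L, sch.c, m'⟩ :=
  -- LANDED (wave 1, worker W2, p138949): Theorems/PencilRigidityWeakCouplingHypercubicLimitStubIrInputsRecentre.lean
  _root_.Summit.QuantumFields.YangMills.Theorems.WeakCouplingHypercubicLimit.TraceNormColdPressure.stub_irInputsRecentre

/-- `stub_volumeFloor` (W4, r11; S/M) — **polynomial volume growth gives the volume floor of the cold-pressure lever.**
For `S' ≥ L`, `((2S'+1)/(2L+1))³ ≤ e^{6(S'−L)/(2L+1)}` (`1 + x ≤ eˣ`), so `(2S'+1)³e^{−ΔaS'/2} ≤ (2L+1)³e^{−ΔaL/2}` once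
`12 ≤ Δ a (2L+1)`; eventually `a_k ≤ 1 ≤ L_k`, `a_k(2L_k+1) ≥ 12/Δ` (`a_kL_k → ∞`) and `2L_k+1 ≤ 3L_k ≤ 3(a_kL_k)^{N+1}`
(`PolyVolume`), while `x ↦ 27 x^{3(N+1)} e^{−Δx/2}` is bounded on `[0, ∞)`. [folklore] -/
theorem stub_volumeFloor :
    ∀ (ι : Type) (sch : SpeciesScheme ι) (Δ C₀ : ℝ), 0 < Δ → 0 ≤ C₀ → PolyVolume sch →
      ∃ K : ℝ, ∀ᶠ k in Filter.atTop, ∀ S' : ℕ, sch.L k ≤ S' →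
        C₀ * ((2 * S' + 1 : ℕ) : ℝ) ^ 3 * Real.exp (-(Δ * sch.a k * S' / 2)) ≤ K :=
  -- LANDED (wave 1, worker W4, p137870): Theorems/PencilRigidityWeakCouplingHypercubicLimitStubVolumeFloor.lean
  _root_.Summit.QuantumFields.YangMills.Theorems.WeakCouplingHypercubicLimit.TraceNormColdPressure.stub_volumeFloor

/-- **The minimal core gives the six-conjunct core** — the bounded-counterterm conjunct is DERIVABLE: the non-triviality floor
(`IRInputs` (c)) bounds `|c_k|` below and UMB at `n = 1` bounds `c_k(6⟨P⟩_k − m_k)`, so `m_k` itself is bounded with the SAME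
scheme (`stub_countertermBound`, LANDED p138229 by the parallel c5 process, packaged as `countertermBound_of_irInputs` in
`…OfLatticeCore.lean`, p138607).  The re-centring route (W2 `stub_irInputsRecentre` + W1/W3) is thereby unnecessary for the
composition; W2 is kept (landed as a reusable fact), W1/W3 are withdrawn. [folklore] -/
theorem core_of_latticeCore {G : Type} [Group G] [TopologicalSpace G] [IsTopologicalGroup G] [CompactSpace G]
    [MeasurableSpace G] [BorelSpace G] (r : LatticeRep G) (sch : SpeciesScheme (YMSpecies G))
    (hw : sch.HasWeakCouplingLimit) (hpv : PolyVolume sch) (hpr : PolyRenorm r sch)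
    (hUMB : UniformMomentBoundsPlanes r sch) (hIR : IRInputs r sch) :
    ∃ sch' : SpeciesScheme (YMSpecies G), sch'.HasWeakCouplingLimit ∧ PolyVolume sch' ∧ PolyRenorm r sch' ∧
      (∃ Cm : ℝ, ∀ k, |sch'.m r.curvature k| ≤ Cm) ∧ UniformMomentBoundsPlanes r sch' ∧ IRInputs r sch' :=
  ⟨sch, hw, hpv, hpr,
    _root_.Summit.QuantumFields.YangMills.Theorems.WeakCouplingHypercubicLimit.TraceNormColdPressure.countertermBound_of_irInputs
      r sch hUMB hIR, hUMB, hIR⟩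

/-- **Reshape monotonicity: the r10c heart implies the r11 heart** (verbatim quotation of r10c's `stub_latticeColdPressure`
as hypothesis; cold pressure + volume floor + floors ⇒ `IRInputs` is the landed `irInputs_of_coldPressure`, `β_k ≥ 0`
eventually from weak coupling). [folklore] -/
theorem latticeCore_of_coldPressureHeart
    (h : ∀ (G : Type) [Group G] [TopologicalSpace G] [IsTopologicalGroup G] [CompactSpace G]
      [MeasurableSpace G] [BorelSpace G], IsCompactSimpleLieGroup G →
      ∃ (r : LatticeRep G) (sch : SpeciesScheme (YMSpecies G)),
        sch.HasWeakCouplingLimit ∧ PolyVolume sch ∧ PolyRenorm r sch ∧ (∃ Cm : ℝ, ∀ k, |sch.m r.curvature k| ≤ Cm) ∧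
        UniformMomentBoundsPlanes r sch ∧
        (∃ (u v : 𝓢(EuclideanSpace ℝ (Fin 4), ℝ)) (δ : ℝ),
          tsupport u ⊆ {y : EuclideanSpace ℝ (Fin 4) | y 0 < 0} ∧
          tsupport v ⊆ {y : EuclideanSpace ℝ (Fin 4) | 0 < y 0} ∧ 0 < δ ∧
          ∀ᶠ k in atTop, δ ≤
            |latticeSchwinger r.ρ sch (fun s => s.F) k (1 + 1) (fun _ => r.curvature) ![u, v] -
              latticeSchwinger r.ρ sch (fun s => s.F) k 1 (fun _ => r.curvature) ![u] *
                latticeSchwinger r.ρ sch (fun s => s.F) k 1 (fun _ => r.curvature) ![v]|) ∧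
        (∃ (f g h : 𝓢(EuclideanSpace ℝ (Fin 4), ℝ)) (δ : ℝ),
          Disjoint (tsupport f) (tsupport g) ∧ Disjoint (tsupport f) (tsupport h) ∧
          Disjoint (tsupport g) (tsupport h) ∧ 0 < δ ∧
          ∀ᶠ k in atTop, δ ≤
            |latticeSchwinger r.ρ sch (fun s => s.F) k 3 (fun _ => r.curvature) ![f, g, h] -
              latticeSchwinger r.ρ sch (fun s => s.F) k 1 (fun _ => r.curvature) ![f] *
                latticeSchwinger r.ρ sch (fun s => s.F) k 2 (fun _ => r.curvature) ![g, h] -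
              latticeSchwinger r.ρ sch (fun s => s.F) k 1 (fun _ => r.curvature) ![g] *
                latticeSchwinger r.ρ sch (fun s => s.F) k 2 (fun _ => r.curvature) ![f, h] -
              latticeSchwinger r.ρ sch (fun s => s.F) k 1 (fun _ => r.curvature) ![h] *
                latticeSchwinger r.ρ sch (fun s => s.F) k 2 (fun _ => r.curvature) ![f, g] +
              2 * (latticeSchwinger r.ρ sch (fun s => s.F) k 1 (fun _ => r.curvature) ![f] *
                latticeSchwinger r.ρ sch (fun s => s.F) k 1 (fun _ => r.curvature) ![g] *
                latticeSchwinger r.ρ sch (fun s => s.F) k 1 (fun _ => r.curvature) ![h])|) ∧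
        ∃ Δ C₀ K : ℝ, 0 < Δ ∧ 0 ≤ C₀ ∧
          (∀ᶠ k in Filter.atTop, ∀ S' : ℕ, sch.L k ≤ S' →
            C₀ * ((2 * S' + 1 : ℕ) : ℝ) ^ 3 * Real.exp (-(Δ * sch.a k * S' / 2)) ≤ K) ∧
          (∀ᶠ k in Filter.atTop, ∀ S' : ℕ, sch.L k ≤ S' → ∀ m : ℕ, S' + 1 ≤ 2 * (m + 2) →
            traceExcess r.ρ (sch.β k) (2 * S' + 1) (m + 2) ≤
              C₀ * ((2 * S' + 1 : ℕ) : ℝ) ^ 3 * Real.exp (-(Δ * sch.a k * ((m + 2 : ℕ) : ℝ))))) :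
    ∀ (G : Type) [Group G] [TopologicalSpace G] [IsTopologicalGroup G] [CompactSpace G]
      [MeasurableSpace G] [BorelSpace G], IsCompactSimpleLieGroup G →
      ∃ (r : LatticeRep G) (sch : SpeciesScheme (YMSpecies G)),
        sch.HasWeakCouplingLimit ∧ PolyVolume sch ∧ PolyRenorm r sch ∧
        UniformMomentBoundsPlanes r sch ∧ IRInputs r sch := by
  intro G _ _ _ _ _ _ hG
  obtain ⟨r, sch, hw, hpv, hpr, -, hUMB, hNT, hNG, Δ, C₀, K, hΔ, hC₀, hK, hP⟩ := h G hG
  exact ⟨r, sch, hw, hpv, hpr, hUMB,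
    _root_.Summit.QuantumFields.YangMills.Theorems.WeakCouplingHypercubicLimit.TraceNormColdPressure.irInputs_of_coldPressure
      r sch (hw.eventually_ge_atTop 0) hΔ hC₀ hK hP hNT hNG⟩

/-- **The cold-pressure lever without the volume-floor hypothesis** (W4 supplies the floor from `PolyVolume`): along a
scheme with `β_k ≥ 0` eventually and polynomial volume growth, the cold-pressure bound at rate `Δ` alone gives
`HasLatticeMassGap r sch (Δ/4)` and `RPSpectral r sch (Δ/4) (16 K)` for some `K`. [folklore] -/
theorem irInputsAB_of_coldPressure_polyVolume {G : Type} [Group G] [TopologicalSpace G] [IsTopologicalGroup G]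
    [CompactSpace G] [MeasurableSpace G] [BorelSpace G] (r : LatticeRep G) (sch : SpeciesScheme (YMSpecies G))
    {Δ C₀ : ℝ} (hβ : ∀ᶠ k in Filter.atTop, 0 ≤ sch.β k) (hΔ : 0 < Δ) (hC₀ : 0 ≤ C₀) (hpv : PolyVolume sch)
    (hP : ∀ᶠ k in Filter.atTop, ∀ S : ℕ, sch.L k ≤ S → ∀ m : ℕ, S + 1 ≤ 2 * (m + 2) →
      traceExcess r.ρ (sch.β k) (2 * S + 1) (m + 2) ≤
        C₀ * ((2 * S + 1 : ℕ) : ℝ) ^ 3 * Real.exp (-(Δ * sch.a k * ((m + 2 : ℕ) : ℝ)))) :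
    ∃ K : ℝ, HasLatticeMassGap r sch (Δ / 4) ∧ RPSpectral r sch (Δ / 4) (16 * K) := by
  obtain ⟨K, hK⟩ := stub_volumeFloor (YMSpecies G) sch Δ C₀ hΔ hC₀ hpv
  exact ⟨K, irInputsAB_of_coldPressure G r sch Δ C₀ K hβ hΔ hC₀ hK hP⟩

-- Record (r11c composition, LANDED p138607): the r11 common core implies the crux BY NAME — importable as
-- `…Theorems.WeakCouplingHypercubicLimit.TraceNormColdPressure.weakCouplingHypercubicLimit_of_latticeCore`
-- (not restated here: a second theorem concluding the crux would confuse the skeleton registry).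

end R11

/-! ### §8 Reshapes r12/r13 (lead c5, processes A and B, 2026-08-17): the SKEW cores — the final heart of the line

Three further weakenings of the r11 common core, all LANDED as tree theorems (namespace `…Theorems.WeakCouplingHypercubicLimit.TraceNormColdPressure`):
* r12 (process A, `…OfSkewCore.lean` p139629 over P1 `stub_ntOfSkewSeparated` p139002, P2 `stub_skewSeparatedOfLatticeFloor` p138964,
  P3 `stub_countertermBoundOfSkewFloor` p139190): the non-triviality floor (c) of `IRInputs` is REDUNDANT given the `κ₃` floor (d) in
  TIME-SEPARATED position — `RPPos` of the limit ⇒ `ConnCS` (`stub_gap`) ⇒ vanishing of all time-ordered truncated two-point functions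
  would kill the time-separated third cumulant; the bounded counterterm follows from the ORDER-ONE moment bound + the `κ₃` floor
  (`countertermBound_of_momentOne_skewFloor`, p139566).
* r13 (process B, `…GevreyMomentBounds.lean` p139303 + `…OfGevreySkewCore.lean` p139728): GEVREY growth `C₀C₁ⁿ(n!)^L` of the moments
  (the OS E0′ currency) already gives `UniformFunctionalBoundPlanes` (`functionalBoundPlanes_of_momentBoundsPow`); the closure is
  exposed at functional-bound level (`oneFieldClauses_of_functionalBoundSkewCore`) — `weakCouplingHypercubicLimit_of_latticeGevreySkewCore`.
* r13′ (process A, `…OfUfbSkewCore.lean` p139757): the heart may carry the FUNCTIONAL bound `UniformFunctionalBoundPlanes r sch` itself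
  (plus the order-one moment bound, used for the counterterm) — `weakCouplingHypercubicLimit_of_ufbSkewCore`.  Every UV currency on the hub
  plugs into it: Gaussian UMB (Z1 `stub_functionalBoundPlanes`), Gevrey moments (`functionalBoundPlanes_of_momentBoundsPow`), order-one
  holomorphy C⁺ (`stub_derivToMomentsPlanes`).
* r13″ (process A, `…OfUfbCore.lean` p139921): the order-one moment bound is itself `UniformFunctionalBoundPlanes` at `n = 1`
  (`momentOne_of_ufb`) — `weakCouplingHypercubicLimit_of_ufbCore`, SIX conjuncts.
HEART S6g `stub_ufbCore` = the hypothesis of `weakCouplingHypercubicLimit_of_ufbCore` (the WEAKEST landed spelling; the composition).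
Monotonicity, all PROVED below: skew core (r12) ⇒ Gevrey–skew core (`L = 1`) ⇒ UFB–skew core (p139303 + the order-one instance) ⇒
UFB core (forget).  The r11 core and the skew cores are incomparable as stated (disjoint vs time-separated `κ₃` supports; r11 carries the NT floor
the skew cores derive) — any realistic IR/UV route delivers the time-separated floor. -/

/-! ### §9 Reshape r14 (lead c6, 2026-08-17): the IR input made SINGLE — `RPSpectral ⇒ HasLatticeMassGap` by odd-torus reflection positivity

The c3/c5 census recorded "RPSpectral ⇏ HasLatticeMassGap as typed (window `n ∈ (S/2−T−1, S]`)".  The window closes WITHOUT spectral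
theory.  For a local gauge-invariant `P` with mirror `Pᴿ = P ∘ Θ` (`reflSpecies`; `Θ = cfgReflect`, the `ℤ⁴` reflection `t ↦ −t`, temporal
links inverted) write `D_P(j) = ⟨P · τ_{j e₀} Pᴿ⟩_{β,2S+1} − ⟨P⟩⟨Pᴿ⟩ = latticeConnectedCorr r.ρ β (2S+1) P.F Pᴿ.F j`.  At every `β ≥ 0` and for
every compact `G` (landed for stmt-9442, namespace `…Theorems.FiniteSusceptibilityWeakCoupling`, from `stub_rpCauchySchwarz stub_oddTorusRP` =
Osterwalder–Seiler positivity of Wilson's action on the ODD torus): `D_P ≥ 0` on `[2R+1, 2S−2R]` (`MirrorLogConvex.mirrorCorr_nonneg`), `D_P` is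
LOG-CONVEX WITH STEP ONE on `[2R+2, 2S−2R−1]` (`mirrorCorr_sq_le`: on the odd torus every reflection is a link-plane AND a site-plane reflection),
and `D_P(j) = D_{Pᴿ}(2S+1−j)` (`mirrorCorr_fold`).  `RPSpectral` read through `torusLift_timeReflect` bounds `D_P` at the SHORT lags `m ≲ S/2`
(K2); the right end of the window `[S/2, 3S/2]` is a short lag of `D_{Pᴿ}` by the fold; a non-negative step-one log-convex sequence is bounded
on an interval by its two end values (K3); so `|D_P(j)| ≲ B² e^{−Δ a_k S/2} ≤ B² e^{−(Δ/2) a_k j}` on the whole window `j ≤ S`, and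
`≲ B² e^{−Δ a_k j}` below it.  A general pair `(A, B)` at lag `n` is dominated by `D_A`, `D_{Aᴿ}` at a lag `j₁ ∈ {n, n+1}` (or `S`) and
`D_{Bᴿ}` at `j₂ ∈ {n−1, n}` through RP Cauchy–Schwarz in the mid-plane `t = ⌊n/2⌋ + ½` (K4 = the argument of `stub_mirrorDominationAxis0` with
the pairs made explicit).  Hence K5 `stub_gapOfRPSpectral : RPSpectral r sch Δ C → (∀ᶠ k, 0 ≤ β_k) → HasLatticeMassGap r sch (Δ/2)`, and
the heart drops its `HasLatticeMassGap` conjunct: S6h `stub_rpCore` (the IR input is ONE clustering statement).  K1 `stub_rpSpectralAnti`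
(= the c5-registered `rpSpectral_anti`) realigns the RP-spectral rate to `Δ/2` for `weakCouplingHypercubicLimit_of_ufbCore`; the c5-registered
`weakCouplingHypercubicLimit_of_ufbCoreRates` (independent rates) is proved below from K1 and `hasLatticeMassGap_anti`. -/

section R14

open Summit.QuantumFields.YangMills.Cruxes.HypercubicLimit.CouplingResponse

/-- `stub_rpSpectralAnti` (K1; the c5-registered `rpSpectral_anti`) — **`RPSpectral` is antitone in the rate** at the cost of doubling the
thermal constant: for `0 ≤ Δ' ≤ Δ`, `e^{−Δ a n}·X ≤ e^{−Δ' a n}·X + (C/2)B²e^{−Δ a S}` because the `n = 0` instance of `RPSpectral` bounds the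
bracket `X = ⟨ΘY·Y⟩ − ⟨Y⟩²` below by `−(C/2) B² e^{−Δ a S}` (no reflection positivity needed), and `e^{−Δ a S} ≤ e^{−Δ' a S}`. [folklore] -/
theorem stub_rpSpectralAnti :
    ∀ (G : Type) [Group G] [TopologicalSpace G] [IsTopologicalGroup G] [CompactSpace G]
      [MeasurableSpace G] [BorelSpace G] (r : LatticeRep G) (sch : SpeciesScheme (YMSpecies G)) (Δ Δ' C : ℝ),
      0 ≤ Δ' → Δ' ≤ Δ → RPSpectral r sch Δ C → RPSpectral r sch Δ' (2 * max C 0) :=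
  -- LANDED p141504 (worker, wave 1; the file also proves c5's `rpSpectral_anti` without the sign hypothesis)
  _root_.Summit.QuantumFields.YangMills.Theorems.WeakCouplingHypercubicLimit.TraceNormColdPressure.stub_rpSpectralAnti

/-- `stub_mirrorOfRPSpectral` (K2) — **`RPSpectral` read on mirror correlators at short lags.**  For a local gauge-invariant `P` of
time radius `R` (`|t| + 2 ≤ R` on `supp P`) bounded by `B`, the slab functional `Y := Pᴿ ∘ τ` (translate of the mirror into the slab `[1, 2R]`)
turns the `RPSpectral` pair `⟨Y(lift Θ₀U) · Y(τ_n lift U)⟩ − ⟨Y⟩²` into `D_P(n + c)` (`torusLift_timeReflect`: `lift ∘ Θ₀ = τ_{e₀} ∘ Θ ∘ lift`;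
`cfgReflect_configShift`; translation and reflection invariance of the torus state), its bracket at `n = 0` is `|D_P(c)| ≤ 2B²`, so eventually in
`k`, for `S ≥ L_k` and all lags `c ≤ m` with `2(m + c) ≤ S`: `|D_P(m)| ≤ 2B² e^{−Δ a_k (m − c)} + C B² e^{−Δ a_k S}` (`c` depends on `P` only). [folklore] -/
theorem stub_mirrorOfRPSpectral :
    ∀ (G : Type) [Group G] [TopologicalSpace G] [IsTopologicalGroup G] [CompactSpace G]
      [MeasurableSpace G] [BorelSpace G] (r : LatticeRep G) (sch : SpeciesScheme (YMSpecies G)) (Δ C : ℝ),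
      0 ≤ Δ → 0 ≤ C → RPSpectral r sch Δ C → ∀ (P : YMSpecies G) (R : ℕ) (B : ℝ),
        (∀ e ∈ P.supp, (e.1 0).natAbs + 2 ≤ R) → (∀ V, |P.F V| ≤ B) →
        ∃ c : ℕ, ∀ᶠ k in atTop, ∀ (S m : ℕ), sch.L k ≤ S → c ≤ m → 2 * (m + c) ≤ S →
          |latticeConnectedCorr r.ρ (sch.β k) (2 * S + 1) P.F (fun V => P.F (cfgReflect V)) m| ≤
            2 * B ^ 2 * Real.exp (-(Δ * sch.a k * ((m : ℝ) - c))) + C * B ^ 2 * Real.exp (-(Δ * sch.a k * S)) :=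
  -- LANDED p141605 (worker, wave 1; `c = 2R + 1`, slab functional `Pᴿ ∘ τ_{-(R+1)e₀}`, `T = 2R + 1`)
  _root_.Summit.QuantumFields.YangMills.Theorems.WeakCouplingHypercubicLimit.TraceNormColdPressure.stub_mirrorOfRPSpectral

/-- `stub_convexWindow` (K3) — **discrete maximum principle**: a sequence that is non-negative on `[lo, hi]` and log-convex with step one in
its interior (`D(m)² ≤ D(m−1)·D(m+1)`) is bounded on `[lo, hi]` by any common bound of its two end values (`D(m) ≤ √(D(m−1)D(m+1)) ≤
max(D(m−1), D(m+1))`: no strict interior maximum).  Pure real analysis. [folklore] -/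
theorem stub_convexWindow :
    ∀ (D : ℕ → ℝ) (lo hi : ℕ) (ε : ℝ), lo ≤ hi →
      (∀ m, lo ≤ m → m ≤ hi → 0 ≤ D m) →
      (∀ m, lo + 1 ≤ m → m + 1 ≤ hi → D m ^ 2 ≤ D (m - 1) * D (m + 1)) →
      D lo ≤ ε → D hi ≤ ε → ∀ m, lo ≤ m → m ≤ hi → D m ≤ ε :=
  -- LANDED p141414 (worker, wave 1; smallest maximiser)
  _root_.Summit.QuantumFields.YangMills.Theorems.WeakCouplingHypercubicLimit.TraceNormColdPressure.stub_convexWindow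

/-- `stub_mirrorDomination` (K4) — **a general pair is dominated by three mirror correlators** (the argument of the landed
`FiniteSusceptibilityWeakCoupling.stub_mirrorDominationAxis0`, pairs made explicit; every compact `G`, `β ≥ 0`): for local gauge-invariant
`A, B` of time radius `R` and a time lag `2R + 4 ≤ n ≤ S` on the torus `2S+1`, RP Cauchy–Schwarz in the link plane `t = p + ½`, `p = ⌊n/2⌋`
(`stub_rpCauchySchwarz stub_oddTorusRP`, `torusLift_theta`, `cov_translate_left`) gives `⟨A; τ_n B⟩² ≤ D_A(2p+1) · D_{Bᴿ}(2n−2p−1)` with both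
factors `≥ 0`; a lag `2p+1 = S+1` folds to `D_{Aᴿ}(S)` (`cov_fold`); all mirror correlators met are `≥ 0` (`mirrorCorr_nonneg`), whence the
symmetric form below with `j₁ ∈ {n, n+1, S}`, `j₂ ∈ {n−1, n}`. [folklore] -/
theorem stub_mirrorDomination :
    ∀ (G : Type) [Group G] [TopologicalSpace G] [IsTopologicalGroup G] [CompactSpace G]
      [MeasurableSpace G] [BorelSpace G] (r : LatticeRep G) (β : ℝ), 0 ≤ β →
      ∀ (A B : YMSpecies G) (R : ℕ), (∀ e ∈ A.supp, (e.1 0).natAbs + 2 ≤ R) → (∀ e ∈ B.supp, (e.1 0).natAbs + 2 ≤ R) →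
      ∀ (S n : ℕ), 1 ≤ S → 2 * R + 4 ≤ n → n ≤ S →
        ∃ j₁ j₂ : ℕ, n ≤ j₁ + 1 ∧ j₁ ≤ S ∧ n ≤ j₂ + 1 ∧ j₂ ≤ S ∧
          0 ≤ latticeConnectedCorr r.ρ β (2 * S + 1) A.F (fun V => A.F (cfgReflect V)) j₁ ∧
          0 ≤ latticeConnectedCorr r.ρ β (2 * S + 1) (fun V => A.F (cfgReflect V)) A.F j₁ ∧
          0 ≤ latticeConnectedCorr r.ρ β (2 * S + 1) (fun V => B.F (cfgReflect V)) B.F j₂ ∧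
          latticeConnectedCorr r.ρ β (2 * S + 1) A.F B.F n ^ 2 ≤
            (latticeConnectedCorr r.ρ β (2 * S + 1) A.F (fun V => A.F (cfgReflect V)) j₁ +
                latticeConnectedCorr r.ρ β (2 * S + 1) (fun V => A.F (cfgReflect V)) A.F j₁) *
              latticeConnectedCorr r.ρ β (2 * S + 1) (fun V => B.F (cfgReflect V)) B.F j₂ :=
  -- LANDED p141573 (worker, wave 1; helper `rp_linkPlane_pair`)
  _root_.Summit.QuantumFields.YangMills.Theorems.WeakCouplingHypercubicLimit.TraceNormColdPressure.stub_mirrorDomination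

/-- `stub_gapOfRPSpectral` (K5, lead) — **RP-spectral relative clustering implies the volume-uniform lattice mass gap at half the rate**:
`RPSpectral r sch Δ C → (∀ᶠ k, 0 ≤ β_k) → HasLatticeMassGap r sch (Δ/2)`.  Per pair `(A, B)`: small lags `n < n₁(A, B)` by the a-priori bound
`2‖A‖‖B‖` (with `a_k ≤ 1` eventually), large lags by K4 and, for each of `A, Aᴿ, B, Bᴿ`, the window bound on `D_P(j)`, `j ≤ S`: below the window
by K2 directly, inside it by K3 on `[m₀, 2S+1−m₀']` with the two ends `D_P(m₀)`, `D_P(2S+1−m₀') = D_{Pᴿ}(m₀')` (`mirrorCorr_fold`) bounded by K2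
(`m₀, m₀' ≈ S/2 − c`), log-convexity and non-negativity from `mirrorCorr_sq_le` / `mirrorCorr_nonneg` at `β_k ≥ 0`; `L_k → ∞` from
`a_k L_k → ∞`, `a_k → 0`. [folklore] -/
theorem stub_gapOfRPSpectral :
    ∀ (G : Type) [Group G] [TopologicalSpace G] [IsTopologicalGroup G] [CompactSpace G]
      [MeasurableSpace G] [BorelSpace G] (r : LatticeRep G) (sch : SpeciesScheme (YMSpecies G)) (Δ C : ℝ),
      0 < Δ → (∀ᶠ k in atTop, 0 ≤ sch.β k) → RPSpectral r sch Δ C → HasLatticeMassGap r sch (Δ / 2) :=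
  -- LANDED p142771 (lead; window toolkit `mirrorWindow` p142066)
  _root_.Summit.QuantumFields.YangMills.Theorems.WeakCouplingHypercubicLimit.TraceNormColdPressure.stub_gapOfRPSpectral

/-- `RPCore` record (S6h, the r14 heart; at r15 SUPERSEDED by the weaker S6i `stub_rpCoreDisjoint`, §10) — the RP core of
stmt-16120 / stmt-16154: weak coupling ∧ PolyVolume ∧ PolyRenorm ∧ UFB ∧ (∃ Δ C, 0 < Δ ∧ RPSpectral r sch Δ C) ∧ ONE time-separated `κ₃` floor.
Kept as the hypothesis of `ufbCore_of_rpCore` (monotonicity r13″ ← r14) and of `rpCoreDisjoint_of_rpCore` (monotonicity r14 → r15);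
the landed `weakCouplingHypercubicLimit_of_rpCore` (Theorems/…OfRpCore.lean) still closes the crux from it. [folklore] -/
theorem ufbCore_of_rpCore
    (hcore : ∀ (G : Type) [Group G] [TopologicalSpace G] [IsTopologicalGroup G] [CompactSpace G]
      [MeasurableSpace G] [BorelSpace G], IsCompactSimpleLieGroup G →
      ∃ (r : LatticeRep G) (sch : SpeciesScheme (YMSpecies G)),
      sch.HasWeakCouplingLimit ∧ PolyVolume sch ∧ PolyRenorm r sch ∧ UniformFunctionalBoundPlanes r sch ∧
      (∃ Δ C : ℝ, 0 < Δ ∧ RPSpectral r sch Δ C) ∧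
      (∃ (f g h : 𝓢(EuclideanSpace ℝ (Fin 4), ℝ)) (δ : ℝ),
      tsupport f ⊆ {y : EuclideanSpace ℝ (Fin 4) | y 0 < 0} ∧ tsupport g ⊆ {y : EuclideanSpace ℝ (Fin 4) | 0 < y 0} ∧
      tsupport h ⊆ {y : EuclideanSpace ℝ (Fin 4) | 0 < y 0} ∧ Disjoint (tsupport g) (tsupport h) ∧ 0 < δ ∧
      ∀ᶠ k in atTop, δ ≤
      |latticeSchwinger r.ρ sch (fun s => s.F) k 3 (fun _ => r.curvature) ![f, g, h] -
      latticeSchwinger r.ρ sch (fun s => s.F) k 1 (fun _ => r.curvature) ![f] *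
      latticeSchwinger r.ρ sch (fun s => s.F) k 2 (fun _ => r.curvature) ![g, h] -
      latticeSchwinger r.ρ sch (fun s => s.F) k 1 (fun _ => r.curvature) ![g] *
      latticeSchwinger r.ρ sch (fun s => s.F) k 2 (fun _ => r.curvature) ![f, h] -
      latticeSchwinger r.ρ sch (fun s => s.F) k 1 (fun _ => r.curvature) ![h] *
      latticeSchwinger r.ρ sch (fun s => s.F) k 2 (fun _ => r.curvature) ![f, g] +
      2 * (latticeSchwinger r.ρ sch (fun s => s.F) k 1 (fun _ => r.curvature) ![f] *
      latticeSchwinger r.ρ sch (fun s => s.F) k 1 (fun _ => r.curvature) ![g] *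
      latticeSchwinger r.ρ sch (fun s => s.F) k 1 (fun _ => r.curvature) ![h])|) ) :
    ∀ (G : Type) [Group G] [TopologicalSpace G] [IsTopologicalGroup G] [CompactSpace G]
      [MeasurableSpace G] [BorelSpace G], IsCompactSimpleLieGroup G →
      ∃ (r : LatticeRep G) (sch : SpeciesScheme (YMSpecies G)),
        sch.HasWeakCouplingLimit ∧ PolyVolume sch ∧ PolyRenorm r sch ∧ UniformFunctionalBoundPlanes r sch ∧
        (∃ Δ C : ℝ, 0 < Δ ∧ HasLatticeMassGap r sch Δ ∧ RPSpectral r sch Δ C) ∧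
        (∃ (f g h : 𝓢(EuclideanSpace ℝ (Fin 4), ℝ)) (δ : ℝ),
          tsupport f ⊆ {y : EuclideanSpace ℝ (Fin 4) | y 0 < 0} ∧ tsupport g ⊆ {y : EuclideanSpace ℝ (Fin 4) | 0 < y 0} ∧
          tsupport h ⊆ {y : EuclideanSpace ℝ (Fin 4) | 0 < y 0} ∧ Disjoint (tsupport g) (tsupport h) ∧ 0 < δ ∧
          ∀ᶠ k in atTop, δ ≤
            |latticeSchwinger r.ρ sch (fun s => s.F) k 3 (fun _ => r.curvature) ![f, g, h] -
              latticeSchwinger r.ρ sch (fun s => s.F) k 1 (fun _ => r.curvature) ![f] *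
                latticeSchwinger r.ρ sch (fun s => s.F) k 2 (fun _ => r.curvature) ![g, h] -
              latticeSchwinger r.ρ sch (fun s => s.F) k 1 (fun _ => r.curvature) ![g] *
                latticeSchwinger r.ρ sch (fun s => s.F) k 2 (fun _ => r.curvature) ![f, h] -
              latticeSchwinger r.ρ sch (fun s => s.F) k 1 (fun _ => r.curvature) ![h] *
                latticeSchwinger r.ρ sch (fun s => s.F) k 2 (fun _ => r.curvature) ![f, g] +
              2 * (latticeSchwinger r.ρ sch (fun s => s.F) k 1 (fun _ => r.curvature) ![f] *
                latticeSchwinger r.ρ sch (fun s => s.F) k 1 (fun _ => r.curvature) ![g] *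
                latticeSchwinger r.ρ sch (fun s => s.F) k 1 (fun _ => r.curvature) ![h])|) := by
  -- r14: PROVED from the RP core S6h — the lattice gap at half the RP-spectral rate (K5), the RP-spectral rate realigned (K1)
  intro G _ _ _ _ _ _ hG
  obtain ⟨r, sch, hw, hpv, hpr, hUFB, ⟨Δ, C, hΔ, hRP⟩, hNG⟩ := hcore G hG
  exact ⟨r, sch, hw, hpv, hpr, hUFB, ⟨Δ / 2, 2 * max C 0, half_pos hΔ,
    stub_gapOfRPSpectral G r sch Δ C hΔ (Filter.tendsto_atTop.1 hw 0) hRP,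
    stub_rpSpectralAnti G r sch Δ (Δ / 2) C (by linarith) (by linarith) hRP⟩, hNG⟩

/-- Along a weak-coupling scheme the couplings are eventually non-negative (so the odd-torus reflection positivity of Wilson's
action is available along the scheme). [folklore] -/
theorem eventually_beta_nonneg {ι : Type} (sch : SpeciesScheme ι) (h : sch.HasWeakCouplingLimit) :
    ∀ᶠ k in atTop, 0 ≤ sch.β k :=
  Filter.tendsto_atTop.1 h 0

/-- **`HasLatticeMassGap` is antitone in the rate** (the constant replaced by `max C 0`; `a_k > 0`). [folklore] -/
theorem hasLatticeMassGap_anti {G : Type} [Group G] [TopologicalSpace G] [IsTopologicalGroup G] [CompactSpace G]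
    [MeasurableSpace G] [BorelSpace G] {ι : Type}
    (r : LatticeRep G) (sch : SpeciesScheme ι) {Δ Δ' : ℝ} (hle : Δ' ≤ Δ) (h : HasLatticeMassGap r sch Δ) :
    HasLatticeMassGap r sch Δ' := by
  intro A B
  obtain ⟨C, hC⟩ := h A B
  refine ⟨max C 0, hC.mono fun k hk S hS n hn => (hk S hS n hn).trans ?_⟩
  have ha : 0 ≤ sch.a k * n := mul_nonneg (sch.a_pos k).le (Nat.cast_nonneg n)
  calc C * Real.exp (-(Δ * (sch.a k * n)))
      ≤ max C 0 * Real.exp (-(Δ * (sch.a k * n))) :=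
        mul_le_mul_of_nonneg_right (le_max_left _ _) (Real.exp_nonneg _)
    _ ≤ max C 0 * Real.exp (-(Δ' * (sch.a k * n))) := by
        refine mul_le_mul_of_nonneg_left (Real.exp_le_exp.2 ?_) (le_max_right _ _)
        nlinarith

end R14

section R13

open Summit.QuantumFields.YangMills.Cruxes.HypercubicLimit.CouplingResponse

-- (r15) `stub_ufbCore` of r13″/r14 is now `ufbCore_of_rpCore` above (§9).

/-- **Monotonicity r13′ → r13″: the UFB–skew core implies the UFB core** (forget the order-one conjunct, which `momentOne_of_ufb`
re-derives from `UniformFunctionalBoundPlanes` at `n = 1`). [folklore] -/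
theorem ufbCore_of_latticeUfbSkewCore
    (h : ∀ (G : Type) [Group G] [TopologicalSpace G] [IsTopologicalGroup G] [CompactSpace G]
      [MeasurableSpace G] [BorelSpace G], IsCompactSimpleLieGroup G →
      ∃ (r : LatticeRep G) (sch : SpeciesScheme (YMSpecies G)),
        sch.HasWeakCouplingLimit ∧ PolyVolume sch ∧ PolyRenorm r sch ∧ UniformFunctionalBoundPlanes r sch ∧
        (∃ (s : ℕ) (C : ℝ), ∀ F : Plane → 𝓢(EuclideanSpace ℝ (Fin 4), ℝ), normP s F ≤ 1 →
          ∀ k : ℕ, |∫ U, fieldP r sch k F U ∂(wilsonAt r sch k)| ≤ C) ∧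
        (∃ Δ C : ℝ, 0 < Δ ∧ HasLatticeMassGap r sch Δ ∧ RPSpectral r sch Δ C) ∧
        (∃ (f g h : 𝓢(EuclideanSpace ℝ (Fin 4), ℝ)) (δ : ℝ),
          tsupport f ⊆ {y : EuclideanSpace ℝ (Fin 4) | y 0 < 0} ∧ tsupport g ⊆ {y : EuclideanSpace ℝ (Fin 4) | 0 < y 0} ∧
          tsupport h ⊆ {y : EuclideanSpace ℝ (Fin 4) | 0 < y 0} ∧ Disjoint (tsupport g) (tsupport h) ∧ 0 < δ ∧
          ∀ᶠ k in atTop, δ ≤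
            |latticeSchwinger r.ρ sch (fun s => s.F) k 3 (fun _ => r.curvature) ![f, g, h] -
              latticeSchwinger r.ρ sch (fun s => s.F) k 1 (fun _ => r.curvature) ![f] *
                latticeSchwinger r.ρ sch (fun s => s.F) k 2 (fun _ => r.curvature) ![g, h] -
              latticeSchwinger r.ρ sch (fun s => s.F) k 1 (fun _ => r.curvature) ![g] *
                latticeSchwinger r.ρ sch (fun s => s.F) k 2 (fun _ => r.curvature) ![f, h] -
              latticeSchwinger r.ρ sch (fun s => s.F) k 1 (fun _ => r.curvature) ![h] *
                latticeSchwinger r.ρ sch (fun s => s.F) k 2 (fun _ => r.curvature) ![f, g] +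
              2 * (latticeSchwinger r.ρ sch (fun s => s.F) k 1 (fun _ => r.curvature) ![f] *
                latticeSchwinger r.ρ sch (fun s => s.F) k 1 (fun _ => r.curvature) ![g] *
                latticeSchwinger r.ρ sch (fun s => s.F) k 1 (fun _ => r.curvature) ![h])|)) :
    ∀ (G : Type) [Group G] [TopologicalSpace G] [IsTopologicalGroup G] [CompactSpace G]
      [MeasurableSpace G] [BorelSpace G], IsCompactSimpleLieGroup G →
      ∃ (r : LatticeRep G) (sch : SpeciesScheme (YMSpecies G)),
        sch.HasWeakCouplingLimit ∧ PolyVolume sch ∧ PolyRenorm r sch ∧ UniformFunctionalBoundPlanes r sch ∧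
        (∃ Δ C : ℝ, 0 < Δ ∧ HasLatticeMassGap r sch Δ ∧ RPSpectral r sch Δ C) ∧
        (∃ (f g h : 𝓢(EuclideanSpace ℝ (Fin 4), ℝ)) (δ : ℝ),
          tsupport f ⊆ {y : EuclideanSpace ℝ (Fin 4) | y 0 < 0} ∧ tsupport g ⊆ {y : EuclideanSpace ℝ (Fin 4) | 0 < y 0} ∧
          tsupport h ⊆ {y : EuclideanSpace ℝ (Fin 4) | 0 < y 0} ∧ Disjoint (tsupport g) (tsupport h) ∧ 0 < δ ∧
          ∀ᶠ k in atTop, δ ≤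
            |latticeSchwinger r.ρ sch (fun s => s.F) k 3 (fun _ => r.curvature) ![f, g, h] -
              latticeSchwinger r.ρ sch (fun s => s.F) k 1 (fun _ => r.curvature) ![f] *
                latticeSchwinger r.ρ sch (fun s => s.F) k 2 (fun _ => r.curvature) ![g, h] -
              latticeSchwinger r.ρ sch (fun s => s.F) k 1 (fun _ => r.curvature) ![g] *
                latticeSchwinger r.ρ sch (fun s => s.F) k 2 (fun _ => r.curvature) ![f, h] -
              latticeSchwinger r.ρ sch (fun s => s.F) k 1 (fun _ => r.curvature) ![h] *
                latticeSchwinger r.ρ sch (fun s => s.F) k 2 (fun _ => r.curvature) ![f, g] +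
              2 * (latticeSchwinger r.ρ sch (fun s => s.F) k 1 (fun _ => r.curvature) ![f] *
                latticeSchwinger r.ρ sch (fun s => s.F) k 1 (fun _ => r.curvature) ![g] *
                latticeSchwinger r.ρ sch (fun s => s.F) k 1 (fun _ => r.curvature) ![h])|) := by
  intro G _ _ _ _ _ _ hG
  obtain ⟨r, sch, hw, hpv, hpr, hUFB, -, hIR, hNG⟩ := h G hG
  exact ⟨r, sch, hw, hpv, hpr, hUFB, hIR, hNG⟩

/-- **Monotonicity r13 → r13′: the Gevrey–skew core implies the UFB–skew core** (`functionalBoundPlanes_of_momentBoundsPow`, p139303;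
the order-one bound is the `n = 1` instance of the Gevrey bound). [folklore] -/
theorem latticeUfbSkewCore_of_latticeGevreySkewCore
    (h : ∀ (G : Type) [Group G] [TopologicalSpace G] [IsTopologicalGroup G] [CompactSpace G]
      [MeasurableSpace G] [BorelSpace G], IsCompactSimpleLieGroup G →
      ∃ (r : LatticeRep G) (sch : SpeciesScheme (YMSpecies G)),
        sch.HasWeakCouplingLimit ∧ PolyVolume sch ∧ PolyRenorm r sch ∧
        (∃ (s L : ℕ) (C₀ C₁ : ℝ), ∀ (n : ℕ) (F : Fin n → Plane → 𝓢(EuclideanSpace ℝ (Fin 4), ℝ)),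
          (∀ i, normP s (F i) ≤ 1) → (∀ i j, i ≠ j → DisjP (F i) (F j)) →
            ∀ k : ℕ, |∫ U, ∏ i, fieldP r sch k (F i) U ∂(wilsonAt r sch k)| ≤ C₀ * C₁ ^ n * (n.factorial : ℝ) ^ L) ∧
        (∃ Δ C : ℝ, 0 < Δ ∧ HasLatticeMassGap r sch Δ ∧ RPSpectral r sch Δ C) ∧
        (∃ (f g h : 𝓢(EuclideanSpace ℝ (Fin 4), ℝ)) (δ : ℝ),
          tsupport f ⊆ {y : EuclideanSpace ℝ (Fin 4) | y 0 < 0} ∧ tsupport g ⊆ {y : EuclideanSpace ℝ (Fin 4) | 0 < y 0} ∧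
          tsupport h ⊆ {y : EuclideanSpace ℝ (Fin 4) | 0 < y 0} ∧ Disjoint (tsupport g) (tsupport h) ∧ 0 < δ ∧
          ∀ᶠ k in atTop, δ ≤
            |latticeSchwinger r.ρ sch (fun s => s.F) k 3 (fun _ => r.curvature) ![f, g, h] -
              latticeSchwinger r.ρ sch (fun s => s.F) k 1 (fun _ => r.curvature) ![f] *
                latticeSchwinger r.ρ sch (fun s => s.F) k 2 (fun _ => r.curvature) ![g, h] -
              latticeSchwinger r.ρ sch (fun s => s.F) k 1 (fun _ => r.curvature) ![g] *
                latticeSchwinger r.ρ sch (fun s => s.F) k 2 (fun _ => r.curvature) ![f, h] -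
              latticeSchwinger r.ρ sch (fun s => s.F) k 1 (fun _ => r.curvature) ![h] *
                latticeSchwinger r.ρ sch (fun s => s.F) k 2 (fun _ => r.curvature) ![f, g] +
              2 * (latticeSchwinger r.ρ sch (fun s => s.F) k 1 (fun _ => r.curvature) ![f] *
                latticeSchwinger r.ρ sch (fun s => s.F) k 1 (fun _ => r.curvature) ![g] *
                latticeSchwinger r.ρ sch (fun s => s.F) k 1 (fun _ => r.curvature) ![h])|)) :
    ∀ (G : Type) [Group G] [TopologicalSpace G] [IsTopologicalGroup G] [CompactSpace G]
      [MeasurableSpace G] [BorelSpace G], IsCompactSimpleLieGroup G →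
      ∃ (r : LatticeRep G) (sch : SpeciesScheme (YMSpecies G)),
        sch.HasWeakCouplingLimit ∧ PolyVolume sch ∧ PolyRenorm r sch ∧ UniformFunctionalBoundPlanes r sch ∧
        (∃ (s : ℕ) (C : ℝ), ∀ F : Plane → 𝓢(EuclideanSpace ℝ (Fin 4), ℝ), normP s F ≤ 1 →
          ∀ k : ℕ, |∫ U, fieldP r sch k F U ∂(wilsonAt r sch k)| ≤ C) ∧
        (∃ Δ C : ℝ, 0 < Δ ∧ HasLatticeMassGap r sch Δ ∧ RPSpectral r sch Δ C) ∧
        (∃ (f g h : 𝓢(EuclideanSpace ℝ (Fin 4), ℝ)) (δ : ℝ),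
          tsupport f ⊆ {y : EuclideanSpace ℝ (Fin 4) | y 0 < 0} ∧ tsupport g ⊆ {y : EuclideanSpace ℝ (Fin 4) | 0 < y 0} ∧
          tsupport h ⊆ {y : EuclideanSpace ℝ (Fin 4) | 0 < y 0} ∧ Disjoint (tsupport g) (tsupport h) ∧ 0 < δ ∧
          ∀ᶠ k in atTop, δ ≤
            |latticeSchwinger r.ρ sch (fun s => s.F) k 3 (fun _ => r.curvature) ![f, g, h] -
              latticeSchwinger r.ρ sch (fun s => s.F) k 1 (fun _ => r.curvature) ![f] *
                latticeSchwinger r.ρ sch (fun s => s.F) k 2 (fun _ => r.curvature) ![g, h] -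
              latticeSchwinger r.ρ sch (fun s => s.F) k 1 (fun _ => r.curvature) ![g] *
                latticeSchwinger r.ρ sch (fun s => s.F) k 2 (fun _ => r.curvature) ![f, h] -
              latticeSchwinger r.ρ sch (fun s => s.F) k 1 (fun _ => r.curvature) ![h] *
                latticeSchwinger r.ρ sch (fun s => s.F) k 2 (fun _ => r.curvature) ![f, g] +
              2 * (latticeSchwinger r.ρ sch (fun s => s.F) k 1 (fun _ => r.curvature) ![f] *
                latticeSchwinger r.ρ sch (fun s => s.F) k 1 (fun _ => r.curvature) ![g] *
                latticeSchwinger r.ρ sch (fun s => s.F) k 1 (fun _ => r.curvature) ![h])|) := by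
  intro G _ _ _ _ _ _ hG
  obtain ⟨r, sch, hw, hpv, hpr, hGev, hIR, hNG⟩ := h G hG
  refine ⟨r, sch, hw, hpv, hpr,
    _root_.Summit.QuantumFields.YangMills.Theorems.WeakCouplingHypercubicLimit.TraceNormColdPressure.functionalBoundPlanes_of_momentBoundsPow
      G r sch hGev, ?_, hIR, hNG⟩
  obtain ⟨s, L, C₀, C₁, hU⟩ := hGev
  refine ⟨s, C₀ * C₁ ^ 1 * ((Nat.factorial 1 : ℕ) : ℝ) ^ L, fun F hF k => ?_⟩
  have h1 := hU 1 (fun _ => F) (fun _ => hF) (fun i j hij => absurd (Subsingleton.elim i j) hij) k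
  simpa only [Fin.prod_univ_one] using h1

/-- **Monotonicity r12 → r13: process A's skew core (Gaussian `UniformMomentBoundsPlanes`) implies the Gevrey–skew core**
(`momentBoundsPow_of_uniformMomentBoundsPlanes`, `L = 1`). [folklore] -/
theorem latticeGevreySkewCore_of_latticeSkewCore
    (h : ∀ (G : Type) [Group G] [TopologicalSpace G] [IsTopologicalGroup G] [CompactSpace G]
      [MeasurableSpace G] [BorelSpace G], IsCompactSimpleLieGroup G →
      ∃ (r : LatticeRep G) (sch : SpeciesScheme (YMSpecies G)),
        sch.HasWeakCouplingLimit ∧ PolyVolume sch ∧ PolyRenorm r sch ∧ UniformMomentBoundsPlanes r sch ∧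
        (∃ Δ C : ℝ, 0 < Δ ∧ HasLatticeMassGap r sch Δ ∧ RPSpectral r sch Δ C) ∧
        (∃ (f g h : 𝓢(EuclideanSpace ℝ (Fin 4), ℝ)) (δ : ℝ),
          tsupport f ⊆ {y : EuclideanSpace ℝ (Fin 4) | y 0 < 0} ∧ tsupport g ⊆ {y : EuclideanSpace ℝ (Fin 4) | 0 < y 0} ∧
          tsupport h ⊆ {y : EuclideanSpace ℝ (Fin 4) | 0 < y 0} ∧ Disjoint (tsupport g) (tsupport h) ∧ 0 < δ ∧
          ∀ᶠ k in atTop, δ ≤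
            |latticeSchwinger r.ρ sch (fun s => s.F) k 3 (fun _ => r.curvature) ![f, g, h] -
              latticeSchwinger r.ρ sch (fun s => s.F) k 1 (fun _ => r.curvature) ![f] *
                latticeSchwinger r.ρ sch (fun s => s.F) k 2 (fun _ => r.curvature) ![g, h] -
              latticeSchwinger r.ρ sch (fun s => s.F) k 1 (fun _ => r.curvature) ![g] *
                latticeSchwinger r.ρ sch (fun s => s.F) k 2 (fun _ => r.curvature) ![f, h] -
              latticeSchwinger r.ρ sch (fun s => s.F) k 1 (fun _ => r.curvature) ![h] *
                latticeSchwinger r.ρ sch (fun s => s.F) k 2 (fun _ => r.curvature) ![f, g] +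
              2 * (latticeSchwinger r.ρ sch (fun s => s.F) k 1 (fun _ => r.curvature) ![f] *
                latticeSchwinger r.ρ sch (fun s => s.F) k 1 (fun _ => r.curvature) ![g] *
                latticeSchwinger r.ρ sch (fun s => s.F) k 1 (fun _ => r.curvature) ![h])|)) :
    ∀ (G : Type) [Group G] [TopologicalSpace G] [IsTopologicalGroup G] [CompactSpace G]
      [MeasurableSpace G] [BorelSpace G], IsCompactSimpleLieGroup G →
      ∃ (r : LatticeRep G) (sch : SpeciesScheme (YMSpecies G)),
        sch.HasWeakCouplingLimit ∧ PolyVolume sch ∧ PolyRenorm r sch ∧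
        (∃ (s L : ℕ) (C₀ C₁ : ℝ), ∀ (n : ℕ) (F : Fin n → Plane → 𝓢(EuclideanSpace ℝ (Fin 4), ℝ)),
          (∀ i, normP s (F i) ≤ 1) → (∀ i j, i ≠ j → DisjP (F i) (F j)) →
            ∀ k : ℕ, |∫ U, ∏ i, fieldP r sch k (F i) U ∂(wilsonAt r sch k)| ≤ C₀ * C₁ ^ n * (n.factorial : ℝ) ^ L) ∧
        (∃ Δ C : ℝ, 0 < Δ ∧ HasLatticeMassGap r sch Δ ∧ RPSpectral r sch Δ C) ∧
        (∃ (f g h : 𝓢(EuclideanSpace ℝ (Fin 4), ℝ)) (δ : ℝ),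
          tsupport f ⊆ {y : EuclideanSpace ℝ (Fin 4) | y 0 < 0} ∧ tsupport g ⊆ {y : EuclideanSpace ℝ (Fin 4) | 0 < y 0} ∧
          tsupport h ⊆ {y : EuclideanSpace ℝ (Fin 4) | 0 < y 0} ∧ Disjoint (tsupport g) (tsupport h) ∧ 0 < δ ∧
          ∀ᶠ k in atTop, δ ≤
            |latticeSchwinger r.ρ sch (fun s => s.F) k 3 (fun _ => r.curvature) ![f, g, h] -
              latticeSchwinger r.ρ sch (fun s => s.F) k 1 (fun _ => r.curvature) ![f] *
                latticeSchwinger r.ρ sch (fun s => s.F) k 2 (fun _ => r.curvature) ![g, h] -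
              latticeSchwinger r.ρ sch (fun s => s.F) k 1 (fun _ => r.curvature) ![g] *
                latticeSchwinger r.ρ sch (fun s => s.F) k 2 (fun _ => r.curvature) ![f, h] -
              latticeSchwinger r.ρ sch (fun s => s.F) k 1 (fun _ => r.curvature) ![h] *
                latticeSchwinger r.ρ sch (fun s => s.F) k 2 (fun _ => r.curvature) ![f, g] +
              2 * (latticeSchwinger r.ρ sch (fun s => s.F) k 1 (fun _ => r.curvature) ![f] *
                latticeSchwinger r.ρ sch (fun s => s.F) k 1 (fun _ => r.curvature) ![g] *
                latticeSchwinger r.ρ sch (fun s => s.F) k 1 (fun _ => r.curvature) ![h])|) := by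
  intro G _ _ _ _ _ _ hG
  obtain ⟨r, sch, hw, hpv, hpr, hUMB, hIR, hNG⟩ := h G hG
  exact ⟨r, sch, hw, hpv, hpr,
    _root_.Summit.QuantumFields.YangMills.Theorems.WeakCouplingHypercubicLimit.TraceNormColdPressure.momentBoundsPow_of_uniformMomentBoundsPlanes
      r sch hUMB, hIR, hNG⟩

-- Record (r13, LANDED p139728): the Gevrey–skew core implies the crux BY NAME — importable as
-- `…Theorems.WeakCouplingHypercubicLimit.TraceNormColdPressure.weakCouplingHypercubicLimit_of_latticeGevreySkewCore`.

end R13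

/-! ### §10 Reshape r15 (lead c7, 2026-08-17): the non-Gaussianity floor in PAIRWISE-DISJOINT geometry (`IRInputs` (d) verbatim)

The r14 heart asked for its ONE `κ₃` floor in TIME-SEPARATED position (`tsupport f ⊆ {y 0 < 0}`, `tsupport g, h ⊆ {0 < y 0}`, `g ⟂ h`),
because non-triviality is read off by RP Cauchy–Schwarz across the time-zero hyperplane (`stub_ntOfSkewSeparated`).  The geometry is
not an input: the limit family `planeSum T` is CONTINUOUS (each `S₁ n` is a CLM), SYMMETRIC (E3, `planeSum_isNormalized_isSymmetric`),
TRANSLATION invariant (`stub_translationPlanesMono`) and `W(B₄)` invariant (`stub_signedPermOfPlaneLimits`) on `⁰𝒮`, so a non-zero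
continuum `κ₃` on ANY pairwise-disjoint triple can be cut off to compact supports (N2a), localised by a finite partition of unity to three
small balls whose centres stay far apart (N2b), one ball is split from the other two by a coordinate hyperplane (N3a), and a signed
permutation + translation makes that hyperplane `{y 0 = 0}` (N3b).  Hence the heart's NG clause relaxes to `IRInputs` (d) verbatim
(S6i `stub_rpCoreDisjoint`; monotone: `rpCoreDisjoint_of_rpCore`), and the common core of stmt-16120 / stmt-16154 reads:
weak coupling ∧ PolyVolume ∧ PolyRenorm ∧ UFB ∧ (∃ Δ C, 0 < Δ ∧ RPSpectral) ∧ (κ₃ ≠ 0 floor on some pairwise-disjoint real triple). -/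

section R15

open Summit.QuantumFields.YangMills.Cruxes.HypercubicLimit.CouplingResponse

/-- `stub_disjointOfLatticeFloor` (N1, r15; S/M — adapt `stub_skewSeparatedOfLatticeFloor` / the twin's
`nonGaussianClause_of_latticeFloor`) — **a PAIRWISE-DISJOINT lattice third-cumulant floor passes to the limit, keeping disjointness.**
Under the crux's convergence clause for the one-field family `S₁`, an eventual floor `δ > 0` for the lattice `κ₃`-combination on a real
triple `f, g, h` with pairwise disjoint supports yields the complex tests `ofRealTest f, g, h` (same supports) on whose CANONICAL tensor
witnesses `SchwartzMap.tensorFin` the continuum `κ₃`-combination of `S₁` is non-zero (seven instances `n = 3,2,2,2,1,1,1` of the convergence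
clause; off-diagonality of the tensors from pairwise disjointness). [folklore] -/
theorem stub_disjointOfLatticeFloor :
    ∀ (G : Type) [Group G] [TopologicalSpace G] [IsTopologicalGroup G] [CompactSpace G]
      [MeasurableSpace G] [BorelSpace G] (r : LatticeRep G) (sch : SpeciesScheme (YMSpecies G))
      (S₁ : SchwingerFamily (EuclideanSpace ℝ (Fin 4))),
      (∀ (n : ℕ), n ≠ 0 → ∀ (f : Fin n → 𝓢(EuclideanSpace ℝ (Fin 4), ℝ))
        (F : 𝓢((Fin n → EuclideanSpace ℝ (Fin 4)), ℂ)), IsTensorOf F (fun i => ofRealTest (f i)) →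
        IsOffDiagonal F →
          Tendsto (fun k : ℕ => ((latticeSchwinger r.ρ sch (fun s => s.F) k n (fun _ => r.curvature) f : ℝ) : ℂ))
            atTop (𝓝 (S₁ n F))) →
      (∃ (f g h : 𝓢(EuclideanSpace ℝ (Fin 4), ℝ)) (δ : ℝ),
        Disjoint (tsupport f) (tsupport g) ∧ Disjoint (tsupport f) (tsupport h) ∧
        Disjoint (tsupport g) (tsupport h) ∧ 0 < δ ∧
        ∀ᶠ k in atTop, δ ≤
          |latticeSchwinger r.ρ sch (fun s => s.F) k 3 (fun _ => r.curvature) ![f, g, h] -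
            latticeSchwinger r.ρ sch (fun s => s.F) k 1 (fun _ => r.curvature) ![f] *
              latticeSchwinger r.ρ sch (fun s => s.F) k 2 (fun _ => r.curvature) ![g, h] -
            latticeSchwinger r.ρ sch (fun s => s.F) k 1 (fun _ => r.curvature) ![g] *
              latticeSchwinger r.ρ sch (fun s => s.F) k 2 (fun _ => r.curvature) ![f, h] -
            latticeSchwinger r.ρ sch (fun s => s.F) k 1 (fun _ => r.curvature) ![h] *
              latticeSchwinger r.ρ sch (fun s => s.F) k 2 (fun _ => r.curvature) ![f, g] +
            2 * (latticeSchwinger r.ρ sch (fun s => s.F) k 1 (fun _ => r.curvature) ![f] *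
              latticeSchwinger r.ρ sch (fun s => s.F) k 1 (fun _ => r.curvature) ![g] *
              latticeSchwinger r.ρ sch (fun s => s.F) k 1 (fun _ => r.curvature) ![h])|) →
      ∃ (f g h : 𝓢(EuclideanSpace ℝ (Fin 4), ℂ)),
        Disjoint (tsupport (f : EuclideanSpace ℝ (Fin 4) → ℂ)) (tsupport (g : EuclideanSpace ℝ (Fin 4) → ℂ)) ∧
        Disjoint (tsupport (f : EuclideanSpace ℝ (Fin 4) → ℂ)) (tsupport (h : EuclideanSpace ℝ (Fin 4) → ℂ)) ∧
        Disjoint (tsupport (g : EuclideanSpace ℝ (Fin 4) → ℂ)) (tsupport (h : EuclideanSpace ℝ (Fin 4) → ℂ)) ∧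
        S₁ 3 (SchwartzMap.tensorFin 3 ![f, g, h]) -
            S₁ 1 (SchwartzMap.tensorFin 1 ![f]) * S₁ 2 (SchwartzMap.tensorFin 2 ![g, h]) -
          S₁ 1 (SchwartzMap.tensorFin 1 ![g]) * S₁ 2 (SchwartzMap.tensorFin 2 ![f, h]) -
          S₁ 1 (SchwartzMap.tensorFin 1 ![h]) * S₁ 2 (SchwartzMap.tensorFin 2 ![f, g]) +
          2 * (S₁ 1 (SchwartzMap.tensorFin 1 ![f]) * S₁ 1 (SchwartzMap.tensorFin 1 ![g]) *
            S₁ 1 (SchwartzMap.tensorFin 1 ![h])) ≠ 0 :=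
  -- LANDED p147724 (wave 1, lead c7)
  _root_.Summit.QuantumFields.YangMills.Theorems.WeakCouplingHypercubicLimit.TraceNormColdPressure.stub_disjointOfLatticeFloor

/-- `stub_compactOfDisjoint` (N2a, r15; M — CONTINUUM, any family of continuous functionals) — **non-Gaussianity survives compact
cut-offs.**  If the `κ₃`-combination of `S₁` is non-zero on a pairwise-disjoint complex triple `f, g, h`, it is non-zero on a triple of
COMPACTLY SUPPORTED Schwartz functions with supports inside the original ones: replace `f` by its bump cut-offs `u_m → f` in `𝓢`
(`Literature.MathematicalPhysics.QuantumLattice.exists_tsupport_subset_inter_closedBall_tendsto`), use the continuity of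
`v ↦ κ₃(v, g, h)` (`continuous_tensorFin` of `OSSkeletonExplicitBounds` + continuity of the CLMs `S₁ n`) to pick `m` with `κ₃(u_m, g, h) ≠ 0`,
then the same for `g` and for `h`. [folklore] -/
theorem stub_compactOfDisjoint :
    ∀ (S₁ : SchwingerFamily (EuclideanSpace ℝ (Fin 4))) (f g h : 𝓢(EuclideanSpace ℝ (Fin 4), ℂ)),
      Disjoint (tsupport (f : EuclideanSpace ℝ (Fin 4) → ℂ)) (tsupport (g : EuclideanSpace ℝ (Fin 4) → ℂ)) →
      Disjoint (tsupport (f : EuclideanSpace ℝ (Fin 4) → ℂ)) (tsupport (h : EuclideanSpace ℝ (Fin 4) → ℂ)) →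
      Disjoint (tsupport (g : EuclideanSpace ℝ (Fin 4) → ℂ)) (tsupport (h : EuclideanSpace ℝ (Fin 4) → ℂ)) →
      S₁ 3 (SchwartzMap.tensorFin 3 ![f, g, h]) -
            S₁ 1 (SchwartzMap.tensorFin 1 ![f]) * S₁ 2 (SchwartzMap.tensorFin 2 ![g, h]) -
          S₁ 1 (SchwartzMap.tensorFin 1 ![g]) * S₁ 2 (SchwartzMap.tensorFin 2 ![f, h]) -
          S₁ 1 (SchwartzMap.tensorFin 1 ![h]) * S₁ 2 (SchwartzMap.tensorFin 2 ![f, g]) +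
          2 * (S₁ 1 (SchwartzMap.tensorFin 1 ![f]) * S₁ 1 (SchwartzMap.tensorFin 1 ![g]) *
            S₁ 1 (SchwartzMap.tensorFin 1 ![h])) ≠ 0 →
      ∃ (f' g' h' : 𝓢(EuclideanSpace ℝ (Fin 4), ℂ)),
        HasCompactSupport (f' : EuclideanSpace ℝ (Fin 4) → ℂ) ∧ HasCompactSupport (g' : EuclideanSpace ℝ (Fin 4) → ℂ) ∧
        HasCompactSupport (h' : EuclideanSpace ℝ (Fin 4) → ℂ) ∧
        tsupport (f' : EuclideanSpace ℝ (Fin 4) → ℂ) ⊆ tsupport (f : EuclideanSpace ℝ (Fin 4) → ℂ) ∧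
        tsupport (g' : EuclideanSpace ℝ (Fin 4) → ℂ) ⊆ tsupport (g : EuclideanSpace ℝ (Fin 4) → ℂ) ∧
        tsupport (h' : EuclideanSpace ℝ (Fin 4) → ℂ) ⊆ tsupport (h : EuclideanSpace ℝ (Fin 4) → ℂ) ∧
        S₁ 3 (SchwartzMap.tensorFin 3 ![f', g', h']) -
            S₁ 1 (SchwartzMap.tensorFin 1 ![f']) * S₁ 2 (SchwartzMap.tensorFin 2 ![g', h']) -
          S₁ 1 (SchwartzMap.tensorFin 1 ![g']) * S₁ 2 (SchwartzMap.tensorFin 2 ![f', h']) -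
          S₁ 1 (SchwartzMap.tensorFin 1 ![h']) * S₁ 2 (SchwartzMap.tensorFin 2 ![f', g']) +
          2 * (S₁ 1 (SchwartzMap.tensorFin 1 ![f']) * S₁ 1 (SchwartzMap.tensorFin 1 ![g']) *
            S₁ 1 (SchwartzMap.tensorFin 1 ![h'])) ≠ 0 :=
  -- LANDED p147763 (wave 1, lead c7)
  _root_.Summit.QuantumFields.YangMills.Theorems.WeakCouplingHypercubicLimit.TraceNormColdPressure.stub_compactOfDisjoint

/-- `stub_localiseOfCompact` (N2b, r15; L — CONTINUUM) — **non-Gaussianity localises to three small, well-separated balls.**  For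
compactly supported pairwise-disjoint `f, g, h` with `κ₃ ≠ 0`: the three supports are at mutual distance `≥ δ₀ > 0`
(`Disjoint.exists_cthickenings` / compactness); with `ρ := δ₀/12`, a finite smooth partition of unity `Σᵢ χᵢ = 1` on `tsupport f` subordinate
to balls `ball xᵢ ρ`, `xᵢ ∈ tsupport f` (`SmoothPartitionOfUnity.exists_isSubordinate` on `𝓘(ℝ, E4)`, or by hand: bumps `φᵢ` and
`χᵢ := φᵢ · η(Σⱼ φⱼ)` with a smooth `η`, `η(t) = 1/t` for `t ≥ 1`) gives `f = Σᵢ χᵢ • f` in `𝓢` (`SchwartzMap.smulLeftCLM`,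
`HasCompactSupport.hasTemperateGrowth`); `κ₃` is LINEAR in each slot (`SchwartzMap.tensorFin_apply` + `map_sum`), so some piece keeps
`κ₃ ≠ 0` (`Finset.exists_ne_zero_of_sum_ne_zero`); repeat for `g`, `h`.  Centres lie in the original supports, hence are `≥ 12ρ` apart. [folklore] -/
theorem stub_localiseOfCompact :
    ∀ (S₁ : SchwingerFamily (EuclideanSpace ℝ (Fin 4))) (f g h : 𝓢(EuclideanSpace ℝ (Fin 4), ℂ)),
      HasCompactSupport (f : EuclideanSpace ℝ (Fin 4) → ℂ) → HasCompactSupport (g : EuclideanSpace ℝ (Fin 4) → ℂ) →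
      HasCompactSupport (h : EuclideanSpace ℝ (Fin 4) → ℂ) →
      Disjoint (tsupport (f : EuclideanSpace ℝ (Fin 4) → ℂ)) (tsupport (g : EuclideanSpace ℝ (Fin 4) → ℂ)) →
      Disjoint (tsupport (f : EuclideanSpace ℝ (Fin 4) → ℂ)) (tsupport (h : EuclideanSpace ℝ (Fin 4) → ℂ)) →
      Disjoint (tsupport (g : EuclideanSpace ℝ (Fin 4) → ℂ)) (tsupport (h : EuclideanSpace ℝ (Fin 4) → ℂ)) →
      S₁ 3 (SchwartzMap.tensorFin 3 ![f, g, h]) -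
            S₁ 1 (SchwartzMap.tensorFin 1 ![f]) * S₁ 2 (SchwartzMap.tensorFin 2 ![g, h]) -
          S₁ 1 (SchwartzMap.tensorFin 1 ![g]) * S₁ 2 (SchwartzMap.tensorFin 2 ![f, h]) -
          S₁ 1 (SchwartzMap.tensorFin 1 ![h]) * S₁ 2 (SchwartzMap.tensorFin 2 ![f, g]) +
          2 * (S₁ 1 (SchwartzMap.tensorFin 1 ![f]) * S₁ 1 (SchwartzMap.tensorFin 1 ![g]) *
            S₁ 1 (SchwartzMap.tensorFin 1 ![h])) ≠ 0 →
      ∃ (f' g' h' : 𝓢(EuclideanSpace ℝ (Fin 4), ℂ)) (p q w : EuclideanSpace ℝ (Fin 4)) (ρ : ℝ), 0 < ρ ∧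
        tsupport (f' : EuclideanSpace ℝ (Fin 4) → ℂ) ⊆ Metric.closedBall p ρ ∧
        tsupport (g' : EuclideanSpace ℝ (Fin 4) → ℂ) ⊆ Metric.closedBall q ρ ∧
        tsupport (h' : EuclideanSpace ℝ (Fin 4) → ℂ) ⊆ Metric.closedBall w ρ ∧
        10 * ρ ≤ dist p q ∧ 10 * ρ ≤ dist p w ∧ 10 * ρ ≤ dist q w ∧
        S₁ 3 (SchwartzMap.tensorFin 3 ![f', g', h']) -
            S₁ 1 (SchwartzMap.tensorFin 1 ![f']) * S₁ 2 (SchwartzMap.tensorFin 2 ![g', h']) -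
          S₁ 1 (SchwartzMap.tensorFin 1 ![g']) * S₁ 2 (SchwartzMap.tensorFin 2 ![f', h']) -
          S₁ 1 (SchwartzMap.tensorFin 1 ![h']) * S₁ 2 (SchwartzMap.tensorFin 2 ![f', g']) +
          2 * (S₁ 1 (SchwartzMap.tensorFin 1 ![f']) * S₁ 1 (SchwartzMap.tensorFin 1 ![g']) *
            S₁ 1 (SchwartzMap.tensorFin 1 ![h'])) ≠ 0 :=
  -- LANDED p147984 (wave 1, lead c7)
  _root_.Summit.QuantumFields.YangMills.Theorems.WeakCouplingHypercubicLimit.TraceNormColdPressure.stub_localiseOfCompact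

/-- `stub_separatingCoordinate` (N3a, r15; S — elementary geometry of `ℝ⁴`) — **three `ρ`-balls with `10ρ`-separated centres are
split by a coordinate hyperplane: one ball strictly on one side, the other two strictly on the other.**  If in every coordinate neither the
minimum nor the maximum of `{p m, q m, w m}` were isolated by more than `2ρ`, all three values would lie within `4ρ`, so
`dist p q ≤ 2 · 4ρ < 10ρ` (`EuclideanSpace.dist_eq`, four coordinates). [folklore] -/
theorem stub_separatingCoordinate :
    ∀ (p q w : EuclideanSpace ℝ (Fin 4)) (ρ : ℝ), 0 < ρ → 10 * ρ ≤ dist p q → 10 * ρ ≤ dist p w → 10 * ρ ≤ dist q w →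
      ∃ (m : Fin 4) (c : ℝ),
        (p m + ρ < c ∧ c + ρ < q m ∧ c + ρ < w m) ∨ (c + ρ < p m ∧ q m + ρ < c ∧ w m + ρ < c) ∨
        (q m + ρ < c ∧ c + ρ < p m ∧ c + ρ < w m) ∨ (c + ρ < q m ∧ p m + ρ < c ∧ w m + ρ < c) ∨
        (w m + ρ < c ∧ c + ρ < p m ∧ c + ρ < q m) ∨ (c + ρ < w m ∧ p m + ρ < c ∧ q m + ρ < c) :=
  -- LANDED p147785 (wave 1, lead c7)
  _root_.Summit.QuantumFields.YangMills.Theorems.WeakCouplingHypercubicLimit.TraceNormColdPressure.stub_separatingCoordinate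

/-- `stub_timeSeparatedOfSeparated` (N3b, r15; M/L — CONTINUUM) — **Euclidean symmetry puts a coordinate-separated triple into
time-separated position.**  For a one-field family `S₁` that is symmetric (E3), translation invariant and signed-permutation (`W(B₄)`)
invariant on `⁰𝒮`, and a PAIRWISE-DISJOINT triple supported in `ρ`-balls around `p, q, w` split by the hyperplane `{y_m = c}` as in N3a
(registry r15b: the three `Disjoint` hypotheses added — without them the stub fails for `g = h`), with `κ₃ ≠ 0`:
relabel by E3 so that the isolated function comes first (`IsTensorOf.permTest`, `permTest` on `tensorFin`), move axis `m` to axis `0` and fix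
the sign by a signed permutation `R` (`LinearIsometryEquiv.piLpCongrLeft` / `timeReflection 4`; `linActMulti R (tensorFin n v) = tensorFin n (linActTest R ∘ v)`),
translate by `c e₀` (`translateMulti_tensorFin`); supports land in `{y 0 < 0}` / `{0 < y 0}` (preimages of balls), the tensors stay
off-diagonal (disjoint supports), and each `S₁`-term of `κ₃` is unchanged by the three invariances (arity one: `IsOffDiagonal` is vacuous).
Conclusion in the witness form consumed by `stub_ntOfSkewSeparated`. [folklore] -/
theorem stub_timeSeparatedOfSeparated :
    ∀ (S₁ : SchwingerFamily (EuclideanSpace ℝ (Fin 4))),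
      (∀ (n : ℕ) (π : Equiv.Perm (Fin n)) (F : 𝓢((Fin n → EuclideanSpace ℝ (Fin 4)), ℂ)), IsOffDiagonal F →
        S₁ n (permTest π F) = S₁ n F) →
      (∀ (n : ℕ) (a : EuclideanSpace ℝ (Fin 4)) (F : 𝓢((Fin n → EuclideanSpace ℝ (Fin 4)), ℂ)), IsOffDiagonal F →
        S₁ n (translateMulti a F) = S₁ n F) →
      (∀ (n : ℕ) (R : EuclideanSpace ℝ (Fin 4) ≃ₗᵢ[ℝ] EuclideanSpace ℝ (Fin 4)),
        (∀ i : Fin 4, ∃ j : Fin 4, R (EuclideanSpace.single i 1) = EuclideanSpace.single j 1 ∨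
          R (EuclideanSpace.single i 1) = -EuclideanSpace.single j 1) →
        ∀ F : 𝓢((Fin n → EuclideanSpace ℝ (Fin 4)), ℂ), IsOffDiagonal F → S₁ n (linActMulti R F) = S₁ n F) →
      ∀ (f g h : 𝓢(EuclideanSpace ℝ (Fin 4), ℂ)) (p q w : EuclideanSpace ℝ (Fin 4)) (ρ : ℝ), 0 < ρ →
        tsupport (f : EuclideanSpace ℝ (Fin 4) → ℂ) ⊆ Metric.closedBall p ρ →
        tsupport (g : EuclideanSpace ℝ (Fin 4) → ℂ) ⊆ Metric.closedBall q ρ →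
        tsupport (h : EuclideanSpace ℝ (Fin 4) → ℂ) ⊆ Metric.closedBall w ρ →
        Disjoint (tsupport (f : EuclideanSpace ℝ (Fin 4) → ℂ)) (tsupport (g : EuclideanSpace ℝ (Fin 4) → ℂ)) →
        Disjoint (tsupport (f : EuclideanSpace ℝ (Fin 4) → ℂ)) (tsupport (h : EuclideanSpace ℝ (Fin 4) → ℂ)) →
        Disjoint (tsupport (g : EuclideanSpace ℝ (Fin 4) → ℂ)) (tsupport (h : EuclideanSpace ℝ (Fin 4) → ℂ)) →
        ∀ (m : Fin 4) (c : ℝ),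
          ((p m + ρ < c ∧ c + ρ < q m ∧ c + ρ < w m) ∨ (c + ρ < p m ∧ q m + ρ < c ∧ w m + ρ < c) ∨
            (q m + ρ < c ∧ c + ρ < p m ∧ c + ρ < w m) ∨ (c + ρ < q m ∧ p m + ρ < c ∧ w m + ρ < c) ∨
            (w m + ρ < c ∧ c + ρ < p m ∧ c + ρ < q m) ∨ (c + ρ < w m ∧ p m + ρ < c ∧ q m + ρ < c)) →
        S₁ 3 (SchwartzMap.tensorFin 3 ![f, g, h]) -
              S₁ 1 (SchwartzMap.tensorFin 1 ![f]) * S₁ 2 (SchwartzMap.tensorFin 2 ![g, h]) -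
            S₁ 1 (SchwartzMap.tensorFin 1 ![g]) * S₁ 2 (SchwartzMap.tensorFin 2 ![f, h]) -
            S₁ 1 (SchwartzMap.tensorFin 1 ![h]) * S₁ 2 (SchwartzMap.tensorFin 2 ![f, g]) +
            2 * (S₁ 1 (SchwartzMap.tensorFin 1 ![f]) * S₁ 1 (SchwartzMap.tensorFin 1 ![g]) *
              S₁ 1 (SchwartzMap.tensorFin 1 ![h])) ≠ 0 →
        ∃ (f' g' h' : 𝓢(EuclideanSpace ℝ (Fin 4), ℂ)) (Ffgh : 𝓢((Fin 3 → EuclideanSpace ℝ (Fin 4)), ℂ))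
          (Fgh Ffh Ffg : 𝓢((Fin 2 → EuclideanSpace ℝ (Fin 4)), ℂ)) (Ff Fg Fh : 𝓢((Fin 1 → EuclideanSpace ℝ (Fin 4)), ℂ)),
          tsupport (f' : EuclideanSpace ℝ (Fin 4) → ℂ) ⊆ {y : EuclideanSpace ℝ (Fin 4) | y 0 < 0} ∧
          tsupport (g' : EuclideanSpace ℝ (Fin 4) → ℂ) ⊆ {y : EuclideanSpace ℝ (Fin 4) | 0 < y 0} ∧
          tsupport (h' : EuclideanSpace ℝ (Fin 4) → ℂ) ⊆ {y : EuclideanSpace ℝ (Fin 4) | 0 < y 0} ∧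
          IsOffDiagonal Fgh ∧ IsTensorOf Ffgh ![f', g', h'] ∧ IsOffDiagonal Ffgh ∧ IsTensorOf Fgh ![g', h'] ∧
          IsTensorOf Ffh ![f', h'] ∧ IsTensorOf Ffg ![f', g'] ∧ IsTensorOf Ff ![f'] ∧ IsTensorOf Fg ![g'] ∧ IsTensorOf Fh ![h'] ∧
          S₁.toLabelled 3 (fun _ => ()) Ffgh - S₁.toLabelled 1 (fun _ => ()) Ff * S₁.toLabelled 2 (fun _ => ()) Fgh -
            S₁.toLabelled 1 (fun _ => ()) Fg * S₁.toLabelled 2 (fun _ => ()) Ffh -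
            S₁.toLabelled 1 (fun _ => ()) Fh * S₁.toLabelled 2 (fun _ => ()) Ffg +
            2 * (S₁.toLabelled 1 (fun _ => ()) Ff * S₁.toLabelled 1 (fun _ => ()) Fg * S₁.toLabelled 1 (fun _ => ()) Fh) ≠ 0 :=
  -- LANDED p147332 (wave 1, lead c7)
  _root_.Summit.QuantumFields.YangMills.Theorems.WeakCouplingHypercubicLimit.TraceNormColdPressure.stub_timeSeparatedOfSeparated

/-- `stub_rpCoreDisjoint` (S6i, r15) — **THE HEART (OPEN): the DISJOINT RP core of stmt-16120 / stmt-16154** — the r14 RP core with its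
non-Gaussianity floor in PAIRWISE-DISJOINT geometry (`IRInputs` (d) VERBATIM: `f, g, h` real with pairwise disjoint supports, no half-space
conditions).  For every compact simple `G`: a faithful unitary `r` and a Wilson scheme AT WEAK COUPLING with polynomial volume growth and
polynomial multiplicative renormalisation of the curvature, along which (UV) `UniformFunctionalBoundPlanes r sch`, (IR) ONE clustering
statement `RPSpectral r sch Δ C` at some rate `Δ > 0`, and (NG) ONE `κ₃` floor on SOME pairwise-disjoint real triple.  The time
separation the non-triviality argument needs is now PRODUCED (N1–N3: compact cut-off, partition of unity, coordinate separation, Euclidean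
symmetry of the limit).  This is the Clay existence-and-gap content in lattice terms; FALSE for `U(1)₄`, excluded at bounded `β` by the
weak-coupling clause, invisible to perturbation theory. -/
theorem stub_rpCoreDisjoint :
    ∀ (G : Type) [Group G] [TopologicalSpace G] [IsTopologicalGroup G] [CompactSpace G]
      [MeasurableSpace G] [BorelSpace G], IsCompactSimpleLieGroup G →
      ∃ (r : LatticeRep G) (sch : SpeciesScheme (YMSpecies G)),
        sch.HasWeakCouplingLimit ∧ PolyVolume sch ∧ PolyRenorm r sch ∧ UniformFunctionalBoundPlanes r sch ∧
        (∃ Δ C : ℝ, 0 < Δ ∧ RPSpectral r sch Δ C) ∧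
        (∃ (f g h : 𝓢(EuclideanSpace ℝ (Fin 4), ℝ)) (δ : ℝ),
          Disjoint (tsupport f) (tsupport g) ∧ Disjoint (tsupport f) (tsupport h) ∧
          Disjoint (tsupport g) (tsupport h) ∧ 0 < δ ∧
          ∀ᶠ k in atTop, δ ≤
            |latticeSchwinger r.ρ sch (fun s => s.F) k 3 (fun _ => r.curvature) ![f, g, h] -
              latticeSchwinger r.ρ sch (fun s => s.F) k 1 (fun _ => r.curvature) ![f] *
                latticeSchwinger r.ρ sch (fun s => s.F) k 2 (fun _ => r.curvature) ![g, h] -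
              latticeSchwinger r.ρ sch (fun s => s.F) k 1 (fun _ => r.curvature) ![g] *
                latticeSchwinger r.ρ sch (fun s => s.F) k 2 (fun _ => r.curvature) ![f, h] -
              latticeSchwinger r.ρ sch (fun s => s.F) k 1 (fun _ => r.curvature) ![h] *
                latticeSchwinger r.ρ sch (fun s => s.F) k 2 (fun _ => r.curvature) ![f, g] +
              2 * (latticeSchwinger r.ρ sch (fun s => s.F) k 1 (fun _ => r.curvature) ![f] *
                latticeSchwinger r.ρ sch (fun s => s.F) k 1 (fun _ => r.curvature) ![g] *
                latticeSchwinger r.ρ sch (fun s => s.F) k 1 (fun _ => r.curvature) ![h])|) := by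
  sorry

/-- Monotonicity r14 → r15: the RP core (time-separated `κ₃` floor) implies the disjoint RP core. -/
theorem rpCoreDisjoint_of_rpCore
    (hcore : ∀ (G : Type) [Group G] [TopologicalSpace G] [IsTopologicalGroup G] [CompactSpace G]
      [MeasurableSpace G] [BorelSpace G], IsCompactSimpleLieGroup G →
      ∃ (r : LatticeRep G) (sch : SpeciesScheme (YMSpecies G)),
        sch.HasWeakCouplingLimit ∧ PolyVolume sch ∧ PolyRenorm r sch ∧ UniformFunctionalBoundPlanes r sch ∧
        (∃ Δ C : ℝ, 0 < Δ ∧ RPSpectral r sch Δ C) ∧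
        (∃ (f g h : 𝓢(EuclideanSpace ℝ (Fin 4), ℝ)) (δ : ℝ),
          tsupport f ⊆ {y : EuclideanSpace ℝ (Fin 4) | y 0 < 0} ∧ tsupport g ⊆ {y : EuclideanSpace ℝ (Fin 4) | 0 < y 0} ∧
          tsupport h ⊆ {y : EuclideanSpace ℝ (Fin 4) | 0 < y 0} ∧ Disjoint (tsupport g) (tsupport h) ∧ 0 < δ ∧
          ∀ᶠ k in atTop, δ ≤
            |latticeSchwinger r.ρ sch (fun s => s.F) k 3 (fun _ => r.curvature) ![f, g, h] -
              latticeSchwinger r.ρ sch (fun s => s.F) k 1 (fun _ => r.curvature) ![f] *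
                latticeSchwinger r.ρ sch (fun s => s.F) k 2 (fun _ => r.curvature) ![g, h] -
              latticeSchwinger r.ρ sch (fun s => s.F) k 1 (fun _ => r.curvature) ![g] *
                latticeSchwinger r.ρ sch (fun s => s.F) k 2 (fun _ => r.curvature) ![f, h] -
              latticeSchwinger r.ρ sch (fun s => s.F) k 1 (fun _ => r.curvature) ![h] *
                latticeSchwinger r.ρ sch (fun s => s.F) k 2 (fun _ => r.curvature) ![f, g] +
              2 * (latticeSchwinger r.ρ sch (fun s => s.F) k 1 (fun _ => r.curvature) ![f] *
                latticeSchwinger r.ρ sch (fun s => s.F) k 1 (fun _ => r.curvature) ![g] *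
                latticeSchwinger r.ρ sch (fun s => s.F) k 1 (fun _ => r.curvature) ![h])|)) :
    ∀ (G : Type) [Group G] [TopologicalSpace G] [IsTopologicalGroup G] [CompactSpace G]
      [MeasurableSpace G] [BorelSpace G], IsCompactSimpleLieGroup G →
      ∃ (r : LatticeRep G) (sch : SpeciesScheme (YMSpecies G)),
        sch.HasWeakCouplingLimit ∧ PolyVolume sch ∧ PolyRenorm r sch ∧ UniformFunctionalBoundPlanes r sch ∧
        (∃ Δ C : ℝ, 0 < Δ ∧ RPSpectral r sch Δ C) ∧
        (∃ (f g h : 𝓢(EuclideanSpace ℝ (Fin 4), ℝ)) (δ : ℝ),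
          Disjoint (tsupport f) (tsupport g) ∧ Disjoint (tsupport f) (tsupport h) ∧
          Disjoint (tsupport g) (tsupport h) ∧ 0 < δ ∧
          ∀ᶠ k in atTop, δ ≤
            |latticeSchwinger r.ρ sch (fun s => s.F) k 3 (fun _ => r.curvature) ![f, g, h] -
              latticeSchwinger r.ρ sch (fun s => s.F) k 1 (fun _ => r.curvature) ![f] *
                latticeSchwinger r.ρ sch (fun s => s.F) k 2 (fun _ => r.curvature) ![g, h] -
              latticeSchwinger r.ρ sch (fun s => s.F) k 1 (fun _ => r.curvature) ![g] *
                latticeSchwinger r.ρ sch (fun s => s.F) k 2 (fun _ => r.curvature) ![f, h] -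
              latticeSchwinger r.ρ sch (fun s => s.F) k 1 (fun _ => r.curvature) ![h] *
                latticeSchwinger r.ρ sch (fun s => s.F) k 2 (fun _ => r.curvature) ![f, g] +
              2 * (latticeSchwinger r.ρ sch (fun s => s.F) k 1 (fun _ => r.curvature) ![f] *
                latticeSchwinger r.ρ sch (fun s => s.F) k 1 (fun _ => r.curvature) ![g] *
                latticeSchwinger r.ρ sch (fun s => s.F) k 1 (fun _ => r.curvature) ![h])|) := by
  intro G _ _ _ _ _ _ hG
  obtain ⟨r, sch, hw, hpv, hpr, hUFB, hIR, f, g, h, δ, hf, hg, hh, hgh, hδ, hev⟩ := hcore G hG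
  refine ⟨r, sch, hw, hpv, hpr, hUFB, hIR, f, g, h, δ, ?_, ?_, hgh, hδ, hev⟩
  · exact Set.disjoint_left.2 fun y hyf hyg => lt_asymm (show y 0 < 0 from hf hyf) (show 0 < y 0 from hg hyg)
  · exact Set.disjoint_left.2 fun y hyf hyh => lt_asymm (show y 0 < 0 from hf hyf) (show 0 < y 0 from hh hyh)

end R15

/-! ### §11 Reshape r17 (lead c8, 2026-08-17): the heart has FILED SUPPLIERS — the three lattice items of route `ScalingWindowSplit`

Leads c5/c6/c7 asked the planners to promote the heart; the planners filed it SPLIT along the renormalisation seam as the three crux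
items of route `ScalingWindowSplit` (opened 2026-08-17 02:53Z, rev 8): W₁ `GapAtCorrelationLength` (stmt-QuantumFields-18927 — IR,
`∃`-form, renormalisation-free: weak coupling, polynomial volumes, the volume-uniform lattice gap AND its RP-spectral form, and at ONE
past-supported bump `u` a polynomial floor and a window of the BARE truncated two-point function), U_R `SelfNormalisedMomentBoundsR`
(stmt-QuantumFields-18014 — UV, `∀`-schemes: the `k`-uniform plane-resolved `n!`-moment bounds of the SELF-NORMALISED field
`c'_k = 1/√T⁰_k(u,θu)`, `m'_k = ⟨tr U_p⟩_k`) and W₂ᴳ `SelfNormalisedSkewnessGapped` (stmt-QuantumFields-18170 — NG, `∀` gapped window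
schemes: a `κ₃` floor of the self-normalised field on a pairwise-disjoint triple), with the typed split W₁ → W₂ᴳ → U_R →
`CoincidenceRotationBootstrap.HypercubicLimit` LANDED (`existenceLegFromLatticeGapped_proof`).  V1 below records that the three items
supply THIS line's heart VERBATIM (the seam re-assembled on the tail sub-scheme `subseq canon (· + k₀)`: `PolyRenorm` from the floor,
UFB from the moment bounds by `stub_functionalBoundPlanes`, `RPSpectral` and the `κ₃` floor restricted to the tail), so the crux is
closed from W₁ ∧ U_R ∧ W₂ᴳ through the line (`WeakCouplingHypercubicLimit_ofSWS`).  The heart S6i stays the single OPEN stub: it is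
WEAKER than W₁ ∧ U_R ∧ W₂ᴳ (U_R, W₂ᴳ are `∀`-scheme statements, each already repaired once after a refutation), so keeping it is the
monotone choice; its suppliers are now items, and the line parks on them. -/

-- section R17 (V1 `stub_rpCoreDisjointOfSWS`, LANDED p163229 in `Theorems/PencilRigidityWeakCouplingHypercubicLimitOfScalingWindowSplit.lean`, and the
-- cross-check compositions `WeakCouplingHypercubicLimit_ofSWS` / `…_ofSWS'`) is OMITTED from the FOLD re-registration (line-writer, 2026-08-31): that module's
-- import `Theorems/ScalingWindowSplitExistenceLegFromLattice.lean` no longer elaborates against the current `Theses/ScalingWindowSplit.lean` (rev ≥ 9,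
-- 2026-08-28: unknown identifier `ScalingWindowSplit.ExistenceLegFromLattice`, farm check 2026-08-31T14:45Z), so the hub cannot build it and a skeleton
-- importing it cannot be checked.  V1 was a LANDED sub-goal (supplier bookkeeping: the three lattice items of route `ScalingWindowSplit` ⟹ the heart S6i
-- verbatim), not an open stub: dropping it removes no obligation from this line; the supplier relation stands as recorded in §11 above and returns the
-- moment `…ExistenceLegFromLattice.lean` is repaired (re-import the module and restore the r17 text from `Cruxes/WeakCouplingHypercubicLimit/Lines/Sketch.lean`
-- :1476–1548 verbatim).

end Summit.QuantumFields.YangMills.Cruxes.WeakCouplingHypercubicLimit.TraceNormColdPressure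

/-! ### r16: the r15 assembly is LANDED (p149207) — `Theorems/PencilRigidityWeakCouplingHypercubicLimitOfRpCoreDisjoint.lean`
(`skewSepDatum_of_disjointDatum`, `oneFieldClauses_of_ufbDisjointCore`, `weakCouplingHypercubicLimit_of_rpCoreDisjoint`,
`hypercubicLimit_of_rpCoreDisjoint`). -/

namespace Summit.QuantumFields.YangMills.Cruxes.WeakCouplingHypercubicLimit.TraceNormColdPressure

/-- **Composition (r15).**  The crux `WeakCouplingHypercubicLimit` BY NAME from the DISJOINT RP core S6i `stub_rpCoreDisjoint`:
`weakCouplingHypercubicLimit_of_rpCoreDisjoint` (lattice gap at half the RP-spectral rate K5, rate realigned K1, order-one bound from UFB,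
`oneFieldClauses_of_ufbDisjointCore` = the r12′ closure with the `κ₃` datum passed to the limit in disjoint geometry (N1) and put into
time-separated position by the Euclidean symmetries of the limit (N2a, N2b, N3a, N3b) before `stub_ntOfSkewSeparated`) ⇒ ONE FIELD
SUFFICES ⇒ `stub_siblingTie`. -/
theorem WeakCouplingHypercubicLimit_of :
    Summit.QuantumFields.YangMills.Theses.PencilRigidity.WeakCouplingHypercubicLimit :=
  _root_.Summit.QuantumFields.YangMills.Theorems.WeakCouplingHypercubicLimit.TraceNormColdPressure.weakCouplingHypercubicLimit_of_rpCoreDisjoint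
    stub_rpCoreDisjoint

end Summit.QuantumFields.YangMills.Cruxes.WeakCouplingHypercubicLimit.TraceNormColdPressure


/-! ### §12 FOLD (shape F, r18; line-writer `linewriter-16120F-1` g0, 2026-08-31): the crux is `PencilRigidity.WeakCouplingHypercubicLimitRP`
(stmt-QuantumFields-27398) — the old body + the diagonal-frame RP of the curvature channel of THE SAME witness

The heart S6i `stub_rpCoreDisjoint` and its composition idea are unchanged; the new conjunct is threaded through the one-field witness
`(subseq sch φ hφ, planeSum T)` of the landed closure.  Exactly ONE new stub is registered: in v1 (7bf38c709623ad77) it was D1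
`stub_diagRPOfPlaneLimits` — diagonal-frame reflection positivity of the constructed plane-limit family, beside its landed axis twin R3′
`stub_rpPosOfPlaneLimits`; since the ρ1 RESHAPE (v2, 2026-08-31, director-ym g23 O4 WORD 20 (2), bytes critic idea-crit-9 g12) it is the
LATTICE stub D1′ `stub_oddTorusSwapPairingLiminf`, and D1 is the theorem `diagRPOfPlaneLimits_of_stubs` (D1′ + the landed transfer p827255).
Everything else of the delta is ALREADY LANDED by the line-writer (2026-08-31) and cited here by name, exactly as §§1–11 cite their landed stubs:
* `Theorems/PencilRigidityWeakCouplingHypercubicLimitRPOfOneFieldRP.lean` (p825644): the PACKAGING `weakCouplingHypercubicLimitRP_of_oneFieldRP` —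
  one-field weak-coupling witness + `OneFieldClauses` + `DiagonalFrameRP` ⇒ the crux (silence the other species, extend by zero; the new bullet via
  `extendByZero_const`); `…_mmb_of_oneFieldRP` for the MirrorModularBoosts / IsotropyFromPowerCounting twin stmt-27395; `…_mmb_of_pr` (PR copy ⇒ MMB copy);
* `Theorems/PencilRigidityWeakCouplingHypercubicLimitRPOfRpCoreDisjoint.lean` (p825896): `oneFieldClausesRP_of_ufbDisjointCore_of_diagRP` (= the landed
  `oneFieldClauses_of_ufbDisjointCore`, p149207, re-proved VERBATIM with the extra output `DiagonalFrameRP S₁` read off D1 — stated verbatim as a hypothesis —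
  at the constructed `(φ, T)`; needed because the landed statement hides `φ, T` behind `∃ sch' S₁`) and `weakCouplingHypercubicLimitRP_of_diagRP_of_rpCoreDisjoint`
  (D1 ⟹ the DISJOINT RP core, verbatim the statement of S6i ⟹ the crux BY NAME: lattice gap at half the RP-spectral rate K5, rate realigned K1, order-one
  bound from UFB, the lemma above, the packaging);
* `Theorems/WeakCouplingHypercubicLimitRP/Negative/SummitTie.lean` (p825247): ON PATH (`YangMills ⟹` both copies of the crux) and new ⟹ old.
* (v2) `Theorems/PencilRigidityWeakCouplingHypercubicLimitRPSwapPairingPSD.lean` (p827142) and `…RPDiagRPOfSwapPairing.lean` (p827255, lead-27398-D1 g0):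
  the TRANSFER `diagRPOfPlaneLimits_of_swapPairingLiminf` — `UniformFunctionalBoundPlanes r sch → PlaneLimits r sch φ T → OddTorusSwapPairingLiminf r
  (subseq sch φ hφ) → DiagonalFrameRP (planeSum T)` (own-torus swap SYMMETRY of the curvature Gram matrix at every k, convergence along `φ`, E0, frames by
  proper sign flips `stub_signedPermOfPlaneLimits`, density closure, real → complex PSD); `Theorems/DiagonalMirrorRPROddTorusSwapPairingDefs.lean` (p827497,
  hand-2): the socket `def OddTorusSwapPairingLiminf` BY NAME (byte-for-byte §1 of the door-B core).
So the top composition `WeakCouplingHypercubicLimitRP_of := weakCouplingHypercubicLimitRP_of_diagRP_of_rpCoreDisjoint diagRPOfPlaneLimits_of_stubs stub_rpCoreDisjoint`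
(= the kit's `weakCouplingHypercubicLimitRP_of_rpCoreDisjoint stub_rpCoreDisjoint` with D1 made explicit) is the ONLY theorem of this file concluding the
new crux, and it is kernel-checked modulo exactly the two registered stubs S6i and D1′.  Door map for D1′ (line cards of the aside crux `DiagonalMirrorRPR`,
stmt-10604): (B) `Cruxes/DiagonalMirrorRPR/Lines/sign_twisted_diagonal_trace_core.lean` (cruxplan g0, 2026-08-31: `core_of : OddTwistGap → DiagLukewarm →
Growth → OddTorusSwapPairingLiminf r sch`, then convergence + the landed rp-closure p87246–p94527 ⇒ `DiagonalFrameRP S₁`; its letters R1/R2/Growth become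
hypotheses of D1's proof, dischargeable inside the construction from `RPSpectral` + `PolyVolume`/`PolyRenorm`); (A) tilted tori + uniqueness of the
weak-coupling state; (C) full `SO(4)` invariance.  Price ρ1 (critic idea-crit-9 g12, F-KIT ACK 2026-08-31T13:18Z) is carried in D1's docstring. -/

namespace Summit.QuantumFields.YangMills.Cruxes.WeakCouplingHypercubicLimit.TraceNormColdPressure

section R18

open Summit.QuantumFields.YangMills.Cruxes.HypercubicLimit.CouplingResponse
-- The new conjunct for a one-field family = the LANDED decl `…Cruxes.DiagonalMirrorRPR.ParityBridgeColdTraces.DiagonalFrameRP`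
-- (Theorems/PencilRigidityDiagonalMirrorRPRStubRpClosureDefs.lean :69; body = the conjunct verbatim): cited, not restated.
open Summit.QuantumFields.YangMills.Cruxes.DiagonalMirrorRPR.ParityBridgeColdTraces (DiagonalFrameRP)

/-- `stub_oddTorusSwapPairingLiminf` (D1′, ρ1 RESHAPE v2 of D1 — **THE ONE NEW STUB of the FOLD; OPEN**): THE OWN-TORUS SWAP SOCKET OF THE
WITNESS SCHEME ALONG `φ`.  For the witness scheme of the core (weak coupling, `PolyVolume`, `PolyRenorm`, `UniformFunctionalBoundPlanes`, an
RP-spectral gap) and ANY subsequential plane-limit datum `(φ, T)` of it (`PlaneLimits r sch φ T`), the swap-mirror Gram pairings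
`Σ_{i,i'} c_i c_{i'} ⟨∏_j Φ_k(σf_{i,j}) ∏_j Φ_k(f_{i',j})⟩_{φ k}` of compact-support, pairwise-disjoint, half-space `{x₁ < x₀}` real test families
and their swapped mirrors `σf_{i,j}(x) = f_{i,rev j}(swap01 x)` on the scheme's OWN odd tori have `liminf_k ≥ 0`:
`OddTorusSwapPairingLiminf r (subseq sch φ hφ)` — the LANDED def (p827497, `Theorems/DiagonalMirrorRPROddTorusSwapPairingDefs.lean`, = §1 of
`Cruxes/DiagonalMirrorRPR/Lines/sign_twisted_diagonal_trace_core.lean` byte-for-byte), cited BY NAME.  It is EXACTLY the output type of both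
suppliers — door B `core_of : OddTwistGap 𝔪 → DiagLukewarm 𝔪 → Growth → OddTorusSwapPairingLiminf` (kernel-checked in the core; letters
re-homed p827367/`…TwistLettersDefs`; `Growth` in its κ3 form is implied by `PolyRenorm ∧ PolyVolume ∧ UFB`) and door C `pairingLiminf_of_cube`
(mod `CubeDecoupling`) — so the future glue is `exact`.  STRENGTH (honest, critic g12): under the shared hypotheses `UFB ∧ PlaneLimits`, D1′ and
the v1 stub D1 are EQUIVALENT (D1′ ⇒ D1 is the landed transfer p827255; D1 ⇒ D1′ by the same convergence `hconv`: the lattice Gram pairings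
CONVERGE to the continuum OS form, which D1 makes `≥ 0`) — the reshape changes the REGISTER (finite-k Wilson measures, where door B's letters
and cdisprove's witnesses live), not the strength; it is NOT implied by the summit statement or by any landed stub (probes of the critic, v2
bytes post).  The hypothesis list is D1's verbatim (NOT the transfer's minimal `UFB ∧ PlaneLimits`: dropping weak coupling / `PolyRenorm` /
`PolyVolume` / `RPSpectral` would assert swap-socket positivity for arbitrary-coupling schemes, which no door supplies).

v1 TEXT (D1 `stub_diagRPOfPlaneLimits`, kept for the record; now the theorem `diagRPOfPlaneLimits_of_stubs` below): DIAGONAL-FRAME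
REFLECTION POSITIVITY OF THE CONSTRUCTED PLANE-LIMIT FAMILY.  For the witness scheme of the core (weak coupling, `PolyVolume`, `PolyRenorm`,
`UniformFunctionalBoundPlanes`, an RP-spectral gap `RPSpectral r sch Δ C`) and ANY subsequential plane-limit family `T` of it
(`PlaneLimits r sch φ T`, produced by `stub_planeLimits`), the one-field family `planeSum T` is reflection positive in pull-back form
`n ↦ planeSum T n ∘ linActMulti R` for every frame `R` with `R e₀ = a e₀ + b e₁`, `a² = b² = ½` (`DiagonalFrameRP (planeSum T)`).
WITNESS-SPECIFIC (it speaks about the constructed `T` along `φ` of THIS scheme, exactly beside its LANDED axis twin R3′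
`stub_rpPosOfPlaneLimits … : RPPos (planeSum T)`), NOT universal over W₁ data — the over-universality that retired the old crux
`DiagonalMirrorRPR` (stmt-10604, strategist r1) as a staffing target is gone; the hypotheses are exactly the core's (S6i).
CONTENT (honest): 45°-universality / boundary-condition insensitivity of the weak-coupling limit.  A straight 4-torus carries no diagonal
mirror pair (tree negatives `Theorems/DiagonalMirrorRPR/Negative/SquareTorusNotSwapRP`, `…/OddTorusTwist`), so Osterwalder–Seiler
positivity of Wilson's measure does not hand this over the way it hands over `RPPos` along `e₀`.  Doors: (B) sign-twisted diagonal trace on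
the ODD straight torus ⇒ `OddTorusSwapPairingLiminf r sch` ⇒ (convergence + landed rp-closure) `DiagonalFrameRP`, with its letters
`OddTwistGap` / `DiagLukewarm` / `Growth` to be discharged inside the construction from `RPSpectral` + thermodynamics
(`Cruxes/DiagonalMirrorRPR/Lines/sign_twisted_diagonal_trace_core.lean`); (A) 45°-tilted tori `Λ_L^U`, `U = sgn K₁` (a lattice isometry),
which ARE diagonally swap-RP (`Literature/…/TiltedTorusSwapRP`, Fröhlich–Israel–Lieb–Simon 1978 §3) + uniqueness / b.c.-insensitivity of
the infinite-volume state at weak coupling from the volume-uniform gap; (C) full `SO(4)` invariance of the limit (then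
`Theorems/WeakCouplingHypercubicLimitRP/Negative/SummitTie.lean`'s `isReflectionPositive_comp_diagFrame` applies verbatim) — summit-strength.
JUNK-SAFETY: E2 evaluates the family only on `θF* ⊗ F` tensors of time-ordered `F`, i.e. off the coincidence locus, which `linActMulti R`
preserves, and `PlaneLimits`.1 pins `T n q` on `⁰𝒮` by uniqueness of limits — a junk `T` cannot kill the stub (critic g12).
PRICE ρ1 (critic idea-crit-9 g12, registered with this skeleton): this stub is UNIVERSAL over admissible `(r, sch, φ)` while the crux
needs ONE witness; for the axis twin that is harmless (lattice RP scheme-by-scheme), for DIAGONAL RP it is rotation restoration — if a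
scheme-level counterexample appears (an admissible scheme with an anisotropic subsequential plane limit), the repair is a
scheme-selection / isotropy hypothesis taken from the H-line's core (S6i gains a conjunct the construction supplies), NOT abandoning the
FOLD; cdisprove's first regime on this skeleton = «admissible scheme, anisotropic limit».
[conjectural step; OsterwalderSeiler1978 §2; FrohlichIsraelLiebSimon1978 §3 (RP of tilted periodic boxes); Seiler1982; JaffeWitten2000] -/
theorem stub_oddTorusSwapPairingLiminf :
    ∀ (G : Type) [Group G] [TopologicalSpace G] [IsTopologicalGroup G] [CompactSpace G]
      [MeasurableSpace G] [BorelSpace G] (r : LatticeRep G) (sch : SpeciesScheme (YMSpecies G))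
      (φ : ℕ → ℕ) (hφ : StrictMono φ)
      (T : (n : ℕ) → (Fin n → Plane) → (𝓢((Fin n → EuclideanSpace ℝ (Fin 4)), ℂ) →L[ℂ] ℂ)),
      sch.HasWeakCouplingLimit → PolyVolume sch → PolyRenorm r sch → UniformFunctionalBoundPlanes r sch →
        (∃ Δ C : ℝ, 0 < Δ ∧ RPSpectral r sch Δ C) → PlaneLimits r sch φ T →
        Summit.QuantumFields.YangMills.Cruxes.DiagonalMirrorRPR.SignTwistedDiagonalTrace.OddTorusSwapPairingLiminf r
          (subseq sch φ hφ) := by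
  sorry

/-- **D1 (the v1 registered stub `stub_diagRPOfPlaneLimits`, 7bf38c709623ad77 :1618) is a THEOREM modulo D1′**: diagonal-frame reflection
positivity of the constructed plane-limit family `planeSum T`, from the socket D1′ `stub_oddTorusSwapPairingLiminf` by the LANDED transfer
`diagRPOfPlaneLimits_of_swapPairingLiminf` (p827255, lead-27398-D1 g0; its socket hypothesis is the body of `OddTorusSwapPairingLiminf r
(subseq sch φ hφ)` verbatim, matched here by `unfold`).  Statement = v1's D1 VERBATIM, so the landed compositions below apply unchanged. -/
theorem diagRPOfPlaneLimits_of_stubs :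
    ∀ (G : Type) [Group G] [TopologicalSpace G] [IsTopologicalGroup G] [CompactSpace G]
      [MeasurableSpace G] [BorelSpace G] (r : LatticeRep G) (sch : SpeciesScheme (YMSpecies G))
      (φ : ℕ → ℕ) (hφ : StrictMono φ)
      (T : (n : ℕ) → (Fin n → Plane) → (𝓢((Fin n → EuclideanSpace ℝ (Fin 4)), ℂ) →L[ℂ] ℂ)),
      sch.HasWeakCouplingLimit → PolyVolume sch → PolyRenorm r sch → UniformFunctionalBoundPlanes r sch →
        (∃ Δ C : ℝ, 0 < Δ ∧ RPSpectral r sch Δ C) → PlaneLimits r sch φ T → DiagonalFrameRP (planeSum T) := by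
  intro G _ _ _ _ _ _ r sch φ hφ T hw hpv hpr hufb hgap hpl
  have hsock := stub_oddTorusSwapPairingLiminf G r sch φ hφ T hw hpv hpr hufb hgap hpl
  unfold Summit.QuantumFields.YangMills.Cruxes.DiagonalMirrorRPR.SignTwistedDiagonalTrace.OddTorusSwapPairingLiminf at hsock
  exact _root_.Summit.QuantumFields.YangMills.Theorems.WeakCouplingHypercubicLimit.TraceNormColdPressure.diagRPOfPlaneLimits_of_swapPairingLiminf
    G r sch φ hφ T hufb hpl hsock

/-- **The UFB disjoint core gives a weak-coupling one-field witness WITH diagonal-frame RP** (r18) — LANDED in D1-parametric form as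
`oneFieldClausesRP_of_ufbDisjointCore_of_diagRP` (p825896, `Theorems/PencilRigidityWeakCouplingHypercubicLimitRPOfRpCoreDisjoint.lean`: the landed
`oneFieldClauses_of_ufbDisjointCore` re-proved verbatim with the extra output read off D1 at the constructed `(φ, T)`); here instantiated at the stub D1. -/
theorem oneFieldClausesRP_of_ufbDisjointCore
    {G : Type} [Group G] [TopologicalSpace G] [IsTopologicalGroup G] [CompactSpace G] [MeasurableSpace G] [BorelSpace G]
    (r : LatticeRep G) (sch : SpeciesScheme (YMSpecies G))
    (hw : sch.HasWeakCouplingLimit) (hpv : PolyVolume sch) (hpr : PolyRenorm r sch) (hUFB : UniformFunctionalBoundPlanes r sch)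
    (hM1 : ∃ (s : ℕ) (C : ℝ), ∀ F : Plane → 𝓢(EuclideanSpace ℝ (Fin 4), ℝ), normP s F ≤ 1 →
      ∀ k : ℕ, |∫ U, fieldP r sch k F U ∂(wilsonAt r sch k)| ≤ C)
    {Δ C : ℝ} (hΔ : 0 < Δ) (hgap : HasLatticeMassGap r sch Δ) (hrp : RPSpectral r sch Δ C)
    (hNG : ∃ (f g h : 𝓢(EuclideanSpace ℝ (Fin 4), ℝ)) (δ : ℝ),
        Disjoint (tsupport f) (tsupport g) ∧ Disjoint (tsupport f) (tsupport h) ∧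
        Disjoint (tsupport g) (tsupport h) ∧ 0 < δ ∧
        ∀ᶠ k in atTop, δ ≤
          |latticeSchwinger r.ρ sch (fun s => s.F) k 3 (fun _ => r.curvature) ![f, g, h] -
            latticeSchwinger r.ρ sch (fun s => s.F) k 1 (fun _ => r.curvature) ![f] *
              latticeSchwinger r.ρ sch (fun s => s.F) k 2 (fun _ => r.curvature) ![g, h] -
            latticeSchwinger r.ρ sch (fun s => s.F) k 1 (fun _ => r.curvature) ![g] *
              latticeSchwinger r.ρ sch (fun s => s.F) k 2 (fun _ => r.curvature) ![f, h] -
            latticeSchwinger r.ρ sch (fun s => s.F) k 1 (fun _ => r.curvature) ![h] *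
              latticeSchwinger r.ρ sch (fun s => s.F) k 2 (fun _ => r.curvature) ![f, g] +
            2 * (latticeSchwinger r.ρ sch (fun s => s.F) k 1 (fun _ => r.curvature) ![f] *
              latticeSchwinger r.ρ sch (fun s => s.F) k 1 (fun _ => r.curvature) ![g] *
              latticeSchwinger r.ρ sch (fun s => s.F) k 1 (fun _ => r.curvature) ![h])|) :
    ∃ (sch' : SpeciesScheme (YMSpecies G)) (S₁ : SchwingerFamily (EuclideanSpace ℝ (Fin 4))),
      sch'.HasWeakCouplingLimit ∧ OneFieldClauses r sch' S₁ ∧ DiagonalFrameRP S₁ :=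
  -- LANDED p825896 (line-writer, 2026-08-31), D1-parametric; instantiated at D1 = `diagRPOfPlaneLimits_of_stubs` (v2; v1: the stub)
  _root_.Summit.QuantumFields.YangMills.Theorems.WeakCouplingHypercubicLimit.TraceNormColdPressure.oneFieldClausesRP_of_ufbDisjointCore_of_diagRP
    diagRPOfPlaneLimits_of_stubs r sch hw hpv hpr hUFB hM1 hΔ hgap hrp hNG

end R18

end Summit.QuantumFields.YangMills.Cruxes.WeakCouplingHypercubicLimit.TraceNormColdPressure

namespace Summit.QuantumFields.YangMills.Cruxes.WeakCouplingHypercubicLimit.TraceNormColdPressure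

/-- **TOP COMPOSITION (r18, FOLD).**  The crux `PencilRigidity.WeakCouplingHypercubicLimitRP` (stmt-QuantumFields-27398) BY NAME from its
two open stubs — the DISJOINT RP core S6i `stub_rpCoreDisjoint` and (v2) the own-torus swap socket D1′ `stub_oddTorusSwapPairingLiminf`, through
D1 `diagRPOfPlaneLimits_of_stubs` (diagonal-frame RP of the constructed witness, = D1′ + the landed transfer p827255) —
through the LANDED closure `weakCouplingHypercubicLimitRP_of_diagRP_of_rpCoreDisjoint` (p825896: the r15 chain `stub_gapOfRPSpectral`,
`stub_rpSpectralAnti`, `momentOne_of_ufb`, the one-field closure with the `κ₃` datum in disjoint geometry and time-separated by symmetry, with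
ONE more output threaded through, then the landed one-field packaging p825644).  (= the kit's `weakCouplingHypercubicLimitRP_of_rpCoreDisjoint
stub_rpCoreDisjoint` with D1 explicit.)  Open stubs: S6i, D1′. -/
theorem WeakCouplingHypercubicLimitRP_of :
    Summit.QuantumFields.YangMills.Theses.PencilRigidity.WeakCouplingHypercubicLimitRP :=
  _root_.Summit.QuantumFields.YangMills.Theorems.WeakCouplingHypercubicLimit.TraceNormColdPressure.weakCouplingHypercubicLimitRP_of_diagRP_of_rpCoreDisjoint
    diagRPOfPlaneLimits_of_stubs stub_rpCoreDisjoint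

end Summit.QuantumFields.YangMills.Cruxes.WeakCouplingHypercubicLimit.TraceNormColdPressure

end
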